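import Literature.MathematicalPhysics.QuantumFieldTheory.Balaban1983to89.B9SectCDiffExpansion

/-!
# `Balaban1983to89.B9SectCDiffEstimate` — the ESTIMATE half of THEOREM D: the block majorant of the intertwining
defect `𝔇(QGQ*)` of two local multiscale propagator systems has the (1.12)-shape (cell record
`b2b-balaban-r1/SectC-diff-proof.md` §6 (iv); the typed instance over `B9SectCDiffExpansion.TwoSeq.dT_flat`)

B9 = T. Bałaban, *Propagators for lattice gauge theories in a background field*, Commun. Math. Phys. **99**, 389–434
(1985) [Balaban1985BackgroundPropagators]; [4] of B9 = B6 = T. Bałaban, *Propagators and renormalization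
transformations for lattice gauge theories. II*, Commun. Math. Phys. **96**, 223–250 (1984) [Balaban1984PropagatorsII];
[2] of B9 = B4 = T. Bałaban, Commun. Math. Phys. **89**, 571–597 (1983) [Balaban1983RegularityDecay].

CITATION HEADER (lean-in-tree rule 2026-08-18).  Cell `pub-balaban`, unit `b2b-balaban-r1-g11` (READER GROUP A,
lineage r1, gen 11), journal claim `SECTC-DIFF-ESTIMATE` (v1 p183275; v1.1 p183331 = claim `SECTC-DIFF-INST-HELPERS`: + §5, append-only; v1.2 = claim `SECTC-DIFF-E-TWIN`: + §6 append-only + two doc fixes) (item (T1b) of `b2b-balaban-r1/g10/BRIEF-gen11.md`; third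
node of the lineage's THEOREM D chain: `…B9SectCDiff` v1.3 p182740 (mechanism, one product), `…B9SectCDiffExpansion`
v1.1 p182741 (the algebraic half: the term list `TwoSeq.dT_flat`), THIS MODULE (the estimate half)).  Source B9:
doi:10.1007/bf01240355, held `paper:balaban1985-cmp99-background-propagators`, journal page = PDF page + 388.  The
quotation of Theorem 3.1 (3.42) below was read from the page render
`run/shared/lean/pub/pub-balaban/b2b-balaban-ref1/pages/1985-cmp99-background-propagators/
1985-cmp99-background-propagators-p009-x2.png` (p. 397) AS AN IMAGE by this unit; the p. 412 and pp. 413–414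
quotations are the ones of `…B9SectCDiff` (same lineage; renders `…-p024-x2.png`, `…-p025-x2.png`, `…-p026-x2.png`
read as images there), repeated here only as far as this module uses them; (2.60) of [4] is quoted in
`B6RandomWalk.Ineq260` (p. 234) and enters here only as the SHAPE of hypothesis `Frame.Valid.htr`.  Cell rows: GAPS
G-B9-05 (p. 412: the transfer of [2]'s difference-of-propagators estimate (1.11)/(1.12) to the local multiscale
propagators, asserted by reference), its repair row G-B9-05R (THEOREM D; residual (iv) "the assembled instance is not
typed": `…B9SectCDiffExpansion` typed the algebraic half, THIS MODULE the estimate half), C-r1g11-1; INTERFACES-A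
IF-A-33; DIVERGENCE D-r1g10.1 (rate) continued as D-r1g11.1 below.  Tree inputs (by name): `B9SectCDiffExpansion.TwoSeq`
with `dT_flat` (the sixteen monomials) and `core_entry`; `B9SectCDiff.cutX`; `B6DomainChange.Profile`, `IsDepth`;
`B4Sect5Torus.IsPseudoDist`.  Mathlib otherwise.  No `HarnessLib` fact, no named-fact `Prop`, no `sorry`.

## THE PRINTED TEXT (verbatim)

B9 p. 397 [PDF 9], Theorem 3.1: *"There exist positive constants M₁, δ₀, a₀, B₀ dependent on d and L only, a constant
B₀(β) dependent on d, L and β, 0 ≤ β < 1 (B₀(β) → ∞ if β → 1), such that for M ≥ M₁ and for an arbitrary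
configuration U satisfying the regularity condition (3.35) with Mα₀ ≤ a₀, the operator G′(U) (a = 1) satisfies the
inequalities |(G′(U)λ)(x)|, |(∇_U G′(U)λ)(x)|, |(G′(U)∇*_U λ)(x)|, |(Δ_U G′(U)λ)(x)| ≤ B₀[(Lʲη)², Lʲη, Lʲη, 1]
e^{−δ₀d(y,y′)}|λ| for x ∈ Δ(y), y ∈ Λ_j, supp λ ⊂ Δ(y′); (3.42)"* — a BLOCK bound: sup over the observation block
`Δ(y)` against the sup norm of a source supported in the block `Δ(y′)`, with the scale weight `(Lʲη)²` read at the
OBSERVATION block; this is literally the `ℓ∞ → ℓ∞` block-majorant statement `BlkMaj` + `WDec` of §1–§2 below (row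
= fine point `x`, column block `J = Δ(y′)`, weight `sc(y)ᵏ` at the row block).  B9 p. 412 [PDF 24] (Sect. C, after
(3.97)): *"We have proved in [2] that if we have a difference of propagators defined on two domains, then in an
estimate of this difference we have, besides the usual factors connected with propagators of a considered type, an
exponential factor with a distance between localizations and a closest point where a change was made. Such
inequalities were proved using only the random walk expansions, hence they are valid for all propagators we have
considered in [4]. […] Hence, they are valid in the considered case, and the differences □̃Q′(G′²_{□₀} − G′²_□)Q′*□
can be estimated by the usual factors multiplied by e^{−2δ₀M}."*; same page, on the preceding term: *"The commutator
in the first term gives O(M⁻¹)."*  B9 pp. 413–414 [PDF 25–26]: *"For covariant derivatives we have (D_μhA_ν)(x) =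
h(x)(D_μA_ν)(x) + (∂_μh)(x)R(U(x, x+ηe_μ))A_ν(x+ηe_μ), (3.100) similarly for adjoint derivatives, hence the
commutators [D*D, h] and [DD*, h] are first order differential operators with coefficients determined by derivatives
of the function h. They are of the order O(M⁻¹), or O(M⁻²), if considered on a proper scale. The operator Δ′ is small
and local by (3.10), hence the commutator [Δ′, h] gives the factor O(M⁻¹) too."*

## WHAT THIS MODULE DOES

§1 `BlkMaj bu bv T K` — block majorants of RECTANGULAR real matrices with respect to two block maps (the matrix form of
`B6RandomWalk.HasMajorant`, which is tied to one `B6.Geometry` carrier and `Module.End`): `Σ_{x′ ∈ block J}|T x x′| ≤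
K(bu x, J)`; closed under `+`, `−`, `·` (`BlkMaj.mul`: `K_S·K_T` majorises `S·T`).  All estimates of this module are
stated at this level, so the fine lattice spacing never enters a constant (record O5: η-uniformity lives at the
block-majorant level only).

§2 The weighted-decay calculus on block kernels over a pseudo-distance `ρ` with a depth function `β` (`IsDepth`: the
distance to the modification zone) and block positions: `WDec` (= the (3.42)/(3.48)-type bound `c·ω(y)·e^{−δρ(y,y′)}`),
`WShp` (= the (1.12)-type bound `ε·ω(y)·e^{−δ(ρ(y,y′)+β(y)+β(y′))}`), `RowZone` (rows supported in the zone `β = 0`),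
`Transfer` (slow variation of a weight: `ω(b) ≤ Λω(a)e^{κρ(a,b)}`, the shape of (2.60) of [4]); the three product
rules `WDec.mul` (decay · decay, one profile sum, the rate of the RIGHT factor survives after paying the tilt `κ` and a
margin `γ` out of the LEFT factor's rate), `WShp.zone_mul` (zone-supported · decay ⇒ shape, by `IsDepth.lip`: a row in
the zone sees `β(y′) ≤ ρ(y,y′)`), `WShp.fac_mul` (decay · shape ⇒ shape at the SAME rate), and `WShp.of_rowzone`.

§3 `Frame S` = (ρ, β, K, sc, δ₀, u, Λ) with `Frame.Valid` (pseudo-distance, depth, profile bound `K ≥ 0`, `sc > 0`,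
the (2.60)-type transfers of `scᵏ`, `|k| ≤ 8`, with tilt `u` and constant `Λ`, `20u ≤ δ₀`), the rate ladder
`rate n = δ₀ − n·u` and the output rate `σ = (δ₀ − 20u)/2`; the three operator classes `OpDec F bu bv pU pV n k c T`
("𝒟": a block majorant with decay at rate `rate n` and weight `scᵏ` at the row block), `OpShp … k ε T` ("𝒮": shape at
rate `σ`), `OpZon … k θ Z` ("𝒵": decay at rate `δ₀` with rows in the zone), and their product rules `OpDec.fmul`
(level `n ↦ n+2`), `OpShp.zmul`, `OpShp.of_zon`, `OpShp.fmul` (level-free) — each costing the factor `Λ·K(u)`.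

§4 The typed instance.  `EstHyp F X t U₁ U₂` lists, for an abstract two-sequence system `X : TwoSeq` of
`…B9SectCDiffExpansion`, block maps and positions of the two block families, their profiles (P), the sixteen
one-sequence factors of `TwoSeq.dT_flat` in `𝒟(0, k, c)` with the printed scale powers ((M): `G, G′ ↦ 2`; `∂G′, ∂*G,
∇G ↦ 1`; `Q, Q*, Q′, Q′* ↦ 0`; `C = (Q′G′²Q′*)⁻¹ ↦ −4` — (3.42), Thm 3.3, (3.48) per sequence, as HYPOTHESES), and the
local defects in `𝒵(k, θ)` ((L): `𝔇(Q), 𝔇(Q*), 𝔇(Q′), 𝔇(Q′*) ↦ 0`, `𝔇(∂), 𝔇(∂*) ↦ −1`, `𝔇(A) ↦ −2`, and the three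
ONE-SIDED FORMS `𝔇(Λ) = Lm₁∇ + Lm₀`, `∂𝔇(∂*) = Dm₁∇ + Dm₀` (Leibniz (3.100)), `𝔇(Δ′_a) = Am₁∂ + Am₀`, first-order
coefficients in `𝒵(−1, θ)`, zeroth-order in `𝒵(−2, θ)` — print's *"first order differential operators with coefficients
determined by derivatives of the function h … of the order O(M⁻¹), or O(M⁻²), if considered on a proper scale"*).
THEOREM `EstHyp.dT_opShp`: `𝔇(QGQ*) = X.dT ∈ 𝒮(2, 22·θ·(cΛK(u))¹⁵)` between the block bonds of the two sequences;
`EstHyp.dT_entry` (entrywise) and `EstHyp.core_diff_entry`: on the core of the block-bond cutoff,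
`|(Q₁G₁Q*₁)(a,v) − (Q₂G₂Q*₂)(a,v)| ≤ 22θ(cΛK(u))¹⁵ · sc(y_a)² · e^{−σ(ρ(y_a,y_v) + β(y_a) + β(y_v))}` — the usual factor
`sc²e^{−σρ}` of `QGQ*` times the (1.12) factor `e^{−σ(β+β)}` times the commutator size `θ = O(M⁻¹)`.  PROOF (kernel-
checked, generated from the monomial table by `work/gen4.py` of the unit folder and elaborated declaration by
declaration): `EstHyp.dT_split` (= `dT_flat` with the one-sided forms substituted: 22 right-nested monomials, `abel`);
thirteen right chains `EstHyp.chain0 … chain12` (`OpDec.fmul`, levels ≤ 16 ≤ 20); per monomial `EstHyp.shape_m…`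
(`OpShp.zmul`/`of_zon`, then `OpShp.fmul` per left factor, then `OpShp.mono` to the common constant: every monomial has
total scale power 2 and at most 15 one-sequence factors); `OpShp.add/sub` along the sum.

§5 (v1.1, APPEND-ONLY; journal claim `SECTC-DIFF-INST-HELPERS`, same unit) Instantiation helpers for the successor item
(T1c): `BlkMaj.of_opBound` / `BlkMaj.opBound` (the operator form of (3.42) ⇔ `BlkMaj`), `Transfer.of_twoSided`
(two-sided (2.60)-type slow variation of `sc` ⇒ `Frame.Valid.htr`'s transfers of `scᵏ`, `|k| ≤ 8`, with
`(Λ, u) = (Λ₀⁸, 8κ)`; `twoSided_of_expMul` rearranges b06's form), `OpDec.of_parts`, `OpZon.of_parts`, `OpDec.of_abs_le`, `OpZon.of_abs_le` (unit-block operators).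
No v1 declaration is modified.

§6 (v1.2, APPEND-ONLY; journal claim `SECTC-DIFF-E-TWIN`, same unit; cell XREAD b09-g9 request R1) THEOREM D's twin
for the coarse operator `E = Q′G′²Q′*` of (3.97) (the object the b09 consumer chain differences, scale power `k = 4`):
`EstHyp.dE_split` (`TwoSeq.dE_explicit` with the one-sided form of `𝔇(Δ′_a)`: 6 monomials, ≤ 6 factors),
`EstHyp.dE_opShp : OpShp F bS₁ bS₂ p₁ p₂ 4 (6θ(cΛK(u))¹⁵) (𝔇 E)`, `dE_entry`, `core_dE_entry` (on the core of a
cutoff `ψS = cutX f₁ f₂ ψ`: `|E₁(a,v) − E₂(a,v)| ≤ …`, by `B9SectCDiff.sub_eq_neg_tdef_apply`).  v1.2 also fixes two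
doc tokens (cell XREADs pv12-g9 D1: reference [2] of B9 keyed `Balaban1983RegularityDecay`; b09-g9 N1: the
kernel-times-measure reading in `OpDec.of_abs_le`'s docstring); no v1/v1.1 declaration is modified.

## WHAT IS NOT CLAIMED (ABSOLUTE RULE) / DIVERGENCES

(M), (L), (P) and the transfers `Frame.Valid.htr` are HYPOTHESES of `EstHyp` / `Frame.Valid`, not facts: (M) is the
content of Thms 3.1–3.3 / (3.48) of B9 for EACH local sequence (typed elsewhere in the cell as `B9.Thm31and32Printed`,
`B9.Thm33Printed` — cited statements, not proved), (L) is the lattice calculus of (3.88)/(3.100)/(3.104) for the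
smooth cutoffs plus the locality of Q, Q′, ∂, Λ, Δ′, a (record §2), (P) is (2.61)-type block counting, `htr` is (2.60)
of [4] in the form `B6DomainMajorant` uses.  Nothing is asserted about B9's operators themselves; the module is
agnostic of the window □̃, of M, L, η, j: these enter only through θ, c, sc, ρ, β supplied by an instantiation.
D-r1g11.1 (continuation of D-r1g10.1): print's rate for (3.97) is `e^{−2δ₀M}` with the FULL δ₀ (two propagators G′²,
each paying `e^{−δ₀M}`); this module proves, for the ONE-propagator difference 𝔇(QGQ*) of THEOREM D / (H-diff), the
rate `σ = (δ₀ − 20u)/2` in `ρ + β + β` (half of what remains of δ₀ after twenty scale-transfer tilts) — weaker in the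
constant in the exponent, of the same (1.12) functional form; no attempt is made to optimise rates (every chain step
gives up one tilt `u` and one margin `u`; every zone/shape step halves nothing further).  The G′²-difference of (3.97)
itself is the analogous statement for `TwoSeq` restricted to the primed system and is NOT typed here.  Value = kernel
certificate that the record's hypotheses (M)+(L)+(P)+(2.60) imply the (1.12)-shape of the assembled majorant with an
explicit constant — located bookkeeping made checkable, NOT summit progress.
-/

namespace Literature.MathematicalPhysics.QuantumFieldTheory.Balaban1983to89.B9SectCDiffEstimate

open Finset Real Matrix
open B4Sect5Torus (IsPseudoDist)
open B6DomainChange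

/-! ## §1 Block majorants of rectangular matrices (the matrix form of `B6RandomWalk.HasMajorant`) -/

section BlkMaj

variable {u v w U V W : Type*}

/-- **block majorant** of a real matrix `T : u × v` with respect to block maps `bu : u → U`, `bv : v → V`:
a nonnegative `K : U × V` with `Σ_{x' ∈ block J} |T x x'| ≤ K (bu x) J` for every fine row `x` and every column
block `J` — the ℓ∞ → ℓ∞ block bound, i.e. the matrix form of `B6RandomWalk.HasMajorant` (there: `|T μ (x)| ≤
Σ_J K(bu x, J)·sup_{block J}|μ|`), for RECTANGULAR matrices and two different block structures. [folklore] -/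
structure BlkMaj [Fintype v] [DecidableEq V] (bu : u → U) (bv : v → V) (T : Matrix u v ℝ) (K : Matrix U V ℝ) :
    Prop where
  nonneg : ∀ I J, 0 ≤ K I J
  le : ∀ x J, ∑ x' ∈ univ.filter (fun x' => bv x' = J), |T x x'| ≤ K (bu x) J

variable [Fintype v] [DecidableEq V] {bu : u → U} {bv : v → V}

/-- a single entry is bounded by the majorant entry of its blocks [folklore] -/
theorem BlkMaj.entry {T : Matrix u v ℝ} {K : Matrix U V ℝ} (h : BlkMaj bu bv T K) (x : u) (x' : v) :
    |T x x'| ≤ K (bu x) (bv x') := by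
  refine le_trans ?_ (h.le x (bv x'))
  exact single_le_sum (f := fun y => |T x y|) (fun _ _ => abs_nonneg _) (by simp)

/-- majorants add [folklore] -/
theorem BlkMaj.add {S T : Matrix u v ℝ} {K K' : Matrix U V ℝ} (hS : BlkMaj bu bv S K) (hT : BlkMaj bu bv T K') :
    BlkMaj bu bv (S + T) (K + K') where
  nonneg I J := by rw [Matrix.add_apply]; exact add_nonneg (hS.nonneg I J) (hT.nonneg I J)
  le x J := by
    rw [Matrix.add_apply]
    refine le_trans (sum_le_sum fun x' _ => ?_) (le_trans (le_of_eq sum_add_distrib) (add_le_add (hS.le x J) (hT.le x J)))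
    rw [Matrix.add_apply]; exact abs_add_le _ _

/-- [folklore] -/
theorem BlkMaj.neg {T : Matrix u v ℝ} {K : Matrix U V ℝ} (hT : BlkMaj bu bv T K) : BlkMaj bu bv (-T) K where
  nonneg := hT.nonneg
  le x J := by simpa only [Matrix.neg_apply, abs_neg] using hT.le x J

/-- [folklore] -/
theorem BlkMaj.sub {S T : Matrix u v ℝ} {K K' : Matrix U V ℝ} (hS : BlkMaj bu bv S K) (hT : BlkMaj bu bv T K') :
    BlkMaj bu bv (S - T) (K + K') := by
  rw [sub_eq_add_neg]; exact hS.add hT.neg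

/-- identity blocks: an entrywise bound is a block majorant (the form in which the unit-lattice operators `C_c`,
`𝔇(C)` enter) [folklore] -/
theorem BlkMaj.of_abs_le [DecidableEq v] {T : Matrix u v ℝ} {K : Matrix u v ℝ} (h : ∀ x x', |T x x'| ≤ K x x') :
    BlkMaj id id T K where
  nonneg I J := (abs_nonneg _).trans (h I J)
  le x J := by
    have : univ.filter (fun x' : v => id x' = J) = {J} := by ext y; simp
    rw [this, sum_singleton]; exact h x J

/-- **majorants multiply**: `K_S·K_T` majorises `S·T` (regroup the middle sum by blocks). [folklore] -/
theorem BlkMaj.mul [Fintype w] [Fintype V] [DecidableEq W] {bw : w → W} {S : Matrix u v ℝ} {T : Matrix v w ℝ}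
    {KS : Matrix U V ℝ} {KT : Matrix V W ℝ} (hS : BlkMaj bu bv S KS) (hT : BlkMaj bv bw T KT) :
    BlkMaj bu bw (S * T) (KS * KT) where
  nonneg I J := by
    rw [Matrix.mul_apply]; exact sum_nonneg fun L _ => mul_nonneg (hS.nonneg I L) (hT.nonneg L J)
  le x J := by
    have h1 : ∀ x'' ∈ univ.filter (fun x'' => bw x'' = J), |(S * T) x x''| ≤ ∑ x', |S x x'| * |T x' x''| := by
      intro x'' _
      rw [Matrix.mul_apply]
      exact (abs_sum_le_sum_abs _ _).trans (le_of_eq (sum_congr rfl fun _ _ => abs_mul _ _))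
    refine (sum_le_sum h1).trans ?_
    rw [sum_comm]
    have h2 : ∀ x', ∑ x'' ∈ univ.filter (fun x'' => bw x'' = J), |S x x'| * |T x' x''| ≤ |S x x'| * KT (bv x') J := by
      intro x'
      rw [← mul_sum]
      exact mul_le_mul_of_nonneg_left (hT.le x' J) (abs_nonneg _)
    refine (sum_le_sum fun x' _ => h2 x').trans ?_
    have h3 : ∑ x', |S x x'| * KT (bv x') J =
        ∑ L, ∑ x' ∈ univ.filter (fun x' => bv x' = L), |S x x'| * KT L J := by
      rw [← sum_fiberwise_of_maps_to (s := (univ : Finset v)) (t := (univ : Finset V)) (g := bv)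
        (fun _ _ => mem_univ _)]
      refine sum_congr rfl fun L _ => sum_congr rfl fun x' hx' => ?_
      rw [(mem_filter.mp hx').2]
    rw [h3, Matrix.mul_apply]
    refine sum_le_sum fun L _ => ?_
    rw [← sum_mul]
    exact mul_le_mul_of_nonneg_right (hS.le x L) (hT.nonneg L J)

end BlkMaj

/-! ## §2 Scale-weighted decay and (1.12)-shape of kernels, with weight transfer at a free rate -/

section Weighted

variable {S : Type*} {ρ : S → S → ℝ} {β : S → ℝ} {K : ℝ → ℝ}
variable {l m k : Type*}

/-- row-weighted decay: `|A i j| ≤ c·ω(pl i)·e^{−δρ(pl i, pm j)}` — (3.42)/(3.48)-type bounds carry the power of the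
scale `(L^{j(y)}η)` of the ROW block as weight. [cite: Balaban1985BackgroundPropagators, (3.42) p.397] -/
def WDec (ρ : S → S → ℝ) (pl : l → S) (pm : m → S) (ω : S → ℝ) (c δ : ℝ) (A : Matrix l m ℝ) : Prop :=
  ∀ i j, |A i j| ≤ c * ω (pl i) * Real.exp (-(δ * ρ (pl i) (pm j)))

/-- row-weighted (1.12)-shape: `|D i j| ≤ ε·ω(pl i)·e^{−δ(ρ(pl i,pm j) + β(pl i) + β(pm j))}`.
[cite: Balaban1983RegularityDecay, (1.12) p.573] -/
def WShp (ρ : S → S → ℝ) (β : S → ℝ) (pl : l → S) (pm : m → S) (ω : S → ℝ) (ε δ : ℝ) (D : Matrix l m ℝ) :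
    Prop :=
  ∀ i j, |D i j| ≤ ε * ω (pl i) * Real.exp (-(δ * (ρ (pl i) (pm j) + β (pl i) + β (pm j))))

/-- the rows of `Z` live in the cut zone (depth 0) [folklore] -/
def RowZone (β : S → ℝ) (pl : l → S) (Z : Matrix l m ℝ) : Prop := ∀ i j, Z i j ≠ 0 → β (pl i) = 0

/-- weight transfer `ω(b) ≤ Λ·ω(a)·e^{κρ(a,b)}` — the slow variation (2.60) of [4] p. 234 of the scale weights
(`e^{−κd(y,y″)}P(y″) ≤ ΛP(y)`), by which a weight sitting at an inner index of a chain is moved to the outer row at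
the price of a tilt `κ` of one link. [cite: Balaban1984PropagatorsII, (2.60) p.234] -/
def Transfer (ρ : S → S → ℝ) (ω : S → ℝ) (Λ κ : ℝ) : Prop := ∀ a b, ω b ≤ Λ * ω a * Real.exp (κ * ρ a b)

variable {pl : l → S} {pm : m → S} {pk : k → S}

/-- [folklore] -/
theorem WDec.mono {ω : S → ℝ} {c c' δ δ' : ℝ} {A : Matrix l m ℝ} (h : WDec ρ pl pm ω c δ A) (hρ : IsPseudoDist ρ)
    (hω : ∀ a, 0 ≤ ω a) (hc0 : 0 ≤ c) (hc : c ≤ c') (hδ : δ' ≤ δ) : WDec ρ pl pm ω c' δ' A := fun i j => by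
  refine (h i j).trans ?_
  have := B4Sect5Proof.weaken (mul_nonneg hc0 (hω (pl i))) (mul_le_mul_of_nonneg_right hc (hω (pl i))) hδ
    (hρ.nonneg (pl i) (pm j))
  simpa [mul_assoc] using this

/-- [folklore] -/
theorem WShp.mono {ω : S → ℝ} {ε ε' δ δ' : ℝ} {D : Matrix l m ℝ} (h : WShp ρ β pl pm ω ε δ D) (hρ : IsPseudoDist ρ)
    (hβ : IsDepth ρ β) (hω : ∀ a, 0 ≤ ω a) (hε0 : 0 ≤ ε) (hε : ε ≤ ε') (hδ : δ' ≤ δ) :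
    WShp ρ β pl pm ω ε' δ' D := fun i j => by
  refine (h i j).trans ?_
  have := B4Sect5Proof.weaken (mul_nonneg hε0 (hω (pl i))) (mul_le_mul_of_nonneg_right hε (hω (pl i))) hδ
    (add_nonneg (add_nonneg (hρ.nonneg (pl i) (pm j)) (hβ.nonneg (pl i))) (hβ.nonneg (pm j)))
  simpa [mul_assoc] using this

/-- [folklore] -/
theorem WShp.add {ω : S → ℝ} {ε₁ ε₂ δ : ℝ} {D₁ D₂ : Matrix l m ℝ} (h₁ : WShp ρ β pl pm ω ε₁ δ D₁)
    (h₂ : WShp ρ β pl pm ω ε₂ δ D₂) : WShp ρ β pl pm ω (ε₁ + ε₂) δ (D₁ + D₂) := fun i j => by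
  rw [Matrix.add_apply, add_mul, add_mul]
  exact (abs_add_le _ _).trans (add_le_add (h₁ i j) (h₂ i j))

/-- pointwise change of the weight function [folklore] -/
theorem WShp.congr_weight {ω ω' : S → ℝ} {ε δ : ℝ} {D : Matrix l m ℝ} (h : WShp ρ β pl pm ω ε δ D)
    (hω : ∀ a, ω a = ω' a) : WShp ρ β pl pm ω' ε δ D := fun i j => by rw [← hω]; exact h i j

/-- [folklore] -/
theorem WDec.congr_weight {ω ω' : S → ℝ} {c δ : ℝ} {A : Matrix l m ℝ} (h : WDec ρ pl pm ω c δ A)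
    (hω : ∀ a, ω a = ω' a) : WDec ρ pl pm ω' c δ A := fun i j => by rw [← hω]; exact h i j

/-- a zone-supported decaying kernel alone has the shape at half its rate: `β(i) = 0`, `β(j) ≤ ρ(i,j)`. [folklore] -/
theorem WShp.of_rowzone {ω : S → ℝ} {c δ : ℝ} {Z : Matrix l m ℝ} (hρ : IsPseudoDist ρ) (hβ : IsDepth ρ β)
    (hω : ∀ a, 0 ≤ ω a) (hc : 0 ≤ c) (hδ : 0 ≤ δ) (hZ : WDec ρ pl pm ω c δ Z) (hZ0 : RowZone β pl Z) :
    WShp ρ β pl pm ω c (δ / 2) Z := fun i j => by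
  by_cases h0 : Z i j = 0
  · rw [h0, abs_zero]; exact mul_nonneg (mul_nonneg hc (hω _)) (Real.exp_pos _).le
  · have hb : β (pl i) = 0 := hZ0 i j h0
    have h3 : β (pm j) ≤ ρ (pl i) (pm j) := by
      have := hβ.lip (pm j) (pl i); rw [hb, hρ.symm] at this; linarith
    refine (hZ i j).trans (mul_le_mul_of_nonneg_left (Real.exp_le_exp.mpr ?_) (mul_nonneg hc (hω _)))
    rw [hb]; nlinarith [hρ.nonneg (pl i) (pm j)]

/-- **weighted free-rate product, factor on the LEFT** (`A` a rate-`δA` factor, `B` the accumulated product): the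
weight of `B` at the middle index is moved to the row of `A` through `A`'s link (tilt `κ`), the middle sum is paid by
the profile at the margin `γ`, both taken from `δA`: `δ' ≤ δB`, `δ' + κ + γ ≤ δA`. [folklore] -/
theorem WDec.mul [Fintype m] (hρ : IsPseudoDist ρ) (hP : Profile ρ pm K) {ωA ωB : S → ℝ}
    {cA cB δA δB Λ κ γ δ' : ℝ} (hωA : ∀ a, 0 ≤ ωA a) (hωB : ∀ a, 0 ≤ ωB a) (hcA : 0 ≤ cA) (hcB : 0 ≤ cB)
    (hΛ : 0 ≤ Λ) (hγ : 0 < γ) (hδ' : 0 ≤ δ') (hB' : δ' ≤ δB) (hA' : δ' + κ + γ ≤ δA) (hT : Transfer ρ ωB Λ κ)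
    {A : Matrix l m ℝ} {B : Matrix m k ℝ} (hA : WDec ρ pl pm ωA cA δA A) (hB : WDec ρ pm pk ωB cB δB B) :
    WDec ρ pl pk (fun a => ωA a * ωB a) (cA * cB * Λ * K γ) δ' (A * B) := by
  intro i j
  refine (abs_mul_apply_le A B i j).trans ?_
  have hC0 : 0 ≤ cA * cB * Λ * (ωA (pl i) * ωB (pl i)) :=
    mul_nonneg (mul_nonneg (mul_nonneg hcA hcB) hΛ) (mul_nonneg (hωA _) (hωB _))
  set W := cA * cB * Λ * (ωA (pl i) * ωB (pl i)) * Real.exp (-(δ' * ρ (pl i) (pk j))) with hW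
  have hW0 : 0 ≤ W := by rw [hW]; exact mul_nonneg hC0 (Real.exp_pos _).le
  have hterm : ∀ t, |A i t| * |B t j| ≤ W * Real.exp (-(γ * ρ (pl i) (pm t))) := by
    intro t
    have hBt : |B t j| ≤ cB * (Λ * ωB (pl i) * Real.exp (κ * ρ (pl i) (pm t))) *
        Real.exp (-(δB * ρ (pm t) (pk j))) :=
      (hB t j).trans (mul_le_mul_of_nonneg_right (mul_le_mul_of_nonneg_left (hT (pl i) (pm t)) hcB)
        (Real.exp_pos _).le)
    have hAt := hA i t
    have e0 : cA * ωA (pl i) * Real.exp (-(δA * ρ (pl i) (pm t))) *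
        (cB * (Λ * ωB (pl i) * Real.exp (κ * ρ (pl i) (pm t))) * Real.exp (-(δB * ρ (pm t) (pk j)))) =
        cA * cB * Λ * (ωA (pl i) * ωB (pl i)) *
          Real.exp (-(δA * ρ (pl i) (pm t)) + κ * ρ (pl i) (pm t) + -(δB * ρ (pm t) (pk j))) := by
      rw [Real.exp_add, Real.exp_add]; ring
    have e1 : W * Real.exp (-(γ * ρ (pl i) (pm t))) = cA * cB * Λ * (ωA (pl i) * ωB (pl i)) *
        Real.exp (-(δ' * ρ (pl i) (pk j)) + -(γ * ρ (pl i) (pm t))) := by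
      rw [hW, Real.exp_add]; ring
    calc |A i t| * |B t j|
        ≤ cA * ωA (pl i) * Real.exp (-(δA * ρ (pl i) (pm t))) *
          (cB * (Λ * ωB (pl i) * Real.exp (κ * ρ (pl i) (pm t))) * Real.exp (-(δB * ρ (pm t) (pk j)))) :=
          mul_le_mul hAt hBt (abs_nonneg _) (mul_nonneg (mul_nonneg hcA (hωA _)) (Real.exp_pos _).le)
      _ ≤ W * Real.exp (-(γ * ρ (pl i) (pm t))) := by
          rw [e0, e1]
          refine mul_le_mul_of_nonneg_left (Real.exp_le_exp.mpr ?_) hC0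
          have h1 : ρ (pl i) (pk j) ≤ ρ (pl i) (pm t) + ρ (pm t) (pk j) := hρ.triangle _ _ _
          have h2 : 0 ≤ ρ (pm t) (pk j) := hρ.nonneg _ _
          have h3 : 0 ≤ ρ (pl i) (pm t) := hρ.nonneg _ _
          nlinarith [mul_le_mul_of_nonneg_left h1 hδ', mul_le_mul_of_nonneg_right hB' h2,
            mul_le_mul_of_nonneg_right hA' h3]
  calc ∑ t, |A i t| * |B t j| ≤ ∑ t, W * Real.exp (-(γ * ρ (pl i) (pm t))) := sum_le_sum fun t _ => hterm t
    _ = W * ∑ t, Real.exp (-(γ * ρ (pl i) (pm t))) := by rw [mul_sum]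
    _ ≤ W * K γ := mul_le_mul_of_nonneg_left (hP γ hγ (pl i)) hW0
    _ = cA * cB * Λ * K γ * (ωA (pl i) * ωB (pl i)) * Real.exp (-(δ' * ρ (pl i) (pk j))) := by rw [hW]; ring

/-- **zone base, zone on the LEFT factor's rows** (`Z·B`, `Z` a zone-supported rate-`δZ` defect majorant, `B` the
accumulated right chain at rate `δB`): the product has the weighted (1.12)-shape at rate `σ` with `2σ + κ + γ ≤ δZ`,
`2σ ≤ δB` — the outer row is in the zone, the column is at most `ρ(i,j)` deep. [folklore] -/
theorem WShp.zone_mul [Fintype m] (hρ : IsPseudoDist ρ) (hβ : IsDepth ρ β) (hP : Profile ρ pm K) {ωZ ωB : S → ℝ}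
    {cZ cB δZ δB Λ κ γ σ : ℝ} (hωZ : ∀ a, 0 ≤ ωZ a) (hωB : ∀ a, 0 ≤ ωB a) (hcZ : 0 ≤ cZ) (hcB : 0 ≤ cB)
    (hΛ : 0 ≤ Λ) (hγ : 0 < γ) (hσ : 0 ≤ σ) (hZ' : 2 * σ + κ + γ ≤ δZ) (hB' : 2 * σ ≤ δB) (hT : Transfer ρ ωB Λ κ)
    {Z : Matrix l m ℝ} {B : Matrix m k ℝ} (hZ : WDec ρ pl pm ωZ cZ δZ Z) (hZ0 : RowZone β pl Z)
    (hB : WDec ρ pm pk ωB cB δB B) :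
    WShp ρ β pl pk (fun a => ωZ a * ωB a) (cZ * cB * Λ * K γ) σ (Z * B) := by
  intro i j
  refine (abs_mul_apply_le Z B i j).trans ?_
  have hC0 : 0 ≤ cZ * cB * Λ * (ωZ (pl i) * ωB (pl i)) :=
    mul_nonneg (mul_nonneg (mul_nonneg hcZ hcB) hΛ) (mul_nonneg (hωZ _) (hωB _))
  set W := cZ * cB * Λ * (ωZ (pl i) * ωB (pl i)) *
    Real.exp (-(σ * (ρ (pl i) (pk j) + β (pl i) + β (pk j)))) with hW
  have hW0 : 0 ≤ W := by rw [hW]; exact mul_nonneg hC0 (Real.exp_pos _).le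
  have hterm : ∀ t, |Z i t| * |B t j| ≤ W * Real.exp (-(γ * ρ (pl i) (pm t))) := by
    intro t
    by_cases h0 : Z i t = 0
    · rw [h0, abs_zero, zero_mul]; exact mul_nonneg hW0 (Real.exp_pos _).le
    have hb : β (pl i) = 0 := hZ0 i t h0
    have hBt : |B t j| ≤ cB * (Λ * ωB (pl i) * Real.exp (κ * ρ (pl i) (pm t))) *
        Real.exp (-(δB * ρ (pm t) (pk j))) :=
      (hB t j).trans (mul_le_mul_of_nonneg_right (mul_le_mul_of_nonneg_left (hT (pl i) (pm t)) hcB)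
        (Real.exp_pos _).le)
    have e0 : cZ * ωZ (pl i) * Real.exp (-(δZ * ρ (pl i) (pm t))) *
        (cB * (Λ * ωB (pl i) * Real.exp (κ * ρ (pl i) (pm t))) * Real.exp (-(δB * ρ (pm t) (pk j)))) =
        cZ * cB * Λ * (ωZ (pl i) * ωB (pl i)) *
          Real.exp (-(δZ * ρ (pl i) (pm t)) + κ * ρ (pl i) (pm t) + -(δB * ρ (pm t) (pk j))) := by
      rw [Real.exp_add, Real.exp_add]; ring
    have e1 : W * Real.exp (-(γ * ρ (pl i) (pm t))) = cZ * cB * Λ * (ωZ (pl i) * ωB (pl i)) *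
        Real.exp (-(σ * (ρ (pl i) (pk j) + β (pl i) + β (pk j))) + -(γ * ρ (pl i) (pm t))) := by
      rw [hW, Real.exp_add]; ring
    calc |Z i t| * |B t j|
        ≤ cZ * ωZ (pl i) * Real.exp (-(δZ * ρ (pl i) (pm t))) *
          (cB * (Λ * ωB (pl i) * Real.exp (κ * ρ (pl i) (pm t))) * Real.exp (-(δB * ρ (pm t) (pk j)))) :=
          mul_le_mul (hZ i t) hBt (abs_nonneg _) (mul_nonneg (mul_nonneg hcZ (hωZ _)) (Real.exp_pos _).le)
      _ ≤ W * Real.exp (-(γ * ρ (pl i) (pm t))) := by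
          rw [e0, e1]
          refine mul_le_mul_of_nonneg_left (Real.exp_le_exp.mpr ?_) hC0
          have h1 : ρ (pl i) (pk j) ≤ ρ (pl i) (pm t) + ρ (pm t) (pk j) := hρ.triangle _ _ _
          have h2 : 0 ≤ ρ (pm t) (pk j) := hρ.nonneg _ _
          have h3 : 0 ≤ ρ (pl i) (pm t) := hρ.nonneg _ _
          have h4 : β (pk j) ≤ ρ (pl i) (pk j) := by
            have := hβ.lip (pk j) (pl i); rw [hb, hρ.symm] at this; linarith
          rw [hb]
          nlinarith [mul_le_mul_of_nonneg_left h1 hσ, mul_le_mul_of_nonneg_right hB' h2,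
            mul_le_mul_of_nonneg_right hZ' h3, mul_le_mul_of_nonneg_left h4 hσ]
  calc ∑ t, |Z i t| * |B t j| ≤ ∑ t, W * Real.exp (-(γ * ρ (pl i) (pm t))) := sum_le_sum fun t _ => hterm t
    _ = W * ∑ t, Real.exp (-(γ * ρ (pl i) (pm t))) := by rw [mul_sum]
    _ ≤ W * K γ := mul_le_mul_of_nonneg_left (hP γ hγ (pl i)) hW0
    _ = cZ * cB * Λ * K γ * (ωZ (pl i) * ωB (pl i)) *
          Real.exp (-(σ * (ρ (pl i) (pk j) + β (pl i) + β (pk j)))) := by rw [hW]; ring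

/-- **shape extended on the LEFT by a factor** (`A·D`, `A` a rate-`δA` factor, `D` of the weighted shape at rate
`σ`): the shape survives at the SAME rate, the weight of `D` moves to the row of `A`, provided `2σ + κ + γ ≤ δA`
(triangle inequality for `ρ` and the Lipschitz property of the depth across `A`'s link). [folklore] -/
theorem WShp.fac_mul [Fintype m] (hρ : IsPseudoDist ρ) (hβ : IsDepth ρ β) (hP : Profile ρ pm K) {ωA ωD : S → ℝ}
    {cA ε δA Λ κ γ σ : ℝ} (hωA : ∀ a, 0 ≤ ωA a) (hωD : ∀ a, 0 ≤ ωD a) (hcA : 0 ≤ cA) (hε : 0 ≤ ε)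
    (hΛ : 0 ≤ Λ) (hγ : 0 < γ) (hσ : 0 ≤ σ) (hA' : 2 * σ + κ + γ ≤ δA) (hT : Transfer ρ ωD Λ κ)
    {A : Matrix l m ℝ} {D : Matrix m k ℝ} (hA : WDec ρ pl pm ωA cA δA A) (hD : WShp ρ β pm pk ωD ε σ D) :
    WShp ρ β pl pk (fun a => ωA a * ωD a) (cA * ε * Λ * K γ) σ (A * D) := by
  intro i j
  refine (abs_mul_apply_le A D i j).trans ?_
  have hC0 : 0 ≤ cA * ε * Λ * (ωA (pl i) * ωD (pl i)) :=
    mul_nonneg (mul_nonneg (mul_nonneg hcA hε) hΛ) (mul_nonneg (hωA _) (hωD _))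
  set W := cA * ε * Λ * (ωA (pl i) * ωD (pl i)) *
    Real.exp (-(σ * (ρ (pl i) (pk j) + β (pl i) + β (pk j)))) with hW
  have hW0 : 0 ≤ W := by rw [hW]; exact mul_nonneg hC0 (Real.exp_pos _).le
  have hterm : ∀ t, |A i t| * |D t j| ≤ W * Real.exp (-(γ * ρ (pl i) (pm t))) := by
    intro t
    have hDt : |D t j| ≤ ε * (Λ * ωD (pl i) * Real.exp (κ * ρ (pl i) (pm t))) *
        Real.exp (-(σ * (ρ (pm t) (pk j) + β (pm t) + β (pk j)))) :=
      (hD t j).trans (mul_le_mul_of_nonneg_right (mul_le_mul_of_nonneg_left (hT (pl i) (pm t)) hε)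
        (Real.exp_pos _).le)
    have e0 : cA * ωA (pl i) * Real.exp (-(δA * ρ (pl i) (pm t))) *
        (ε * (Λ * ωD (pl i) * Real.exp (κ * ρ (pl i) (pm t))) *
          Real.exp (-(σ * (ρ (pm t) (pk j) + β (pm t) + β (pk j))))) =
        cA * ε * Λ * (ωA (pl i) * ωD (pl i)) * Real.exp (-(δA * ρ (pl i) (pm t)) + κ * ρ (pl i) (pm t) +
          -(σ * (ρ (pm t) (pk j) + β (pm t) + β (pk j)))) := by
      rw [Real.exp_add, Real.exp_add]; ring
    have e1 : W * Real.exp (-(γ * ρ (pl i) (pm t))) = cA * ε * Λ * (ωA (pl i) * ωD (pl i)) *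
        Real.exp (-(σ * (ρ (pl i) (pk j) + β (pl i) + β (pk j))) + -(γ * ρ (pl i) (pm t))) := by
      rw [hW, Real.exp_add]; ring
    calc |A i t| * |D t j|
        ≤ cA * ωA (pl i) * Real.exp (-(δA * ρ (pl i) (pm t))) *
          (ε * (Λ * ωD (pl i) * Real.exp (κ * ρ (pl i) (pm t))) *
            Real.exp (-(σ * (ρ (pm t) (pk j) + β (pm t) + β (pk j))))) :=
          mul_le_mul (hA i t) hDt (abs_nonneg _) (mul_nonneg (mul_nonneg hcA (hωA _)) (Real.exp_pos _).le)
      _ ≤ W * Real.exp (-(γ * ρ (pl i) (pm t))) := by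
          rw [e0, e1]
          refine mul_le_mul_of_nonneg_left (Real.exp_le_exp.mpr ?_) hC0
          have h1 : ρ (pl i) (pk j) ≤ ρ (pl i) (pm t) + ρ (pm t) (pk j) := hρ.triangle _ _ _
          have h2 : β (pl i) ≤ ρ (pl i) (pm t) + β (pm t) := hβ.lip _ _
          have h3 : 0 ≤ ρ (pl i) (pm t) := hρ.nonneg _ _
          nlinarith [mul_le_mul_of_nonneg_left h1 hσ, mul_le_mul_of_nonneg_left h2 hσ,
            mul_le_mul_of_nonneg_right hA' h3]
  calc ∑ t, |A i t| * |D t j| ≤ ∑ t, W * Real.exp (-(γ * ρ (pl i) (pm t))) := sum_le_sum fun t _ => hterm t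
    _ = W * ∑ t, Real.exp (-(γ * ρ (pl i) (pm t))) := by rw [mul_sum]
    _ ≤ W * K γ := mul_le_mul_of_nonneg_left (hP γ hγ (pl i)) hW0
    _ = cA * ε * Λ * K γ * (ωA (pl i) * ωD (pl i)) *
          Real.exp (-(σ * (ρ (pl i) (pk j) + β (pl i) + β (pk j)))) := by rw [hW]; ring

end Weighted

/-! ## §3 The frame: pseudo-distance, depth, profile, scale weights; bundled operator classes with a level -/

section Frame

variable {S : Type*}

/-- the data of the estimate common to all operators: block pseudo-distance `ρ` (the scaled distance `d` of B9
(2.13)), depth `β` (distance to the cut zone), summation profile `K` ((2.61)/Lemma 2.1 of [4]), scale function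
`sc` (`y ↦ L^{j(y)}η`), the input rate `δ₀`, the unit rate loss `u` (transfer tilt = profile margin) and the transfer
constant `Λ`. [cite: Balaban1984PropagatorsII, (2.60)–(2.61) p.234] -/
structure Frame (S : Type*) where
  /-- block pseudo-distance -/
  ρ : S → S → ℝ
  /-- depth = distance to the cut zone -/
  β : S → ℝ
  /-- summation profile -/
  K : ℝ → ℝ
  /-- scale function (power 1) -/
  sc : S → ℝ
  /-- input decay rate of all one-sequence kernels and defect majorants -/
  δ₀ : ℝ
  /-- unit rate loss (one transfer tilt = one profile margin) -/
  u : ℝ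
  /-- transfer constant -/
  Λ : ℝ

/-- validity of a frame: `ρ` a pseudo-distance, `β` a depth for it, `K ≥ 0`, `sc > 0` with the transfer property
(2.60) for all powers `|k| ≤ 8` at the common constant `Λ ≥ 1` and tilt `u > 0`, `K(u) ≥ 1`, and the smallness
`20u ≤ δ₀` of the unit loss (B9: a change of scale costs a distance `≥ RM`, so the tilt per unit power is
`ln L/(RM) ≪ δ₀`). [cite: Balaban1984PropagatorsII, (2.60) p.234] -/
structure Frame.Valid (F : Frame S) : Prop where
  hρ : IsPseudoDist F.ρ
  hβ : IsDepth F.ρ F.β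
  hK : ∀ a, 0 < a → 0 ≤ F.K a
  hsc : ∀ a, 0 < F.sc a
  htr : ∀ k : ℤ, -8 ≤ k → k ≤ 8 → Transfer F.ρ (fun a => F.sc a ^ k) F.Λ F.u
  hu : 0 < F.u
  hΛ : 1 ≤ F.Λ
  hKu : 1 ≤ F.K F.u
  hδ₀ : 20 * F.u ≤ F.δ₀

namespace Frame

variable (F : Frame S)

/-- the rate of a chain at level `n`: `δ₀ − n·u` [folklore] -/
noncomputable def rate (n : ℕ) : ℝ := F.δ₀ - n * F.u

/-- the output shape rate `σ = (δ₀ − 20u)/2` [folklore] -/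
noncomputable def σ : ℝ := (F.δ₀ - 20 * F.u) / 2

/-- [folklore] -/
theorem rate_zero : F.rate 0 = F.δ₀ := by simp [rate]

variable {F}

/-- [folklore] -/
theorem Valid.sc_zpow_nonneg (hF : F.Valid) (k : ℤ) (a : S) : 0 ≤ F.sc a ^ k := (zpow_pos (hF.hsc a) k).le

/-- [folklore] -/
theorem Valid.σ_nonneg (hF : F.Valid) : 0 ≤ F.σ := by
  have := hF.hδ₀; unfold σ; linarith

/-- [folklore] -/
theorem Valid.Λ_nonneg (hF : F.Valid) : 0 ≤ F.Λ := le_trans zero_le_one hF.hΛ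

/-- [folklore] -/
theorem Valid.Ku_nonneg (hF : F.Valid) : 0 ≤ F.K F.u := le_trans zero_le_one hF.hKu

/-- [folklore] -/
theorem Valid.sc_zpow_add (hF : F.Valid) (k₁ k₂ : ℤ) (a : S) : F.sc a ^ k₁ * F.sc a ^ k₂ = F.sc a ^ (k₁ + k₂) :=
  (zpow_add₀ (hF.hsc a).ne' k₁ k₂).symm

end Frame

variable {u v w U V W : Type*} [Fintype v] [DecidableEq V]

/-- **operator class 𝒟(n, k, c)**: `T` has a block majorant with row weight `sc^k`, constant `c`, rate `δ₀ − n·u`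
(a product of one-sequence factors; `n = 0` for a single factor of hypothesis (M)). [folklore] -/
def OpDec (F : Frame S) (bu : u → U) (bv : v → V) (pU : U → S) (pV : V → S) (n : ℕ) (k : ℤ) (c : ℝ)
    (T : Matrix u v ℝ) : Prop :=
  ∃ K : Matrix U V ℝ, BlkMaj bu bv T K ∧ WDec F.ρ pU pV (fun a => F.sc a ^ k) c (F.rate n) K

/-- **operator class 𝒮(k, ε)**: `T` has a block majorant of the row-weighted (1.12)-shape at the output rate `σ`.
[folklore] -/
def OpShp (F : Frame S) (bu : u → U) (bv : v → V) (pU : U → S) (pV : V → S) (k : ℤ) (ε : ℝ)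
    (T : Matrix u v ℝ) : Prop :=
  ∃ K : Matrix U V ℝ, BlkMaj bu bv T K ∧ WShp F.ρ F.β pU pV (fun a => F.sc a ^ k) ε F.σ K

/-- **operator class 𝒵(k, θ)** of the local defects (hypothesis (L)): a block majorant with row weight `sc^k`,
constant `θ` (`= O(M⁻¹)`), rate `δ₀`, whose rows live in the cut zone. [folklore] -/
def OpZon (F : Frame S) (bu : u → U) (bv : v → V) (pU : U → S) (pV : V → S) (k : ℤ) (θ : ℝ)
    (Z : Matrix u v ℝ) : Prop :=
  ∃ K : Matrix U V ℝ, BlkMaj bu bv Z K ∧ WDec F.ρ pU pV (fun a => F.sc a ^ k) θ (F.rate 0) K ∧ RowZone F.β pU K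

variable {F : Frame S} {bu : u → U} {bv : v → V} {bw : w → W} {pU : U → S} {pV : V → S} {pW : W → S}

/-- [folklore] -/
theorem OpDec.castK {n : ℕ} {k k' : ℤ} {c : ℝ} {T : Matrix u v ℝ} (h : OpDec F bu bv pU pV n k c T)
    (hk : k = k') : OpDec F bu bv pU pV n k' c T := hk ▸ h

/-- [folklore] -/
theorem OpDec.cst {n : ℕ} {k : ℤ} {c c' : ℝ} {T : Matrix u v ℝ} (h : OpDec F bu bv pU pV n k c T)
    (hc : c = c') : OpDec F bu bv pU pV n k c' T := hc ▸ h

/-- [folklore] -/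
theorem OpShp.castK {k k' : ℤ} {ε : ℝ} {T : Matrix u v ℝ} (h : OpShp F bu bv pU pV k ε T) (hk : k = k') :
    OpShp F bu bv pU pV k' ε T := hk ▸ h

/-- [folklore] -/
theorem OpShp.cst {k : ℤ} {ε ε' : ℝ} {T : Matrix u v ℝ} (h : OpShp F bu bv pU pV k ε T) (hε : ε = ε') :
    OpShp F bu bv pU pV k ε' T := hε ▸ h

/-- [folklore] -/
theorem OpShp.mono (hF : F.Valid) {k : ℤ} {ε ε' : ℝ} {T : Matrix u v ℝ} (h : OpShp F bu bv pU pV k ε T)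
    (hε0 : 0 ≤ ε) (hε : ε ≤ ε') : OpShp F bu bv pU pV k ε' T := by
  obtain ⟨K, hK, hS⟩ := h
  exact ⟨K, hK, hS.mono hF.hρ hF.hβ (hF.sc_zpow_nonneg k) hε0 hε le_rfl⟩

/-- [folklore] -/
theorem OpShp.add {k : ℤ} {ε₁ ε₂ : ℝ} {T₁ T₂ : Matrix u v ℝ} (h₁ : OpShp F bu bv pU pV k ε₁ T₁)
    (h₂ : OpShp F bu bv pU pV k ε₂ T₂) : OpShp F bu bv pU pV k (ε₁ + ε₂) (T₁ + T₂) := by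
  obtain ⟨K₁, hK₁, hS₁⟩ := h₁
  obtain ⟨K₂, hK₂, hS₂⟩ := h₂
  exact ⟨K₁ + K₂, hK₁.add hK₂, hS₁.add hS₂⟩

/-- [folklore] -/
theorem OpShp.neg {k : ℤ} {ε : ℝ} {T : Matrix u v ℝ} (h : OpShp F bu bv pU pV k ε T) :
    OpShp F bu bv pU pV k ε (-T) := by
  obtain ⟨K, hK, hS⟩ := h
  exact ⟨K, hK.neg, hS⟩

/-- [folklore] -/
theorem OpShp.sub {k : ℤ} {ε₁ ε₂ : ℝ} {T₁ T₂ : Matrix u v ℝ} (h₁ : OpShp F bu bv pU pV k ε₁ T₁)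
    (h₂ : OpShp F bu bv pU pV k ε₂ T₂) : OpShp F bu bv pU pV k (ε₁ + ε₂) (T₁ - T₂) := by
  rw [sub_eq_add_neg]; exact h₁.add h₂.neg

/-- the entry bound delivered by a shape class [folklore] -/
theorem OpShp.entry {k : ℤ} {ε : ℝ} {T : Matrix u v ℝ} (h : OpShp F bu bv pU pV k ε T) (x : u) (x' : v) :
    |T x x'| ≤ ε * F.sc (pU (bu x)) ^ k *
      Real.exp (-(F.σ * (F.ρ (pU (bu x)) (pV (bv x')) + F.β (pU (bu x)) + F.β (pV (bv x'))))) := by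
  obtain ⟨K, hK, hS⟩ := h
  exact (hK.entry x x').trans ((le_abs_self _).trans (hS (bu x) (bv x')))

/-- **chain step** `𝒟(0,k₁,c₁)·𝒟(n,k₂,c₂) ⊂ 𝒟(n+2, k₁+k₂, c₁c₂ΛK(u))` (factor on the left of the accumulated
product; profile of the middle block family). [folklore] -/
theorem OpDec.fmul [Fintype w] [Fintype V] [DecidableEq W] (hF : F.Valid) (hP : Profile F.ρ pV F.K) {n : ℕ} {k₁ k₂ : ℤ} {c₁ c₂ : ℝ}
    {A : Matrix u v ℝ} {B : Matrix v w ℝ} (hA : OpDec F bu bv pU pV 0 k₁ c₁ A) (hB : OpDec F bv bw pV pW n k₂ c₂ B)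
    (hk : -8 ≤ k₂) (hk' : k₂ ≤ 8) (hn : n + 2 ≤ 20) (hc₁ : 0 ≤ c₁) (hc₂ : 0 ≤ c₂) :
    OpDec F bu bw pU pW (n + 2) (k₁ + k₂) (c₁ * c₂ * F.Λ * F.K F.u) (A * B) := by
  obtain ⟨KA, hKA, hdA⟩ := hA
  obtain ⟨KB, hKB, hdB⟩ := hB
  refine ⟨KA * KB, hKA.mul hKB, ?_⟩
  have hn' : ((n + 2 : ℕ) : ℝ) ≤ 20 := by exact_mod_cast hn
  have h := WDec.mul (k := W) (pk := pW) hF.hρ hP (hF.sc_zpow_nonneg k₁) (hF.sc_zpow_nonneg k₂) hc₁ hc₂ hF.Λ_nonneg hF.hu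
    (δ' := F.rate (n + 2)) (by have := hF.hδ₀; have := hF.hu; unfold Frame.rate; nlinarith)
    (by unfold Frame.rate; push_cast; have := hF.hu; nlinarith)
    (by unfold Frame.rate; push_cast; have := hF.hu; nlinarith) (hF.htr k₂ hk hk') hdA hdB
  exact h.congr_weight fun a => hF.sc_zpow_add k₁ k₂ a

/-- **zone base** `𝒵(k₁,θ)·𝒟(n,k₂,c) ⊂ 𝒮(k₁+k₂, θcΛK(u))` for `n ≤ 20`. [folklore] -/
theorem OpShp.zmul [Fintype w] [Fintype V] [DecidableEq W] (hF : F.Valid) (hP : Profile F.ρ pV F.K) {n : ℕ} {k₁ k₂ : ℤ} {θ c : ℝ}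
    {Z : Matrix u v ℝ} {B : Matrix v w ℝ} (hZ : OpZon F bu bv pU pV k₁ θ Z) (hB : OpDec F bv bw pV pW n k₂ c B)
    (hk : -8 ≤ k₂) (hk' : k₂ ≤ 8) (hn : n ≤ 20) (hθ : 0 ≤ θ) (hc : 0 ≤ c) :
    OpShp F bu bw pU pW (k₁ + k₂) (θ * c * F.Λ * F.K F.u) (Z * B) := by
  obtain ⟨KZ, hKZ, hdZ, hZ0⟩ := hZ
  obtain ⟨KB, hKB, hdB⟩ := hB
  refine ⟨KZ * KB, hKZ.mul hKB, ?_⟩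
  have hn' : ((n : ℕ) : ℝ) ≤ 20 := by exact_mod_cast hn
  have h := WShp.zone_mul (k := W) (pk := pW) hF.hρ hF.hβ hP (hF.sc_zpow_nonneg k₁) (hF.sc_zpow_nonneg k₂) hθ hc
    hF.Λ_nonneg hF.hu hF.σ_nonneg (δZ := F.rate 0) (δB := F.rate n) (κ := F.u)
    (by unfold Frame.rate Frame.σ; push_cast; have := hF.hu; nlinarith)
    (by unfold Frame.rate Frame.σ; have := hF.hu; nlinarith) (hF.htr k₂ hk hk') hdZ hZ0 hdB
  exact h.congr_weight fun a => hF.sc_zpow_add k₁ k₂ a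

/-- a defect alone: `𝒵(k,θ) ⊂ 𝒮(k,θ)`. [folklore] -/
theorem OpShp.of_zon (hF : F.Valid) {k : ℤ} {θ : ℝ} {Z : Matrix u v ℝ} (hZ : OpZon F bu bv pU pV k θ Z)
    (hθ : 0 ≤ θ) : OpShp F bu bv pU pV k θ Z := by
  obtain ⟨KZ, hKZ, hdZ, hZ0⟩ := hZ
  refine ⟨KZ, hKZ, ?_⟩
  have h := WShp.of_rowzone hF.hρ hF.hβ (hF.sc_zpow_nonneg k) hθ
    (by rw [Frame.rate_zero]; have := hF.hδ₀; have := hF.hu; nlinarith) hdZ hZ0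
  exact h.mono hF.hρ hF.hβ (hF.sc_zpow_nonneg k) hθ le_rfl
    (by unfold Frame.rate Frame.σ; push_cast; have := hF.hu; nlinarith)

/-- **left factor** `𝒟(0,k₁,c)·𝒮(k₂,ε) ⊂ 𝒮(k₁+k₂, cεΛK(u))` — at the SAME output rate. [folklore] -/
theorem OpShp.fmul [Fintype w] [Fintype V] [DecidableEq W] (hF : F.Valid) (hP : Profile F.ρ pV F.K) {k₁ k₂ : ℤ} {c ε : ℝ}
    {A : Matrix u v ℝ} {D : Matrix v w ℝ} (hA : OpDec F bu bv pU pV 0 k₁ c A) (hD : OpShp F bv bw pV pW k₂ ε D)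
    (hk : -8 ≤ k₂) (hk' : k₂ ≤ 8) (hc : 0 ≤ c) (hε : 0 ≤ ε) :
    OpShp F bu bw pU pW (k₁ + k₂) (c * ε * F.Λ * F.K F.u) (A * D) := by
  obtain ⟨KA, hKA, hdA⟩ := hA
  obtain ⟨KD, hKD, hsD⟩ := hD
  refine ⟨KA * KD, hKA.mul hKD, ?_⟩
  have h := WShp.fac_mul (k := W) (pk := pW) hF.hρ hF.hβ hP (hF.sc_zpow_nonneg k₁) (hF.sc_zpow_nonneg k₂) hc hε
    hF.Λ_nonneg hF.hu hF.σ_nonneg (δA := F.rate 0) (κ := F.u)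
    (by unfold Frame.rate Frame.σ; push_cast; have := hF.hu; nlinarith) (hF.htr k₂ hk hk') hdA hsD
  exact h.congr_weight fun a => hF.sc_zpow_add k₁ k₂ a

/-- [folklore] -/
theorem OpDec.castN {n n' : ℕ} {k : ℤ} {c : ℝ} {T : Matrix u v ℝ} (h : OpDec F bu bv pU pV n k c T)
    (hn : n = n') : OpDec F bu bv pU pV n' k c T := hn ▸ h

end Frame

/-! ## §4 The typed instance: THEOREM D, estimate half, for `B9SectCDiffExpansion.TwoSeq` -/

section Instance

open B9SectCDiffExpansion (TwoSeq)
open B9SectCDiff (cutX)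

universe uu

variable {S : Type*}
variable {s b S₁ S₂ B₁ B₂ : Type uu} [Fintype s] [DecidableEq s] [Fintype b] [DecidableEq b]
  [Fintype S₁] [DecidableEq S₁] [Fintype S₂] [DecidableEq S₂] [Fintype B₁] [Fintype B₂]

/-- **Hypotheses (M), (L), (P) of THEOREM D** for an abstract two-sequence system `X : TwoSeq`, over a frame `F`:
two block families `U₁, U₂` (the 𝔅-points of the two sequences) with positions `p₁, p₂` and their profiles (P);
block maps from every carrier of `X` (and from the 2-tensor carrier `t` of the covariant derivative `Dv` of 1-forms);
(M) = the sixteen one-sequence factors of `TwoSeq.dT_flat` in the class `𝒟(0, k, c)` with the printed scale powers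
`k` (`G, G′ : 2`; `∂G′, ∂*G, ∇G : 1`; `Q, Q*, Q′, Q′* : 0`; `C : −4`) — (3.42) of Thm 3.1, (3.48) of Thm 3.2,
Thm 3.3 / (3.132) of Thm 3.12, per sequence, transcribed to 𝔅-block majorants; (L) = the local defects in the
zone class `𝒵(k, θ)` (`𝔇(Q), 𝔇(Q*), 𝔇(Q′), 𝔇(Q′*) : 0`; `𝔇(∂), 𝔇(∂*) : −1`; `𝔇(A) : −2`) together with the three
ONE-SIDED FORMS of the record's placement rule — `𝔇(Λ) = Lm₁·∇ + Lm₀`, `∂·𝔇(∂*) = Dm₁·∇ + Dm₀` (Leibniz (3.100)),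
`𝔇(Δ′_a) = Am₁·∂ + Am₀` — with first-order coefficients in `𝒵(−1, θ)` and zeroth-order ones in `𝒵(−2, θ)`
(`θ = O(M⁻¹)`: *"They are of the order O(M⁻¹), or O(M⁻²), if considered on a proper scale"*, p. 414).  Nothing here
is proved about the lattice operators: (M) and (L) are HYPOTHESES, discharged elsewhere or cited.
[cite: Balaban1985BackgroundPropagators, (3.100) p.413] -/
structure EstHyp (F : Frame S) (X : TwoSeq s b S₁ S₂ B₁ B₂) (t U₁ U₂ : Type uu) [Fintype t] [Fintype U₁]
    [DecidableEq U₁] [Fintype U₂] [DecidableEq U₂] where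
  /-- positions of the blocks of sequence 1 -/
  p₁ : U₁ → S
  /-- positions of the blocks of sequence 2 -/
  p₂ : U₂ → S
  /-- block maps: sites, bonds, 2-tensors, block sites, block bonds, per sequence -/
  bs₁ : s → U₁
  bs₂ : s → U₂
  bb₁ : b → U₁
  bb₂ : b → U₂
  bt₂ : t → U₂
  bS₁ : S₁ → U₁
  bS₂ : S₂ → U₂
  bB₁ : B₁ → U₁
  bB₂ : B₂ → U₂
  /-- covariant derivative of 1-forms (1-forms → 2-tensors), sequence-independent -/
  Dv : Matrix t b ℝ
  /-- one-sided form of 𝔇(Λ): first-order coefficient -/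
  Lm₁ : Matrix b t ℝ
  /-- one-sided form of 𝔇(Λ): zeroth-order coefficient -/
  Lm₀ : Matrix b b ℝ
  /-- one-sided form of ∂·𝔇(∂*): first-order coefficient -/
  Dm₁ : Matrix b t ℝ
  /-- one-sided form of ∂·𝔇(∂*): zeroth-order coefficient -/
  Dm₀ : Matrix b b ℝ
  /-- one-sided form of 𝔇(Δ′_a): first-order coefficient -/
  Am₁ : Matrix s b ℝ
  /-- one-sided form of 𝔇(Δ′_a): zeroth-order coefficient -/
  Am₀ : Matrix s s ℝ
  /-- common constant of the one-sequence factors (B₀-type), normalised `≥ 1` -/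
  c : ℝ
  /-- common constant of the defects, `= O(M⁻¹)` -/
  θ : ℝ
  hc : 1 ≤ c
  hθ : 0 ≤ θ
  /-- (P) profiles of the two block families -/
  hP₁ : Profile F.ρ p₁ F.K
  hP₂ : Profile F.ρ p₂ F.K
  /-- (M), sequence 1 -/
  mQ₁ : OpDec F bB₁ bb₁ p₁ p₁ 0 0 c X.Q₁
  mG₁ : OpDec F bb₁ bb₁ p₁ p₁ 0 2 c X.G₁
  mDG'₁ : OpDec F bb₁ bs₁ p₁ p₁ 0 1 c (X.D * X.G'₁)
  mQ't₁ : OpDec F bs₁ bS₁ p₁ p₁ 0 0 c X.Q't₁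
  mC₁ : OpDec F bS₁ bS₁ p₁ p₁ 0 (-4) c X.C₁
  mQ'₁ : OpDec F bS₁ bs₁ p₁ p₁ 0 0 c X.Q'₁
  mG'₁ : OpDec F bs₁ bs₁ p₁ p₁ 0 2 c X.G'₁
  /-- (M), sequence 2 -/
  mG₂ : OpDec F bb₂ bb₂ p₂ p₂ 0 2 c X.G₂
  mQt₂ : OpDec F bb₂ bB₂ p₂ p₂ 0 0 c X.Qt₂
  mDtG₂ : OpDec F bs₂ bb₂ p₂ p₂ 0 1 c (X.Dt * X.G₂)
  mDvG₂ : OpDec F bt₂ bb₂ p₂ p₂ 0 1 c (Dv * X.G₂)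
  mG'₂ : OpDec F bs₂ bs₂ p₂ p₂ 0 2 c X.G'₂
  mDG'₂ : OpDec F bb₂ bs₂ p₂ p₂ 0 1 c (X.D * X.G'₂)
  mQ't₂ : OpDec F bs₂ bS₂ p₂ p₂ 0 0 c X.Q't₂
  mC₂ : OpDec F bS₂ bS₂ p₂ p₂ 0 (-4) c X.C₂
  mQ'₂ : OpDec F bS₂ bs₂ p₂ p₂ 0 0 c X.Q'₂
  /-- (L), multiplication-type defects -/
  zQ : OpZon F bB₁ bb₂ p₁ p₂ 0 θ X.dQ
  zQt : OpZon F bb₁ bB₂ p₁ p₂ 0 θ X.dQt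
  zD : OpZon F bb₁ bs₂ p₁ p₂ (-1) θ X.dD
  zDt : OpZon F bs₁ bb₂ p₁ p₂ (-1) θ X.dDt
  zA : OpZon F bb₁ bb₂ p₁ p₂ (-2) θ X.dA
  zQ' : OpZon F bS₁ bs₂ p₁ p₂ 0 θ X.dQ'
  zQ't : OpZon F bs₁ bS₂ p₁ p₂ 0 θ X.dQ't
  /-- (L), one-sided forms of the three differential-operator defects -/
  hΛ : X.dΛ = Lm₁ * Dv + Lm₀
  zLm₁ : OpZon F bb₁ bt₂ p₁ p₂ (-1) θ Lm₁
  zLm₀ : OpZon F bb₁ bb₂ p₁ p₂ (-2) θ Lm₀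
  hM : X.D * X.dDt = Dm₁ * Dv + Dm₀
  zDm₁ : OpZon F bb₁ bt₂ p₁ p₂ (-1) θ Dm₁
  zDm₀ : OpZon F bb₁ bb₂ p₁ p₂ (-2) θ Dm₀
  hA : X.ddA' = Am₁ * X.D + Am₀
  zAm₁ : OpZon F bs₁ bb₂ p₁ p₂ (-1) θ Am₁
  zAm₀ : OpZon F bs₁ bs₂ p₁ p₂ (-2) θ Am₀

variable {F : Frame S} {X : TwoSeq s b S₁ S₂ B₁ B₂} {t U₁ U₂ : Type uu} [Fintype t] [Fintype U₁] [DecidableEq U₁]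
  [Fintype U₂] [DecidableEq U₂]

/-- [folklore] -/
theorem EstHyp.c_nonneg (H : EstHyp F X t U₁ U₂) : 0 ≤ H.c := zero_le_one.trans H.hc

/-- [folklore] -/
theorem EstHyp.cnn (H : EstHyp F X t U₁ U₂) (hF : F.Valid) (a b : ℕ) : 0 ≤ H.c ^ a * (F.Λ * F.K F.u) ^ b :=
  mul_nonneg (pow_nonneg H.c_nonneg a)
    (pow_nonneg (zero_le_one.trans (one_le_mul_of_one_le_of_one_le hF.hΛ hF.hKu)) b)

/-- [folklore] -/
theorem EstHyp.snn (H : EstHyp F X t U₁ U₂) (hF : F.Valid) (a b : ℕ) :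
    0 ≤ H.θ * (H.c ^ a * (F.Λ * F.K F.u) ^ b) := mul_nonneg H.hθ (H.cnn hF a b)

/-- every monomial constant `θ·cᵃ·(ΛK(u))ᵇ`, `a, b ≤ 15`, is below the common `θ·(cΛK(u))¹⁵`. [folklore] -/
theorem EstHyp.sle (H : EstHyp F X t U₁ U₂) (hF : F.Valid) {a b : ℕ} (ha : a ≤ 15) (hb : b ≤ 15) :
    H.θ * (H.c ^ a * (F.Λ * F.K F.u) ^ b) ≤ H.θ * (H.c * (F.Λ * F.K F.u)) ^ 15 := by
  have hB1 : 1 ≤ F.Λ * F.K F.u := one_le_mul_of_one_le_of_one_le hF.hΛ hF.hKu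
  have h1 : H.c ^ a ≤ H.c ^ 15 := pow_le_pow_right₀ H.hc ha
  have h2 : (F.Λ * F.K F.u) ^ b ≤ (F.Λ * F.K F.u) ^ 15 := pow_le_pow_right₀ hB1 hb
  have h3 : H.c ^ a * (F.Λ * F.K F.u) ^ b ≤ H.c ^ 15 * (F.Λ * F.K F.u) ^ 15 :=
    mul_le_mul h1 h2 (pow_nonneg (zero_le_one.trans hB1) b) (pow_nonneg H.c_nonneg 15)
  calc H.θ * (H.c ^ a * (F.Λ * F.K F.u) ^ b) ≤ H.θ * (H.c ^ 15 * (F.Λ * F.K F.u) ^ 15) :=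
        mul_le_mul_of_nonneg_left h3 H.hθ
    _ = H.θ * (H.c * (F.Λ * F.K F.u)) ^ 15 := by ring

/-- `TwoSeq.dT_flat` with the three one-sided forms substituted: 22 right-nested monomials. [folklore] -/
theorem EstHyp.dT_split (H : EstHyp F X t U₁ U₂) : X.dT =
    X.dQ * (X.G₂ * (X.Qt₂))
    + X.Q₁ * (X.G₁ * (X.dQt))
    - X.Q₁ * (X.G₁ * (H.Lm₁ * ((H.Dv * X.G₂) * (X.Qt₂))))
    - X.Q₁ * (X.G₁ * (H.Lm₀ * (X.G₂ * (X.Qt₂))))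
    - X.Q₁ * (X.G₁ * (X.dA * (X.G₂ * (X.Qt₂))))
    - X.Q₁ * (X.G₁ * (X.dD * ((X.Dt * X.G₂) * (X.Qt₂))))
    + X.Q₁ * (X.G₁ * (X.dD * (X.G'₂ * (X.Q't₂ * (X.C₂ * (X.Q'₂ * (X.G'₂ * ((X.Dt * X.G₂) * (X.Qt₂)))))))))
    - X.Q₁ * (X.G₁ * (H.Dm₁ * ((H.Dv * X.G₂) * (X.Qt₂))))
    - X.Q₁ * (X.G₁ * (H.Dm₀ * (X.G₂ * (X.Qt₂))))
    + X.Q₁ * (X.G₁ * ((X.D * X.G'₁) * (X.Q't₁ * (X.C₁ * (X.Q'₁ * (X.G'₁ * (X.dDt * (X.G₂ * (X.Qt₂)))))))))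
    - X.Q₁ * (X.G₁ * ((X.D * X.G'₁) * (H.Am₁ * ((X.D * X.G'₂) * (X.Q't₂ * (X.C₂ * (X.Q'₂ * (X.G'₂ * ((X.Dt * X.G₂) * (X.Qt₂))))))))))
    - X.Q₁ * (X.G₁ * ((X.D * X.G'₁) * (H.Am₀ * (X.G'₂ * (X.Q't₂ * (X.C₂ * (X.Q'₂ * (X.G'₂ * ((X.Dt * X.G₂) * (X.Qt₂))))))))))
    + X.Q₁ * (X.G₁ * ((X.D * X.G'₁) * (X.dQ't * (X.C₂ * (X.Q'₂ * (X.G'₂ * ((X.Dt * X.G₂) * (X.Qt₂))))))))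
    - X.Q₁ * (X.G₁ * ((X.D * X.G'₁) * (X.Q't₁ * (X.C₁ * (X.dQ' * (X.G'₂ * (X.G'₂ * (X.Q't₂ * (X.C₂ * (X.Q'₂ * (X.G'₂ * ((X.Dt * X.G₂) * (X.Qt₂)))))))))))))
    + X.Q₁ * (X.G₁ * ((X.D * X.G'₁) * (X.Q't₁ * (X.C₁ * (X.Q'₁ * (X.G'₁ * (H.Am₁ * ((X.D * X.G'₂) * (X.G'₂ * (X.Q't₂ * (X.C₂ * (X.Q'₂ * (X.G'₂ * ((X.Dt * X.G₂) * (X.Qt₂)))))))))))))))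
    + X.Q₁ * (X.G₁ * ((X.D * X.G'₁) * (X.Q't₁ * (X.C₁ * (X.Q'₁ * (X.G'₁ * (H.Am₀ * (X.G'₂ * (X.G'₂ * (X.Q't₂ * (X.C₂ * (X.Q'₂ * (X.G'₂ * ((X.Dt * X.G₂) * (X.Qt₂)))))))))))))))
    + X.Q₁ * (X.G₁ * ((X.D * X.G'₁) * (X.Q't₁ * (X.C₁ * (X.Q'₁ * (X.G'₁ * (X.G'₁ * (H.Am₁ * ((X.D * X.G'₂) * (X.Q't₂ * (X.C₂ * (X.Q'₂ * (X.G'₂ * ((X.Dt * X.G₂) * (X.Qt₂)))))))))))))))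
    + X.Q₁ * (X.G₁ * ((X.D * X.G'₁) * (X.Q't₁ * (X.C₁ * (X.Q'₁ * (X.G'₁ * (X.G'₁ * (H.Am₀ * (X.G'₂ * (X.Q't₂ * (X.C₂ * (X.Q'₂ * (X.G'₂ * ((X.Dt * X.G₂) * (X.Qt₂)))))))))))))))
    - X.Q₁ * (X.G₁ * ((X.D * X.G'₁) * (X.Q't₁ * (X.C₁ * (X.Q'₁ * (X.G'₁ * (X.G'₁ * (X.dQ't * (X.C₂ * (X.Q'₂ * (X.G'₂ * ((X.Dt * X.G₂) * (X.Qt₂)))))))))))))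
    + X.Q₁ * (X.G₁ * ((X.D * X.G'₁) * (X.Q't₁ * (X.C₁ * (X.dQ' * (X.G'₂ * ((X.Dt * X.G₂) * (X.Qt₂))))))))
    - X.Q₁ * (X.G₁ * ((X.D * X.G'₁) * (X.Q't₁ * (X.C₁ * (X.Q'₁ * (X.G'₁ * (H.Am₁ * ((X.D * X.G'₂) * ((X.Dt * X.G₂) * (X.Qt₂))))))))))
    - X.Q₁ * (X.G₁ * ((X.D * X.G'₁) * (X.Q't₁ * (X.C₁ * (X.Q'₁ * (X.G'₁ * (H.Am₀ * (X.G'₂ * ((X.Dt * X.G₂) * (X.Qt₂)))))))))) := by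
  rw [X.dT_flat, H.hΛ, H.hM, H.hA]
  simp only [Matrix.mul_add, Matrix.add_mul, Matrix.mul_assoc]
  abel

/-- right chain `X.Qt₂`. [folklore] -/
theorem EstHyp.chain0 (_hF : F.Valid) (H : EstHyp F X t U₁ U₂) :
    OpDec F H.bb₂ H.bB₂ H.p₂ H.p₂ 0 0 (H.c ^ 1 * (F.Λ * F.K F.u) ^ 0) X.Qt₂ :=
  H.mQt₂.cst (by ring)

/-- right chain, 2 factors. [folklore] -/
theorem EstHyp.chain1 (hF : F.Valid) (H : EstHyp F X t U₁ U₂) :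
    OpDec F H.bb₂ H.bB₂ H.p₂ H.p₂ 2 2 (H.c ^ 2 * (F.Λ * F.K F.u) ^ 1)
      (X.G₂ * (X.Qt₂)) :=
  (((OpDec.fmul hF H.hP₂ H.mG₂ (H.chain0 hF) (by norm_num) (by norm_num) (by norm_num) H.c_nonneg
    (H.cnn hF 1 0)).castK (by norm_num)).castN (by norm_num)).cst (by ring)

/-- monomial `𝔇(Q)·G₂Q*₂` (0 + 1 + 2 factors) is in `𝒮(2, θ(cΛK(u))¹⁵)`. [folklore] -/
theorem EstHyp.shape_m1 (hF : F.Valid) (H : EstHyp F X t U₁ U₂) :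
    OpShp F H.bB₁ H.bB₂ H.p₁ H.p₂ 2 (H.θ * (H.c * (F.Λ * F.K F.u)) ^ 15)
      (X.dQ * (X.G₂ * (X.Qt₂))) := by
  have hz : OpShp F H.bB₁ H.bB₂ H.p₁ H.p₂ 2 (H.θ * (H.c ^ 2 * (F.Λ * F.K F.u) ^ 2))
      (X.dQ * (X.G₂ * (X.Qt₂))) :=
    ((OpShp.zmul hF H.hP₂ H.zQ (H.chain1 hF) (by norm_num) (by norm_num) (by norm_num) H.hθ (H.cnn hF 2 1)).castK
      (by norm_num)).cst (by ring)
  exact hz.mono hF (H.snn hF 2 2) (H.sle hF (by norm_num : 2 ≤ 15) (by norm_num : 2 ≤ 15))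

/-- monomial `Q₁G₁·𝔇(Q*)` (2 + 1 + 0 factors) is in `𝒮(2, θ(cΛK(u))¹⁵)`. [folklore] -/
theorem EstHyp.shape_m2 (hF : F.Valid) (H : EstHyp F X t U₁ U₂) :
    OpShp F H.bB₁ H.bB₂ H.p₁ H.p₂ 2 (H.θ * (H.c * (F.Λ * F.K F.u)) ^ 15)
      (X.Q₁ * (X.G₁ * (X.dQt))) := by
  have hz : OpShp F H.bb₁ H.bB₂ H.p₁ H.p₂ 0 (H.θ * (H.c ^ 0 * (F.Λ * F.K F.u) ^ 0)) (X.dQt) :=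
    (OpShp.of_zon hF H.zQt H.hθ).cst (by ring)
  have hl1 : OpShp F H.bb₁ H.bB₂ H.p₁ H.p₂ 2 (H.θ * (H.c ^ 1 * (F.Λ * F.K F.u) ^ 1))
      (X.G₁ * (X.dQt)) :=
    ((OpShp.fmul hF H.hP₁ H.mG₁ hz (by norm_num) (by norm_num) H.c_nonneg (H.snn hF 0 0)).castK
      (by norm_num)).cst (by ring)
  have hl0 : OpShp F H.bB₁ H.bB₂ H.p₁ H.p₂ 2 (H.θ * (H.c ^ 2 * (F.Λ * F.K F.u) ^ 2))
      (X.Q₁ * (X.G₁ * (X.dQt))) :=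
    ((OpShp.fmul hF H.hP₁ H.mQ₁ hl1 (by norm_num) (by norm_num) H.c_nonneg (H.snn hF 1 1)).castK
      (by norm_num)).cst (by ring)
  exact hl0.mono hF (H.snn hF 2 2) (H.sle hF (by norm_num : 2 ≤ 15) (by norm_num : 2 ≤ 15))

/-- right chain, 2 factors. [folklore] -/
theorem EstHyp.chain2 (hF : F.Valid) (H : EstHyp F X t U₁ U₂) :
    OpDec F H.bt₂ H.bB₂ H.p₂ H.p₂ 2 1 (H.c ^ 2 * (F.Λ * F.K F.u) ^ 1)
      ((H.Dv * X.G₂) * (X.Qt₂)) :=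
  (((OpDec.fmul hF H.hP₂ H.mDvG₂ (H.chain0 hF) (by norm_num) (by norm_num) (by norm_num) H.c_nonneg
    (H.cnn hF 1 0)).castK (by norm_num)).castN (by norm_num)).cst (by ring)

/-- monomial `Q₁G₁·𝔇(Λ)·G₂Q*₂, first-order part Lm₁∇` (2 + 1 + 2 factors) is in `𝒮(2, θ(cΛK(u))¹⁵)`. [folklore] -/
theorem EstHyp.shape_m3a (hF : F.Valid) (H : EstHyp F X t U₁ U₂) :
    OpShp F H.bB₁ H.bB₂ H.p₁ H.p₂ 2 (H.θ * (H.c * (F.Λ * F.K F.u)) ^ 15)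
      (X.Q₁ * (X.G₁ * (H.Lm₁ * ((H.Dv * X.G₂) * (X.Qt₂))))) := by
  have hz : OpShp F H.bb₁ H.bB₂ H.p₁ H.p₂ 0 (H.θ * (H.c ^ 2 * (F.Λ * F.K F.u) ^ 2))
      (H.Lm₁ * ((H.Dv * X.G₂) * (X.Qt₂))) :=
    ((OpShp.zmul hF H.hP₂ H.zLm₁ (H.chain2 hF) (by norm_num) (by norm_num) (by norm_num) H.hθ (H.cnn hF 2 1)).castK
      (by norm_num)).cst (by ring)
  have hl1 : OpShp F H.bb₁ H.bB₂ H.p₁ H.p₂ 2 (H.θ * (H.c ^ 3 * (F.Λ * F.K F.u) ^ 3))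
      (X.G₁ * (H.Lm₁ * ((H.Dv * X.G₂) * (X.Qt₂)))) :=
    ((OpShp.fmul hF H.hP₁ H.mG₁ hz (by norm_num) (by norm_num) H.c_nonneg (H.snn hF 2 2)).castK
      (by norm_num)).cst (by ring)
  have hl0 : OpShp F H.bB₁ H.bB₂ H.p₁ H.p₂ 2 (H.θ * (H.c ^ 4 * (F.Λ * F.K F.u) ^ 4))
      (X.Q₁ * (X.G₁ * (H.Lm₁ * ((H.Dv * X.G₂) * (X.Qt₂))))) :=
    ((OpShp.fmul hF H.hP₁ H.mQ₁ hl1 (by norm_num) (by norm_num) H.c_nonneg (H.snn hF 3 3)).castK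
      (by norm_num)).cst (by ring)
  exact hl0.mono hF (H.snn hF 4 4) (H.sle hF (by norm_num : 4 ≤ 15) (by norm_num : 4 ≤ 15))

/-- monomial `Q₁G₁·𝔇(Λ)·G₂Q*₂, zeroth-order part Lm₀` (2 + 1 + 2 factors) is in `𝒮(2, θ(cΛK(u))¹⁵)`. [folklore] -/
theorem EstHyp.shape_m3b (hF : F.Valid) (H : EstHyp F X t U₁ U₂) :
    OpShp F H.bB₁ H.bB₂ H.p₁ H.p₂ 2 (H.θ * (H.c * (F.Λ * F.K F.u)) ^ 15)
      (X.Q₁ * (X.G₁ * (H.Lm₀ * (X.G₂ * (X.Qt₂))))) := by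
  have hz : OpShp F H.bb₁ H.bB₂ H.p₁ H.p₂ 0 (H.θ * (H.c ^ 2 * (F.Λ * F.K F.u) ^ 2))
      (H.Lm₀ * (X.G₂ * (X.Qt₂))) :=
    ((OpShp.zmul hF H.hP₂ H.zLm₀ (H.chain1 hF) (by norm_num) (by norm_num) (by norm_num) H.hθ (H.cnn hF 2 1)).castK
      (by norm_num)).cst (by ring)
  have hl1 : OpShp F H.bb₁ H.bB₂ H.p₁ H.p₂ 2 (H.θ * (H.c ^ 3 * (F.Λ * F.K F.u) ^ 3))
      (X.G₁ * (H.Lm₀ * (X.G₂ * (X.Qt₂)))) :=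
    ((OpShp.fmul hF H.hP₁ H.mG₁ hz (by norm_num) (by norm_num) H.c_nonneg (H.snn hF 2 2)).castK
      (by norm_num)).cst (by ring)
  have hl0 : OpShp F H.bB₁ H.bB₂ H.p₁ H.p₂ 2 (H.θ * (H.c ^ 4 * (F.Λ * F.K F.u) ^ 4))
      (X.Q₁ * (X.G₁ * (H.Lm₀ * (X.G₂ * (X.Qt₂))))) :=
    ((OpShp.fmul hF H.hP₁ H.mQ₁ hl1 (by norm_num) (by norm_num) H.c_nonneg (H.snn hF 3 3)).castK
      (by norm_num)).cst (by ring)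
  exact hl0.mono hF (H.snn hF 4 4) (H.sle hF (by norm_num : 4 ≤ 15) (by norm_num : 4 ≤ 15))

/-- monomial `Q₁G₁·𝔇(A)·G₂Q*₂` (2 + 1 + 2 factors) is in `𝒮(2, θ(cΛK(u))¹⁵)`. [folklore] -/
theorem EstHyp.shape_m4 (hF : F.Valid) (H : EstHyp F X t U₁ U₂) :
    OpShp F H.bB₁ H.bB₂ H.p₁ H.p₂ 2 (H.θ * (H.c * (F.Λ * F.K F.u)) ^ 15)
      (X.Q₁ * (X.G₁ * (X.dA * (X.G₂ * (X.Qt₂))))) := by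
  have hz : OpShp F H.bb₁ H.bB₂ H.p₁ H.p₂ 0 (H.θ * (H.c ^ 2 * (F.Λ * F.K F.u) ^ 2))
      (X.dA * (X.G₂ * (X.Qt₂))) :=
    ((OpShp.zmul hF H.hP₂ H.zA (H.chain1 hF) (by norm_num) (by norm_num) (by norm_num) H.hθ (H.cnn hF 2 1)).castK
      (by norm_num)).cst (by ring)
  have hl1 : OpShp F H.bb₁ H.bB₂ H.p₁ H.p₂ 2 (H.θ * (H.c ^ 3 * (F.Λ * F.K F.u) ^ 3))
      (X.G₁ * (X.dA * (X.G₂ * (X.Qt₂)))) :=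
    ((OpShp.fmul hF H.hP₁ H.mG₁ hz (by norm_num) (by norm_num) H.c_nonneg (H.snn hF 2 2)).castK
      (by norm_num)).cst (by ring)
  have hl0 : OpShp F H.bB₁ H.bB₂ H.p₁ H.p₂ 2 (H.θ * (H.c ^ 4 * (F.Λ * F.K F.u) ^ 4))
      (X.Q₁ * (X.G₁ * (X.dA * (X.G₂ * (X.Qt₂))))) :=
    ((OpShp.fmul hF H.hP₁ H.mQ₁ hl1 (by norm_num) (by norm_num) H.c_nonneg (H.snn hF 3 3)).castK
      (by norm_num)).cst (by ring)
  exact hl0.mono hF (H.snn hF 4 4) (H.sle hF (by norm_num : 4 ≤ 15) (by norm_num : 4 ≤ 15))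

/-- right chain, 2 factors. [folklore] -/
theorem EstHyp.chain3 (hF : F.Valid) (H : EstHyp F X t U₁ U₂) :
    OpDec F H.bs₂ H.bB₂ H.p₂ H.p₂ 2 1 (H.c ^ 2 * (F.Λ * F.K F.u) ^ 1)
      ((X.Dt * X.G₂) * (X.Qt₂)) :=
  (((OpDec.fmul hF H.hP₂ H.mDtG₂ (H.chain0 hF) (by norm_num) (by norm_num) (by norm_num) H.c_nonneg
    (H.cnn hF 1 0)).castK (by norm_num)).castN (by norm_num)).cst (by ring)

/-- monomial `Q₁G₁·𝔇(∂)·∂*G₂Q*₂` (2 + 1 + 2 factors) is in `𝒮(2, θ(cΛK(u))¹⁵)`. [folklore] -/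
theorem EstHyp.shape_m5 (hF : F.Valid) (H : EstHyp F X t U₁ U₂) :
    OpShp F H.bB₁ H.bB₂ H.p₁ H.p₂ 2 (H.θ * (H.c * (F.Λ * F.K F.u)) ^ 15)
      (X.Q₁ * (X.G₁ * (X.dD * ((X.Dt * X.G₂) * (X.Qt₂))))) := by
  have hz : OpShp F H.bb₁ H.bB₂ H.p₁ H.p₂ 0 (H.θ * (H.c ^ 2 * (F.Λ * F.K F.u) ^ 2))
      (X.dD * ((X.Dt * X.G₂) * (X.Qt₂))) :=
    ((OpShp.zmul hF H.hP₂ H.zD (H.chain3 hF) (by norm_num) (by norm_num) (by norm_num) H.hθ (H.cnn hF 2 1)).castK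
      (by norm_num)).cst (by ring)
  have hl1 : OpShp F H.bb₁ H.bB₂ H.p₁ H.p₂ 2 (H.θ * (H.c ^ 3 * (F.Λ * F.K F.u) ^ 3))
      (X.G₁ * (X.dD * ((X.Dt * X.G₂) * (X.Qt₂)))) :=
    ((OpShp.fmul hF H.hP₁ H.mG₁ hz (by norm_num) (by norm_num) H.c_nonneg (H.snn hF 2 2)).castK
      (by norm_num)).cst (by ring)
  have hl0 : OpShp F H.bB₁ H.bB₂ H.p₁ H.p₂ 2 (H.θ * (H.c ^ 4 * (F.Λ * F.K F.u) ^ 4))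
      (X.Q₁ * (X.G₁ * (X.dD * ((X.Dt * X.G₂) * (X.Qt₂))))) :=
    ((OpShp.fmul hF H.hP₁ H.mQ₁ hl1 (by norm_num) (by norm_num) H.c_nonneg (H.snn hF 3 3)).castK
      (by norm_num)).cst (by ring)
  exact hl0.mono hF (H.snn hF 4 4) (H.sle hF (by norm_num : 4 ≤ 15) (by norm_num : 4 ≤ 15))

/-- right chain, 3 factors. [folklore] -/
theorem EstHyp.chain4 (hF : F.Valid) (H : EstHyp F X t U₁ U₂) :
    OpDec F H.bs₂ H.bB₂ H.p₂ H.p₂ 4 3 (H.c ^ 3 * (F.Λ * F.K F.u) ^ 2)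
      (X.G'₂ * ((X.Dt * X.G₂) * (X.Qt₂))) :=
  (((OpDec.fmul hF H.hP₂ H.mG'₂ (H.chain3 hF) (by norm_num) (by norm_num) (by norm_num) H.c_nonneg
    (H.cnn hF 2 1)).castK (by norm_num)).castN (by norm_num)).cst (by ring)

/-- right chain, 4 factors. [folklore] -/
theorem EstHyp.chain5 (hF : F.Valid) (H : EstHyp F X t U₁ U₂) :
    OpDec F H.bS₂ H.bB₂ H.p₂ H.p₂ 6 3 (H.c ^ 4 * (F.Λ * F.K F.u) ^ 3)
      (X.Q'₂ * (X.G'₂ * ((X.Dt * X.G₂) * (X.Qt₂)))) :=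
  (((OpDec.fmul hF H.hP₂ H.mQ'₂ (H.chain4 hF) (by norm_num) (by norm_num) (by norm_num) H.c_nonneg
    (H.cnn hF 3 2)).castK (by norm_num)).castN (by norm_num)).cst (by ring)

/-- right chain, 5 factors. [folklore] -/
theorem EstHyp.chain6 (hF : F.Valid) (H : EstHyp F X t U₁ U₂) :
    OpDec F H.bS₂ H.bB₂ H.p₂ H.p₂ 8 (-1) (H.c ^ 5 * (F.Λ * F.K F.u) ^ 4)
      (X.C₂ * (X.Q'₂ * (X.G'₂ * ((X.Dt * X.G₂) * (X.Qt₂))))) :=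
  (((OpDec.fmul hF H.hP₂ H.mC₂ (H.chain5 hF) (by norm_num) (by norm_num) (by norm_num) H.c_nonneg
    (H.cnn hF 4 3)).castK (by norm_num)).castN (by norm_num)).cst (by ring)

/-- right chain, 6 factors. [folklore] -/
theorem EstHyp.chain7 (hF : F.Valid) (H : EstHyp F X t U₁ U₂) :
    OpDec F H.bs₂ H.bB₂ H.p₂ H.p₂ 10 (-1) (H.c ^ 6 * (F.Λ * F.K F.u) ^ 5)
      (X.Q't₂ * (X.C₂ * (X.Q'₂ * (X.G'₂ * ((X.Dt * X.G₂) * (X.Qt₂)))))) :=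
  (((OpDec.fmul hF H.hP₂ H.mQ't₂ (H.chain6 hF) (by norm_num) (by norm_num) (by norm_num) H.c_nonneg
    (H.cnn hF 5 4)).castK (by norm_num)).castN (by norm_num)).cst (by ring)

/-- right chain, 7 factors. [folklore] -/
theorem EstHyp.chain8 (hF : F.Valid) (H : EstHyp F X t U₁ U₂) :
    OpDec F H.bs₂ H.bB₂ H.p₂ H.p₂ 12 1 (H.c ^ 7 * (F.Λ * F.K F.u) ^ 6)
      (X.G'₂ * (X.Q't₂ * (X.C₂ * (X.Q'₂ * (X.G'₂ * ((X.Dt * X.G₂) * (X.Qt₂))))))) :=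
  (((OpDec.fmul hF H.hP₂ H.mG'₂ (H.chain7 hF) (by norm_num) (by norm_num) (by norm_num) H.c_nonneg
    (H.cnn hF 6 5)).castK (by norm_num)).castN (by norm_num)).cst (by ring)

/-- monomial `Q₁G₁·𝔇(∂)·G′₂Q′*₂C₂Q′₂G′₂∂*G₂Q*₂` (2 + 1 + 7 factors) is in `𝒮(2, θ(cΛK(u))¹⁵)`. [folklore] -/
theorem EstHyp.shape_m6 (hF : F.Valid) (H : EstHyp F X t U₁ U₂) :
    OpShp F H.bB₁ H.bB₂ H.p₁ H.p₂ 2 (H.θ * (H.c * (F.Λ * F.K F.u)) ^ 15)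
      (X.Q₁ * (X.G₁ * (X.dD * (X.G'₂ * (X.Q't₂ * (X.C₂ * (X.Q'₂ * (X.G'₂ * ((X.Dt * X.G₂) * (X.Qt₂)))))))))) := by
  have hz : OpShp F H.bb₁ H.bB₂ H.p₁ H.p₂ 0 (H.θ * (H.c ^ 7 * (F.Λ * F.K F.u) ^ 7))
      (X.dD * (X.G'₂ * (X.Q't₂ * (X.C₂ * (X.Q'₂ * (X.G'₂ * ((X.Dt * X.G₂) * (X.Qt₂)))))))) :=
    ((OpShp.zmul hF H.hP₂ H.zD (H.chain8 hF) (by norm_num) (by norm_num) (by norm_num) H.hθ (H.cnn hF 7 6)).castK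
      (by norm_num)).cst (by ring)
  have hl1 : OpShp F H.bb₁ H.bB₂ H.p₁ H.p₂ 2 (H.θ * (H.c ^ 8 * (F.Λ * F.K F.u) ^ 8))
      (X.G₁ * (X.dD * (X.G'₂ * (X.Q't₂ * (X.C₂ * (X.Q'₂ * (X.G'₂ * ((X.Dt * X.G₂) * (X.Qt₂))))))))) :=
    ((OpShp.fmul hF H.hP₁ H.mG₁ hz (by norm_num) (by norm_num) H.c_nonneg (H.snn hF 7 7)).castK
      (by norm_num)).cst (by ring)
  have hl0 : OpShp F H.bB₁ H.bB₂ H.p₁ H.p₂ 2 (H.θ * (H.c ^ 9 * (F.Λ * F.K F.u) ^ 9))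
      (X.Q₁ * (X.G₁ * (X.dD * (X.G'₂ * (X.Q't₂ * (X.C₂ * (X.Q'₂ * (X.G'₂ * ((X.Dt * X.G₂) * (X.Qt₂)))))))))) :=
    ((OpShp.fmul hF H.hP₁ H.mQ₁ hl1 (by norm_num) (by norm_num) H.c_nonneg (H.snn hF 8 8)).castK
      (by norm_num)).cst (by ring)
  exact hl0.mono hF (H.snn hF 9 9) (H.sle hF (by norm_num : 9 ≤ 15) (by norm_num : 9 ≤ 15))

/-- monomial `Q₁G₁·∂𝔇(∂*)·G₂Q*₂, first-order part Dm₁∇` (2 + 1 + 2 factors) is in `𝒮(2, θ(cΛK(u))¹⁵)`. [folklore] -/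
theorem EstHyp.shape_m7a (hF : F.Valid) (H : EstHyp F X t U₁ U₂) :
    OpShp F H.bB₁ H.bB₂ H.p₁ H.p₂ 2 (H.θ * (H.c * (F.Λ * F.K F.u)) ^ 15)
      (X.Q₁ * (X.G₁ * (H.Dm₁ * ((H.Dv * X.G₂) * (X.Qt₂))))) := by
  have hz : OpShp F H.bb₁ H.bB₂ H.p₁ H.p₂ 0 (H.θ * (H.c ^ 2 * (F.Λ * F.K F.u) ^ 2))
      (H.Dm₁ * ((H.Dv * X.G₂) * (X.Qt₂))) :=
    ((OpShp.zmul hF H.hP₂ H.zDm₁ (H.chain2 hF) (by norm_num) (by norm_num) (by norm_num) H.hθ (H.cnn hF 2 1)).castK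
      (by norm_num)).cst (by ring)
  have hl1 : OpShp F H.bb₁ H.bB₂ H.p₁ H.p₂ 2 (H.θ * (H.c ^ 3 * (F.Λ * F.K F.u) ^ 3))
      (X.G₁ * (H.Dm₁ * ((H.Dv * X.G₂) * (X.Qt₂)))) :=
    ((OpShp.fmul hF H.hP₁ H.mG₁ hz (by norm_num) (by norm_num) H.c_nonneg (H.snn hF 2 2)).castK
      (by norm_num)).cst (by ring)
  have hl0 : OpShp F H.bB₁ H.bB₂ H.p₁ H.p₂ 2 (H.θ * (H.c ^ 4 * (F.Λ * F.K F.u) ^ 4))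
      (X.Q₁ * (X.G₁ * (H.Dm₁ * ((H.Dv * X.G₂) * (X.Qt₂))))) :=
    ((OpShp.fmul hF H.hP₁ H.mQ₁ hl1 (by norm_num) (by norm_num) H.c_nonneg (H.snn hF 3 3)).castK
      (by norm_num)).cst (by ring)
  exact hl0.mono hF (H.snn hF 4 4) (H.sle hF (by norm_num : 4 ≤ 15) (by norm_num : 4 ≤ 15))

/-- monomial `Q₁G₁·∂𝔇(∂*)·G₂Q*₂, zeroth-order part Dm₀` (2 + 1 + 2 factors) is in `𝒮(2, θ(cΛK(u))¹⁵)`. [folklore] -/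
theorem EstHyp.shape_m7b (hF : F.Valid) (H : EstHyp F X t U₁ U₂) :
    OpShp F H.bB₁ H.bB₂ H.p₁ H.p₂ 2 (H.θ * (H.c * (F.Λ * F.K F.u)) ^ 15)
      (X.Q₁ * (X.G₁ * (H.Dm₀ * (X.G₂ * (X.Qt₂))))) := by
  have hz : OpShp F H.bb₁ H.bB₂ H.p₁ H.p₂ 0 (H.θ * (H.c ^ 2 * (F.Λ * F.K F.u) ^ 2))
      (H.Dm₀ * (X.G₂ * (X.Qt₂))) :=
    ((OpShp.zmul hF H.hP₂ H.zDm₀ (H.chain1 hF) (by norm_num) (by norm_num) (by norm_num) H.hθ (H.cnn hF 2 1)).castK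
      (by norm_num)).cst (by ring)
  have hl1 : OpShp F H.bb₁ H.bB₂ H.p₁ H.p₂ 2 (H.θ * (H.c ^ 3 * (F.Λ * F.K F.u) ^ 3))
      (X.G₁ * (H.Dm₀ * (X.G₂ * (X.Qt₂)))) :=
    ((OpShp.fmul hF H.hP₁ H.mG₁ hz (by norm_num) (by norm_num) H.c_nonneg (H.snn hF 2 2)).castK
      (by norm_num)).cst (by ring)
  have hl0 : OpShp F H.bB₁ H.bB₂ H.p₁ H.p₂ 2 (H.θ * (H.c ^ 4 * (F.Λ * F.K F.u) ^ 4))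
      (X.Q₁ * (X.G₁ * (H.Dm₀ * (X.G₂ * (X.Qt₂))))) :=
    ((OpShp.fmul hF H.hP₁ H.mQ₁ hl1 (by norm_num) (by norm_num) H.c_nonneg (H.snn hF 3 3)).castK
      (by norm_num)).cst (by ring)
  exact hl0.mono hF (H.snn hF 4 4) (H.sle hF (by norm_num : 4 ≤ 15) (by norm_num : 4 ≤ 15))

/-- monomial `Q₁G₁(∂G′₁)Q′*₁C₁Q′₁G′₁·𝔇(∂*)·G₂Q*₂` (7 + 1 + 2 factors) is in `𝒮(2, θ(cΛK(u))¹⁵)`. [folklore] -/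
theorem EstHyp.shape_m8 (hF : F.Valid) (H : EstHyp F X t U₁ U₂) :
    OpShp F H.bB₁ H.bB₂ H.p₁ H.p₂ 2 (H.θ * (H.c * (F.Λ * F.K F.u)) ^ 15)
      (X.Q₁ * (X.G₁ * ((X.D * X.G'₁) * (X.Q't₁ * (X.C₁ * (X.Q'₁ * (X.G'₁ * (X.dDt * (X.G₂ * (X.Qt₂)))))))))) := by
  have hz : OpShp F H.bs₁ H.bB₂ H.p₁ H.p₂ 1 (H.θ * (H.c ^ 2 * (F.Λ * F.K F.u) ^ 2))
      (X.dDt * (X.G₂ * (X.Qt₂))) :=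
    ((OpShp.zmul hF H.hP₂ H.zDt (H.chain1 hF) (by norm_num) (by norm_num) (by norm_num) H.hθ (H.cnn hF 2 1)).castK
      (by norm_num)).cst (by ring)
  have hl6 : OpShp F H.bs₁ H.bB₂ H.p₁ H.p₂ 3 (H.θ * (H.c ^ 3 * (F.Λ * F.K F.u) ^ 3))
      (X.G'₁ * (X.dDt * (X.G₂ * (X.Qt₂)))) :=
    ((OpShp.fmul hF H.hP₁ H.mG'₁ hz (by norm_num) (by norm_num) H.c_nonneg (H.snn hF 2 2)).castK
      (by norm_num)).cst (by ring)
  have hl5 : OpShp F H.bS₁ H.bB₂ H.p₁ H.p₂ 3 (H.θ * (H.c ^ 4 * (F.Λ * F.K F.u) ^ 4))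
      (X.Q'₁ * (X.G'₁ * (X.dDt * (X.G₂ * (X.Qt₂))))) :=
    ((OpShp.fmul hF H.hP₁ H.mQ'₁ hl6 (by norm_num) (by norm_num) H.c_nonneg (H.snn hF 3 3)).castK
      (by norm_num)).cst (by ring)
  have hl4 : OpShp F H.bS₁ H.bB₂ H.p₁ H.p₂ (-1) (H.θ * (H.c ^ 5 * (F.Λ * F.K F.u) ^ 5))
      (X.C₁ * (X.Q'₁ * (X.G'₁ * (X.dDt * (X.G₂ * (X.Qt₂)))))) :=
    ((OpShp.fmul hF H.hP₁ H.mC₁ hl5 (by norm_num) (by norm_num) H.c_nonneg (H.snn hF 4 4)).castK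
      (by norm_num)).cst (by ring)
  have hl3 : OpShp F H.bs₁ H.bB₂ H.p₁ H.p₂ (-1) (H.θ * (H.c ^ 6 * (F.Λ * F.K F.u) ^ 6))
      (X.Q't₁ * (X.C₁ * (X.Q'₁ * (X.G'₁ * (X.dDt * (X.G₂ * (X.Qt₂))))))) :=
    ((OpShp.fmul hF H.hP₁ H.mQ't₁ hl4 (by norm_num) (by norm_num) H.c_nonneg (H.snn hF 5 5)).castK
      (by norm_num)).cst (by ring)
  have hl2 : OpShp F H.bb₁ H.bB₂ H.p₁ H.p₂ 0 (H.θ * (H.c ^ 7 * (F.Λ * F.K F.u) ^ 7))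
      ((X.D * X.G'₁) * (X.Q't₁ * (X.C₁ * (X.Q'₁ * (X.G'₁ * (X.dDt * (X.G₂ * (X.Qt₂)))))))) :=
    ((OpShp.fmul hF H.hP₁ H.mDG'₁ hl3 (by norm_num) (by norm_num) H.c_nonneg (H.snn hF 6 6)).castK
      (by norm_num)).cst (by ring)
  have hl1 : OpShp F H.bb₁ H.bB₂ H.p₁ H.p₂ 2 (H.θ * (H.c ^ 8 * (F.Λ * F.K F.u) ^ 8))
      (X.G₁ * ((X.D * X.G'₁) * (X.Q't₁ * (X.C₁ * (X.Q'₁ * (X.G'₁ * (X.dDt * (X.G₂ * (X.Qt₂))))))))) :=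
    ((OpShp.fmul hF H.hP₁ H.mG₁ hl2 (by norm_num) (by norm_num) H.c_nonneg (H.snn hF 7 7)).castK
      (by norm_num)).cst (by ring)
  have hl0 : OpShp F H.bB₁ H.bB₂ H.p₁ H.p₂ 2 (H.θ * (H.c ^ 9 * (F.Λ * F.K F.u) ^ 9))
      (X.Q₁ * (X.G₁ * ((X.D * X.G'₁) * (X.Q't₁ * (X.C₁ * (X.Q'₁ * (X.G'₁ * (X.dDt * (X.G₂ * (X.Qt₂)))))))))) :=
    ((OpShp.fmul hF H.hP₁ H.mQ₁ hl1 (by norm_num) (by norm_num) H.c_nonneg (H.snn hF 8 8)).castK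
      (by norm_num)).cst (by ring)
  exact hl0.mono hF (H.snn hF 9 9) (H.sle hF (by norm_num : 9 ≤ 15) (by norm_num : 9 ≤ 15))

/-- right chain, 7 factors. [folklore] -/
theorem EstHyp.chain9 (hF : F.Valid) (H : EstHyp F X t U₁ U₂) :
    OpDec F H.bb₂ H.bB₂ H.p₂ H.p₂ 12 0 (H.c ^ 7 * (F.Λ * F.K F.u) ^ 6)
      ((X.D * X.G'₂) * (X.Q't₂ * (X.C₂ * (X.Q'₂ * (X.G'₂ * ((X.Dt * X.G₂) * (X.Qt₂))))))) :=
  (((OpDec.fmul hF H.hP₂ H.mDG'₂ (H.chain7 hF) (by norm_num) (by norm_num) (by norm_num) H.c_nonneg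
    (H.cnn hF 6 5)).castK (by norm_num)).castN (by norm_num)).cst (by ring)

/-- monomial `Q₁G₁(∂G′₁)·𝔇(Δ′_a)·G′₂Q′*₂C₂Q′₂G′₂∂*G₂Q*₂, part Am₁∂` (3 + 1 + 7 factors) is in `𝒮(2, θ(cΛK(u))¹⁵)`. [folklore] -/
theorem EstHyp.shape_m9a (hF : F.Valid) (H : EstHyp F X t U₁ U₂) :
    OpShp F H.bB₁ H.bB₂ H.p₁ H.p₂ 2 (H.θ * (H.c * (F.Λ * F.K F.u)) ^ 15)
      (X.Q₁ * (X.G₁ * ((X.D * X.G'₁) * (H.Am₁ * ((X.D * X.G'₂) * (X.Q't₂ * (X.C₂ * (X.Q'₂ * (X.G'₂ * ((X.Dt * X.G₂) * (X.Qt₂))))))))))) := by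
  have hz : OpShp F H.bs₁ H.bB₂ H.p₁ H.p₂ (-1) (H.θ * (H.c ^ 7 * (F.Λ * F.K F.u) ^ 7))
      (H.Am₁ * ((X.D * X.G'₂) * (X.Q't₂ * (X.C₂ * (X.Q'₂ * (X.G'₂ * ((X.Dt * X.G₂) * (X.Qt₂)))))))) :=
    ((OpShp.zmul hF H.hP₂ H.zAm₁ (H.chain9 hF) (by norm_num) (by norm_num) (by norm_num) H.hθ (H.cnn hF 7 6)).castK
      (by norm_num)).cst (by ring)
  have hl2 : OpShp F H.bb₁ H.bB₂ H.p₁ H.p₂ 0 (H.θ * (H.c ^ 8 * (F.Λ * F.K F.u) ^ 8))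
      ((X.D * X.G'₁) * (H.Am₁ * ((X.D * X.G'₂) * (X.Q't₂ * (X.C₂ * (X.Q'₂ * (X.G'₂ * ((X.Dt * X.G₂) * (X.Qt₂))))))))) :=
    ((OpShp.fmul hF H.hP₁ H.mDG'₁ hz (by norm_num) (by norm_num) H.c_nonneg (H.snn hF 7 7)).castK
      (by norm_num)).cst (by ring)
  have hl1 : OpShp F H.bb₁ H.bB₂ H.p₁ H.p₂ 2 (H.θ * (H.c ^ 9 * (F.Λ * F.K F.u) ^ 9))
      (X.G₁ * ((X.D * X.G'₁) * (H.Am₁ * ((X.D * X.G'₂) * (X.Q't₂ * (X.C₂ * (X.Q'₂ * (X.G'₂ * ((X.Dt * X.G₂) * (X.Qt₂)))))))))) :=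
    ((OpShp.fmul hF H.hP₁ H.mG₁ hl2 (by norm_num) (by norm_num) H.c_nonneg (H.snn hF 8 8)).castK
      (by norm_num)).cst (by ring)
  have hl0 : OpShp F H.bB₁ H.bB₂ H.p₁ H.p₂ 2 (H.θ * (H.c ^ 10 * (F.Λ * F.K F.u) ^ 10))
      (X.Q₁ * (X.G₁ * ((X.D * X.G'₁) * (H.Am₁ * ((X.D * X.G'₂) * (X.Q't₂ * (X.C₂ * (X.Q'₂ * (X.G'₂ * ((X.Dt * X.G₂) * (X.Qt₂))))))))))) :=
    ((OpShp.fmul hF H.hP₁ H.mQ₁ hl1 (by norm_num) (by norm_num) H.c_nonneg (H.snn hF 9 9)).castK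
      (by norm_num)).cst (by ring)
  exact hl0.mono hF (H.snn hF 10 10) (H.sle hF (by norm_num : 10 ≤ 15) (by norm_num : 10 ≤ 15))

/-- monomial `the same, part Am₀` (3 + 1 + 7 factors) is in `𝒮(2, θ(cΛK(u))¹⁵)`. [folklore] -/
theorem EstHyp.shape_m9b (hF : F.Valid) (H : EstHyp F X t U₁ U₂) :
    OpShp F H.bB₁ H.bB₂ H.p₁ H.p₂ 2 (H.θ * (H.c * (F.Λ * F.K F.u)) ^ 15)
      (X.Q₁ * (X.G₁ * ((X.D * X.G'₁) * (H.Am₀ * (X.G'₂ * (X.Q't₂ * (X.C₂ * (X.Q'₂ * (X.G'₂ * ((X.Dt * X.G₂) * (X.Qt₂))))))))))) := by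
  have hz : OpShp F H.bs₁ H.bB₂ H.p₁ H.p₂ (-1) (H.θ * (H.c ^ 7 * (F.Λ * F.K F.u) ^ 7))
      (H.Am₀ * (X.G'₂ * (X.Q't₂ * (X.C₂ * (X.Q'₂ * (X.G'₂ * ((X.Dt * X.G₂) * (X.Qt₂)))))))) :=
    ((OpShp.zmul hF H.hP₂ H.zAm₀ (H.chain8 hF) (by norm_num) (by norm_num) (by norm_num) H.hθ (H.cnn hF 7 6)).castK
      (by norm_num)).cst (by ring)
  have hl2 : OpShp F H.bb₁ H.bB₂ H.p₁ H.p₂ 0 (H.θ * (H.c ^ 8 * (F.Λ * F.K F.u) ^ 8))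
      ((X.D * X.G'₁) * (H.Am₀ * (X.G'₂ * (X.Q't₂ * (X.C₂ * (X.Q'₂ * (X.G'₂ * ((X.Dt * X.G₂) * (X.Qt₂))))))))) :=
    ((OpShp.fmul hF H.hP₁ H.mDG'₁ hz (by norm_num) (by norm_num) H.c_nonneg (H.snn hF 7 7)).castK
      (by norm_num)).cst (by ring)
  have hl1 : OpShp F H.bb₁ H.bB₂ H.p₁ H.p₂ 2 (H.θ * (H.c ^ 9 * (F.Λ * F.K F.u) ^ 9))
      (X.G₁ * ((X.D * X.G'₁) * (H.Am₀ * (X.G'₂ * (X.Q't₂ * (X.C₂ * (X.Q'₂ * (X.G'₂ * ((X.Dt * X.G₂) * (X.Qt₂)))))))))) :=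
    ((OpShp.fmul hF H.hP₁ H.mG₁ hl2 (by norm_num) (by norm_num) H.c_nonneg (H.snn hF 8 8)).castK
      (by norm_num)).cst (by ring)
  have hl0 : OpShp F H.bB₁ H.bB₂ H.p₁ H.p₂ 2 (H.θ * (H.c ^ 10 * (F.Λ * F.K F.u) ^ 10))
      (X.Q₁ * (X.G₁ * ((X.D * X.G'₁) * (H.Am₀ * (X.G'₂ * (X.Q't₂ * (X.C₂ * (X.Q'₂ * (X.G'₂ * ((X.Dt * X.G₂) * (X.Qt₂))))))))))) :=
    ((OpShp.fmul hF H.hP₁ H.mQ₁ hl1 (by norm_num) (by norm_num) H.c_nonneg (H.snn hF 9 9)).castK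
      (by norm_num)).cst (by ring)
  exact hl0.mono hF (H.snn hF 10 10) (H.sle hF (by norm_num : 10 ≤ 15) (by norm_num : 10 ≤ 15))

/-- monomial `Q₁G₁(∂G′₁)·𝔇(Q′*)·C₂Q′₂G′₂∂*G₂Q*₂` (3 + 1 + 5 factors) is in `𝒮(2, θ(cΛK(u))¹⁵)`. [folklore] -/
theorem EstHyp.shape_m10 (hF : F.Valid) (H : EstHyp F X t U₁ U₂) :
    OpShp F H.bB₁ H.bB₂ H.p₁ H.p₂ 2 (H.θ * (H.c * (F.Λ * F.K F.u)) ^ 15)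
      (X.Q₁ * (X.G₁ * ((X.D * X.G'₁) * (X.dQ't * (X.C₂ * (X.Q'₂ * (X.G'₂ * ((X.Dt * X.G₂) * (X.Qt₂))))))))) := by
  have hz : OpShp F H.bs₁ H.bB₂ H.p₁ H.p₂ (-1) (H.θ * (H.c ^ 5 * (F.Λ * F.K F.u) ^ 5))
      (X.dQ't * (X.C₂ * (X.Q'₂ * (X.G'₂ * ((X.Dt * X.G₂) * (X.Qt₂)))))) :=
    ((OpShp.zmul hF H.hP₂ H.zQ't (H.chain6 hF) (by norm_num) (by norm_num) (by norm_num) H.hθ (H.cnn hF 5 4)).castK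
      (by norm_num)).cst (by ring)
  have hl2 : OpShp F H.bb₁ H.bB₂ H.p₁ H.p₂ 0 (H.θ * (H.c ^ 6 * (F.Λ * F.K F.u) ^ 6))
      ((X.D * X.G'₁) * (X.dQ't * (X.C₂ * (X.Q'₂ * (X.G'₂ * ((X.Dt * X.G₂) * (X.Qt₂))))))) :=
    ((OpShp.fmul hF H.hP₁ H.mDG'₁ hz (by norm_num) (by norm_num) H.c_nonneg (H.snn hF 5 5)).castK
      (by norm_num)).cst (by ring)
  have hl1 : OpShp F H.bb₁ H.bB₂ H.p₁ H.p₂ 2 (H.θ * (H.c ^ 7 * (F.Λ * F.K F.u) ^ 7))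
      (X.G₁ * ((X.D * X.G'₁) * (X.dQ't * (X.C₂ * (X.Q'₂ * (X.G'₂ * ((X.Dt * X.G₂) * (X.Qt₂)))))))) :=
    ((OpShp.fmul hF H.hP₁ H.mG₁ hl2 (by norm_num) (by norm_num) H.c_nonneg (H.snn hF 6 6)).castK
      (by norm_num)).cst (by ring)
  have hl0 : OpShp F H.bB₁ H.bB₂ H.p₁ H.p₂ 2 (H.θ * (H.c ^ 8 * (F.Λ * F.K F.u) ^ 8))
      (X.Q₁ * (X.G₁ * ((X.D * X.G'₁) * (X.dQ't * (X.C₂ * (X.Q'₂ * (X.G'₂ * ((X.Dt * X.G₂) * (X.Qt₂))))))))) :=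
    ((OpShp.fmul hF H.hP₁ H.mQ₁ hl1 (by norm_num) (by norm_num) H.c_nonneg (H.snn hF 7 7)).castK
      (by norm_num)).cst (by ring)
  exact hl0.mono hF (H.snn hF 8 8) (H.sle hF (by norm_num : 8 ≤ 15) (by norm_num : 8 ≤ 15))

/-- right chain, 8 factors. [folklore] -/
theorem EstHyp.chain10 (hF : F.Valid) (H : EstHyp F X t U₁ U₂) :
    OpDec F H.bs₂ H.bB₂ H.p₂ H.p₂ 14 3 (H.c ^ 8 * (F.Λ * F.K F.u) ^ 7)
      (X.G'₂ * (X.G'₂ * (X.Q't₂ * (X.C₂ * (X.Q'₂ * (X.G'₂ * ((X.Dt * X.G₂) * (X.Qt₂)))))))) :=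
  (((OpDec.fmul hF H.hP₂ H.mG'₂ (H.chain8 hF) (by norm_num) (by norm_num) (by norm_num) H.c_nonneg
    (H.cnn hF 7 6)).castK (by norm_num)).castN (by norm_num)).cst (by ring)

/-- monomial `Q₁G₁(∂G′₁)Q′*₁C₁·𝔇(Q′)·G′₂²Q′*₂C₂Q′₂G′₂∂*G₂Q*₂` (5 + 1 + 8 factors) is in `𝒮(2, θ(cΛK(u))¹⁵)`. [folklore] -/
theorem EstHyp.shape_m11 (hF : F.Valid) (H : EstHyp F X t U₁ U₂) :
    OpShp F H.bB₁ H.bB₂ H.p₁ H.p₂ 2 (H.θ * (H.c * (F.Λ * F.K F.u)) ^ 15)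
      (X.Q₁ * (X.G₁ * ((X.D * X.G'₁) * (X.Q't₁ * (X.C₁ * (X.dQ' * (X.G'₂ * (X.G'₂ * (X.Q't₂ * (X.C₂ * (X.Q'₂ * (X.G'₂ * ((X.Dt * X.G₂) * (X.Qt₂)))))))))))))) := by
  have hz : OpShp F H.bS₁ H.bB₂ H.p₁ H.p₂ 3 (H.θ * (H.c ^ 8 * (F.Λ * F.K F.u) ^ 8))
      (X.dQ' * (X.G'₂ * (X.G'₂ * (X.Q't₂ * (X.C₂ * (X.Q'₂ * (X.G'₂ * ((X.Dt * X.G₂) * (X.Qt₂))))))))) :=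
    ((OpShp.zmul hF H.hP₂ H.zQ' (H.chain10 hF) (by norm_num) (by norm_num) (by norm_num) H.hθ (H.cnn hF 8 7)).castK
      (by norm_num)).cst (by ring)
  have hl4 : OpShp F H.bS₁ H.bB₂ H.p₁ H.p₂ (-1) (H.θ * (H.c ^ 9 * (F.Λ * F.K F.u) ^ 9))
      (X.C₁ * (X.dQ' * (X.G'₂ * (X.G'₂ * (X.Q't₂ * (X.C₂ * (X.Q'₂ * (X.G'₂ * ((X.Dt * X.G₂) * (X.Qt₂)))))))))) :=
    ((OpShp.fmul hF H.hP₁ H.mC₁ hz (by norm_num) (by norm_num) H.c_nonneg (H.snn hF 8 8)).castK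
      (by norm_num)).cst (by ring)
  have hl3 : OpShp F H.bs₁ H.bB₂ H.p₁ H.p₂ (-1) (H.θ * (H.c ^ 10 * (F.Λ * F.K F.u) ^ 10))
      (X.Q't₁ * (X.C₁ * (X.dQ' * (X.G'₂ * (X.G'₂ * (X.Q't₂ * (X.C₂ * (X.Q'₂ * (X.G'₂ * ((X.Dt * X.G₂) * (X.Qt₂))))))))))) :=
    ((OpShp.fmul hF H.hP₁ H.mQ't₁ hl4 (by norm_num) (by norm_num) H.c_nonneg (H.snn hF 9 9)).castK
      (by norm_num)).cst (by ring)
  have hl2 : OpShp F H.bb₁ H.bB₂ H.p₁ H.p₂ 0 (H.θ * (H.c ^ 11 * (F.Λ * F.K F.u) ^ 11))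
      ((X.D * X.G'₁) * (X.Q't₁ * (X.C₁ * (X.dQ' * (X.G'₂ * (X.G'₂ * (X.Q't₂ * (X.C₂ * (X.Q'₂ * (X.G'₂ * ((X.Dt * X.G₂) * (X.Qt₂)))))))))))) :=
    ((OpShp.fmul hF H.hP₁ H.mDG'₁ hl3 (by norm_num) (by norm_num) H.c_nonneg (H.snn hF 10 10)).castK
      (by norm_num)).cst (by ring)
  have hl1 : OpShp F H.bb₁ H.bB₂ H.p₁ H.p₂ 2 (H.θ * (H.c ^ 12 * (F.Λ * F.K F.u) ^ 12))
      (X.G₁ * ((X.D * X.G'₁) * (X.Q't₁ * (X.C₁ * (X.dQ' * (X.G'₂ * (X.G'₂ * (X.Q't₂ * (X.C₂ * (X.Q'₂ * (X.G'₂ * ((X.Dt * X.G₂) * (X.Qt₂))))))))))))) :=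
    ((OpShp.fmul hF H.hP₁ H.mG₁ hl2 (by norm_num) (by norm_num) H.c_nonneg (H.snn hF 11 11)).castK
      (by norm_num)).cst (by ring)
  have hl0 : OpShp F H.bB₁ H.bB₂ H.p₁ H.p₂ 2 (H.θ * (H.c ^ 13 * (F.Λ * F.K F.u) ^ 13))
      (X.Q₁ * (X.G₁ * ((X.D * X.G'₁) * (X.Q't₁ * (X.C₁ * (X.dQ' * (X.G'₂ * (X.G'₂ * (X.Q't₂ * (X.C₂ * (X.Q'₂ * (X.G'₂ * ((X.Dt * X.G₂) * (X.Qt₂)))))))))))))) :=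
    ((OpShp.fmul hF H.hP₁ H.mQ₁ hl1 (by norm_num) (by norm_num) H.c_nonneg (H.snn hF 12 12)).castK
      (by norm_num)).cst (by ring)
  exact hl0.mono hF (H.snn hF 13 13) (H.sle hF (by norm_num : 13 ≤ 15) (by norm_num : 13 ≤ 15))

/-- right chain, 8 factors. [folklore] -/
theorem EstHyp.chain11 (hF : F.Valid) (H : EstHyp F X t U₁ U₂) :
    OpDec F H.bb₂ H.bB₂ H.p₂ H.p₂ 14 2 (H.c ^ 8 * (F.Λ * F.K F.u) ^ 7)
      ((X.D * X.G'₂) * (X.G'₂ * (X.Q't₂ * (X.C₂ * (X.Q'₂ * (X.G'₂ * ((X.Dt * X.G₂) * (X.Qt₂)))))))) :=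
  (((OpDec.fmul hF H.hP₂ H.mDG'₂ (H.chain8 hF) (by norm_num) (by norm_num) (by norm_num) H.c_nonneg
    (H.cnn hF 7 6)).castK (by norm_num)).castN (by norm_num)).cst (by ring)

/-- monomial `Q₁G₁(∂G′₁)Q′*₁C₁Q′₁G′₁·𝔇(Δ′_a)·G′₂²Q′*₂C₂Q′₂G′₂∂*G₂Q*₂, part Am₁∂` (7 + 1 + 8 factors) is in `𝒮(2, θ(cΛK(u))¹⁵)`. [folklore] -/
theorem EstHyp.shape_m12a (hF : F.Valid) (H : EstHyp F X t U₁ U₂) :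
    OpShp F H.bB₁ H.bB₂ H.p₁ H.p₂ 2 (H.θ * (H.c * (F.Λ * F.K F.u)) ^ 15)
      (X.Q₁ * (X.G₁ * ((X.D * X.G'₁) * (X.Q't₁ * (X.C₁ * (X.Q'₁ * (X.G'₁ * (H.Am₁ * ((X.D * X.G'₂) * (X.G'₂ * (X.Q't₂ * (X.C₂ * (X.Q'₂ * (X.G'₂ * ((X.Dt * X.G₂) * (X.Qt₂)))))))))))))))) := by
  have hz : OpShp F H.bs₁ H.bB₂ H.p₁ H.p₂ 1 (H.θ * (H.c ^ 8 * (F.Λ * F.K F.u) ^ 8))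
      (H.Am₁ * ((X.D * X.G'₂) * (X.G'₂ * (X.Q't₂ * (X.C₂ * (X.Q'₂ * (X.G'₂ * ((X.Dt * X.G₂) * (X.Qt₂))))))))) :=
    ((OpShp.zmul hF H.hP₂ H.zAm₁ (H.chain11 hF) (by norm_num) (by norm_num) (by norm_num) H.hθ (H.cnn hF 8 7)).castK
      (by norm_num)).cst (by ring)
  have hl6 : OpShp F H.bs₁ H.bB₂ H.p₁ H.p₂ 3 (H.θ * (H.c ^ 9 * (F.Λ * F.K F.u) ^ 9))
      (X.G'₁ * (H.Am₁ * ((X.D * X.G'₂) * (X.G'₂ * (X.Q't₂ * (X.C₂ * (X.Q'₂ * (X.G'₂ * ((X.Dt * X.G₂) * (X.Qt₂)))))))))) :=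
    ((OpShp.fmul hF H.hP₁ H.mG'₁ hz (by norm_num) (by norm_num) H.c_nonneg (H.snn hF 8 8)).castK
      (by norm_num)).cst (by ring)
  have hl5 : OpShp F H.bS₁ H.bB₂ H.p₁ H.p₂ 3 (H.θ * (H.c ^ 10 * (F.Λ * F.K F.u) ^ 10))
      (X.Q'₁ * (X.G'₁ * (H.Am₁ * ((X.D * X.G'₂) * (X.G'₂ * (X.Q't₂ * (X.C₂ * (X.Q'₂ * (X.G'₂ * ((X.Dt * X.G₂) * (X.Qt₂))))))))))) :=
    ((OpShp.fmul hF H.hP₁ H.mQ'₁ hl6 (by norm_num) (by norm_num) H.c_nonneg (H.snn hF 9 9)).castK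
      (by norm_num)).cst (by ring)
  have hl4 : OpShp F H.bS₁ H.bB₂ H.p₁ H.p₂ (-1) (H.θ * (H.c ^ 11 * (F.Λ * F.K F.u) ^ 11))
      (X.C₁ * (X.Q'₁ * (X.G'₁ * (H.Am₁ * ((X.D * X.G'₂) * (X.G'₂ * (X.Q't₂ * (X.C₂ * (X.Q'₂ * (X.G'₂ * ((X.Dt * X.G₂) * (X.Qt₂)))))))))))) :=
    ((OpShp.fmul hF H.hP₁ H.mC₁ hl5 (by norm_num) (by norm_num) H.c_nonneg (H.snn hF 10 10)).castK
      (by norm_num)).cst (by ring)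
  have hl3 : OpShp F H.bs₁ H.bB₂ H.p₁ H.p₂ (-1) (H.θ * (H.c ^ 12 * (F.Λ * F.K F.u) ^ 12))
      (X.Q't₁ * (X.C₁ * (X.Q'₁ * (X.G'₁ * (H.Am₁ * ((X.D * X.G'₂) * (X.G'₂ * (X.Q't₂ * (X.C₂ * (X.Q'₂ * (X.G'₂ * ((X.Dt * X.G₂) * (X.Qt₂))))))))))))) :=
    ((OpShp.fmul hF H.hP₁ H.mQ't₁ hl4 (by norm_num) (by norm_num) H.c_nonneg (H.snn hF 11 11)).castK
      (by norm_num)).cst (by ring)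
  have hl2 : OpShp F H.bb₁ H.bB₂ H.p₁ H.p₂ 0 (H.θ * (H.c ^ 13 * (F.Λ * F.K F.u) ^ 13))
      ((X.D * X.G'₁) * (X.Q't₁ * (X.C₁ * (X.Q'₁ * (X.G'₁ * (H.Am₁ * ((X.D * X.G'₂) * (X.G'₂ * (X.Q't₂ * (X.C₂ * (X.Q'₂ * (X.G'₂ * ((X.Dt * X.G₂) * (X.Qt₂)))))))))))))) :=
    ((OpShp.fmul hF H.hP₁ H.mDG'₁ hl3 (by norm_num) (by norm_num) H.c_nonneg (H.snn hF 12 12)).castK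
      (by norm_num)).cst (by ring)
  have hl1 : OpShp F H.bb₁ H.bB₂ H.p₁ H.p₂ 2 (H.θ * (H.c ^ 14 * (F.Λ * F.K F.u) ^ 14))
      (X.G₁ * ((X.D * X.G'₁) * (X.Q't₁ * (X.C₁ * (X.Q'₁ * (X.G'₁ * (H.Am₁ * ((X.D * X.G'₂) * (X.G'₂ * (X.Q't₂ * (X.C₂ * (X.Q'₂ * (X.G'₂ * ((X.Dt * X.G₂) * (X.Qt₂))))))))))))))) :=
    ((OpShp.fmul hF H.hP₁ H.mG₁ hl2 (by norm_num) (by norm_num) H.c_nonneg (H.snn hF 13 13)).castK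
      (by norm_num)).cst (by ring)
  have hl0 : OpShp F H.bB₁ H.bB₂ H.p₁ H.p₂ 2 (H.θ * (H.c ^ 15 * (F.Λ * F.K F.u) ^ 15))
      (X.Q₁ * (X.G₁ * ((X.D * X.G'₁) * (X.Q't₁ * (X.C₁ * (X.Q'₁ * (X.G'₁ * (H.Am₁ * ((X.D * X.G'₂) * (X.G'₂ * (X.Q't₂ * (X.C₂ * (X.Q'₂ * (X.G'₂ * ((X.Dt * X.G₂) * (X.Qt₂)))))))))))))))) :=
    ((OpShp.fmul hF H.hP₁ H.mQ₁ hl1 (by norm_num) (by norm_num) H.c_nonneg (H.snn hF 14 14)).castK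
      (by norm_num)).cst (by ring)
  exact hl0.mono hF (H.snn hF 15 15) (H.sle hF (by norm_num : 15 ≤ 15) (by norm_num : 15 ≤ 15))

/-- monomial `the same, part Am₀` (7 + 1 + 8 factors) is in `𝒮(2, θ(cΛK(u))¹⁵)`. [folklore] -/
theorem EstHyp.shape_m12b (hF : F.Valid) (H : EstHyp F X t U₁ U₂) :
    OpShp F H.bB₁ H.bB₂ H.p₁ H.p₂ 2 (H.θ * (H.c * (F.Λ * F.K F.u)) ^ 15)
      (X.Q₁ * (X.G₁ * ((X.D * X.G'₁) * (X.Q't₁ * (X.C₁ * (X.Q'₁ * (X.G'₁ * (H.Am₀ * (X.G'₂ * (X.G'₂ * (X.Q't₂ * (X.C₂ * (X.Q'₂ * (X.G'₂ * ((X.Dt * X.G₂) * (X.Qt₂)))))))))))))))) := by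
  have hz : OpShp F H.bs₁ H.bB₂ H.p₁ H.p₂ 1 (H.θ * (H.c ^ 8 * (F.Λ * F.K F.u) ^ 8))
      (H.Am₀ * (X.G'₂ * (X.G'₂ * (X.Q't₂ * (X.C₂ * (X.Q'₂ * (X.G'₂ * ((X.Dt * X.G₂) * (X.Qt₂))))))))) :=
    ((OpShp.zmul hF H.hP₂ H.zAm₀ (H.chain10 hF) (by norm_num) (by norm_num) (by norm_num) H.hθ (H.cnn hF 8 7)).castK
      (by norm_num)).cst (by ring)
  have hl6 : OpShp F H.bs₁ H.bB₂ H.p₁ H.p₂ 3 (H.θ * (H.c ^ 9 * (F.Λ * F.K F.u) ^ 9))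
      (X.G'₁ * (H.Am₀ * (X.G'₂ * (X.G'₂ * (X.Q't₂ * (X.C₂ * (X.Q'₂ * (X.G'₂ * ((X.Dt * X.G₂) * (X.Qt₂)))))))))) :=
    ((OpShp.fmul hF H.hP₁ H.mG'₁ hz (by norm_num) (by norm_num) H.c_nonneg (H.snn hF 8 8)).castK
      (by norm_num)).cst (by ring)
  have hl5 : OpShp F H.bS₁ H.bB₂ H.p₁ H.p₂ 3 (H.θ * (H.c ^ 10 * (F.Λ * F.K F.u) ^ 10))
      (X.Q'₁ * (X.G'₁ * (H.Am₀ * (X.G'₂ * (X.G'₂ * (X.Q't₂ * (X.C₂ * (X.Q'₂ * (X.G'₂ * ((X.Dt * X.G₂) * (X.Qt₂))))))))))) :=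
    ((OpShp.fmul hF H.hP₁ H.mQ'₁ hl6 (by norm_num) (by norm_num) H.c_nonneg (H.snn hF 9 9)).castK
      (by norm_num)).cst (by ring)
  have hl4 : OpShp F H.bS₁ H.bB₂ H.p₁ H.p₂ (-1) (H.θ * (H.c ^ 11 * (F.Λ * F.K F.u) ^ 11))
      (X.C₁ * (X.Q'₁ * (X.G'₁ * (H.Am₀ * (X.G'₂ * (X.G'₂ * (X.Q't₂ * (X.C₂ * (X.Q'₂ * (X.G'₂ * ((X.Dt * X.G₂) * (X.Qt₂)))))))))))) :=
    ((OpShp.fmul hF H.hP₁ H.mC₁ hl5 (by norm_num) (by norm_num) H.c_nonneg (H.snn hF 10 10)).castK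
      (by norm_num)).cst (by ring)
  have hl3 : OpShp F H.bs₁ H.bB₂ H.p₁ H.p₂ (-1) (H.θ * (H.c ^ 12 * (F.Λ * F.K F.u) ^ 12))
      (X.Q't₁ * (X.C₁ * (X.Q'₁ * (X.G'₁ * (H.Am₀ * (X.G'₂ * (X.G'₂ * (X.Q't₂ * (X.C₂ * (X.Q'₂ * (X.G'₂ * ((X.Dt * X.G₂) * (X.Qt₂))))))))))))) :=
    ((OpShp.fmul hF H.hP₁ H.mQ't₁ hl4 (by norm_num) (by norm_num) H.c_nonneg (H.snn hF 11 11)).castK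
      (by norm_num)).cst (by ring)
  have hl2 : OpShp F H.bb₁ H.bB₂ H.p₁ H.p₂ 0 (H.θ * (H.c ^ 13 * (F.Λ * F.K F.u) ^ 13))
      ((X.D * X.G'₁) * (X.Q't₁ * (X.C₁ * (X.Q'₁ * (X.G'₁ * (H.Am₀ * (X.G'₂ * (X.G'₂ * (X.Q't₂ * (X.C₂ * (X.Q'₂ * (X.G'₂ * ((X.Dt * X.G₂) * (X.Qt₂)))))))))))))) :=
    ((OpShp.fmul hF H.hP₁ H.mDG'₁ hl3 (by norm_num) (by norm_num) H.c_nonneg (H.snn hF 12 12)).castK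
      (by norm_num)).cst (by ring)
  have hl1 : OpShp F H.bb₁ H.bB₂ H.p₁ H.p₂ 2 (H.θ * (H.c ^ 14 * (F.Λ * F.K F.u) ^ 14))
      (X.G₁ * ((X.D * X.G'₁) * (X.Q't₁ * (X.C₁ * (X.Q'₁ * (X.G'₁ * (H.Am₀ * (X.G'₂ * (X.G'₂ * (X.Q't₂ * (X.C₂ * (X.Q'₂ * (X.G'₂ * ((X.Dt * X.G₂) * (X.Qt₂))))))))))))))) :=
    ((OpShp.fmul hF H.hP₁ H.mG₁ hl2 (by norm_num) (by norm_num) H.c_nonneg (H.snn hF 13 13)).castK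
      (by norm_num)).cst (by ring)
  have hl0 : OpShp F H.bB₁ H.bB₂ H.p₁ H.p₂ 2 (H.θ * (H.c ^ 15 * (F.Λ * F.K F.u) ^ 15))
      (X.Q₁ * (X.G₁ * ((X.D * X.G'₁) * (X.Q't₁ * (X.C₁ * (X.Q'₁ * (X.G'₁ * (H.Am₀ * (X.G'₂ * (X.G'₂ * (X.Q't₂ * (X.C₂ * (X.Q'₂ * (X.G'₂ * ((X.Dt * X.G₂) * (X.Qt₂)))))))))))))))) :=
    ((OpShp.fmul hF H.hP₁ H.mQ₁ hl1 (by norm_num) (by norm_num) H.c_nonneg (H.snn hF 14 14)).castK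
      (by norm_num)).cst (by ring)
  exact hl0.mono hF (H.snn hF 15 15) (H.sle hF (by norm_num : 15 ≤ 15) (by norm_num : 15 ≤ 15))

/-- monomial `Q₁G₁(∂G′₁)Q′*₁C₁Q′₁G′₁²·𝔇(Δ′_a)·G′₂Q′*₂C₂Q′₂G′₂∂*G₂Q*₂, part Am₁∂` (8 + 1 + 7 factors) is in `𝒮(2, θ(cΛK(u))¹⁵)`. [folklore] -/
theorem EstHyp.shape_m13a (hF : F.Valid) (H : EstHyp F X t U₁ U₂) :
    OpShp F H.bB₁ H.bB₂ H.p₁ H.p₂ 2 (H.θ * (H.c * (F.Λ * F.K F.u)) ^ 15)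
      (X.Q₁ * (X.G₁ * ((X.D * X.G'₁) * (X.Q't₁ * (X.C₁ * (X.Q'₁ * (X.G'₁ * (X.G'₁ * (H.Am₁ * ((X.D * X.G'₂) * (X.Q't₂ * (X.C₂ * (X.Q'₂ * (X.G'₂ * ((X.Dt * X.G₂) * (X.Qt₂)))))))))))))))) := by
  have hz : OpShp F H.bs₁ H.bB₂ H.p₁ H.p₂ (-1) (H.θ * (H.c ^ 7 * (F.Λ * F.K F.u) ^ 7))
      (H.Am₁ * ((X.D * X.G'₂) * (X.Q't₂ * (X.C₂ * (X.Q'₂ * (X.G'₂ * ((X.Dt * X.G₂) * (X.Qt₂)))))))) :=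
    ((OpShp.zmul hF H.hP₂ H.zAm₁ (H.chain9 hF) (by norm_num) (by norm_num) (by norm_num) H.hθ (H.cnn hF 7 6)).castK
      (by norm_num)).cst (by ring)
  have hl7 : OpShp F H.bs₁ H.bB₂ H.p₁ H.p₂ 1 (H.θ * (H.c ^ 8 * (F.Λ * F.K F.u) ^ 8))
      (X.G'₁ * (H.Am₁ * ((X.D * X.G'₂) * (X.Q't₂ * (X.C₂ * (X.Q'₂ * (X.G'₂ * ((X.Dt * X.G₂) * (X.Qt₂))))))))) :=
    ((OpShp.fmul hF H.hP₁ H.mG'₁ hz (by norm_num) (by norm_num) H.c_nonneg (H.snn hF 7 7)).castK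
      (by norm_num)).cst (by ring)
  have hl6 : OpShp F H.bs₁ H.bB₂ H.p₁ H.p₂ 3 (H.θ * (H.c ^ 9 * (F.Λ * F.K F.u) ^ 9))
      (X.G'₁ * (X.G'₁ * (H.Am₁ * ((X.D * X.G'₂) * (X.Q't₂ * (X.C₂ * (X.Q'₂ * (X.G'₂ * ((X.Dt * X.G₂) * (X.Qt₂)))))))))) :=
    ((OpShp.fmul hF H.hP₁ H.mG'₁ hl7 (by norm_num) (by norm_num) H.c_nonneg (H.snn hF 8 8)).castK
      (by norm_num)).cst (by ring)
  have hl5 : OpShp F H.bS₁ H.bB₂ H.p₁ H.p₂ 3 (H.θ * (H.c ^ 10 * (F.Λ * F.K F.u) ^ 10))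
      (X.Q'₁ * (X.G'₁ * (X.G'₁ * (H.Am₁ * ((X.D * X.G'₂) * (X.Q't₂ * (X.C₂ * (X.Q'₂ * (X.G'₂ * ((X.Dt * X.G₂) * (X.Qt₂))))))))))) :=
    ((OpShp.fmul hF H.hP₁ H.mQ'₁ hl6 (by norm_num) (by norm_num) H.c_nonneg (H.snn hF 9 9)).castK
      (by norm_num)).cst (by ring)
  have hl4 : OpShp F H.bS₁ H.bB₂ H.p₁ H.p₂ (-1) (H.θ * (H.c ^ 11 * (F.Λ * F.K F.u) ^ 11))
      (X.C₁ * (X.Q'₁ * (X.G'₁ * (X.G'₁ * (H.Am₁ * ((X.D * X.G'₂) * (X.Q't₂ * (X.C₂ * (X.Q'₂ * (X.G'₂ * ((X.Dt * X.G₂) * (X.Qt₂)))))))))))) :=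
    ((OpShp.fmul hF H.hP₁ H.mC₁ hl5 (by norm_num) (by norm_num) H.c_nonneg (H.snn hF 10 10)).castK
      (by norm_num)).cst (by ring)
  have hl3 : OpShp F H.bs₁ H.bB₂ H.p₁ H.p₂ (-1) (H.θ * (H.c ^ 12 * (F.Λ * F.K F.u) ^ 12))
      (X.Q't₁ * (X.C₁ * (X.Q'₁ * (X.G'₁ * (X.G'₁ * (H.Am₁ * ((X.D * X.G'₂) * (X.Q't₂ * (X.C₂ * (X.Q'₂ * (X.G'₂ * ((X.Dt * X.G₂) * (X.Qt₂))))))))))))) :=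
    ((OpShp.fmul hF H.hP₁ H.mQ't₁ hl4 (by norm_num) (by norm_num) H.c_nonneg (H.snn hF 11 11)).castK
      (by norm_num)).cst (by ring)
  have hl2 : OpShp F H.bb₁ H.bB₂ H.p₁ H.p₂ 0 (H.θ * (H.c ^ 13 * (F.Λ * F.K F.u) ^ 13))
      ((X.D * X.G'₁) * (X.Q't₁ * (X.C₁ * (X.Q'₁ * (X.G'₁ * (X.G'₁ * (H.Am₁ * ((X.D * X.G'₂) * (X.Q't₂ * (X.C₂ * (X.Q'₂ * (X.G'₂ * ((X.Dt * X.G₂) * (X.Qt₂)))))))))))))) :=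
    ((OpShp.fmul hF H.hP₁ H.mDG'₁ hl3 (by norm_num) (by norm_num) H.c_nonneg (H.snn hF 12 12)).castK
      (by norm_num)).cst (by ring)
  have hl1 : OpShp F H.bb₁ H.bB₂ H.p₁ H.p₂ 2 (H.θ * (H.c ^ 14 * (F.Λ * F.K F.u) ^ 14))
      (X.G₁ * ((X.D * X.G'₁) * (X.Q't₁ * (X.C₁ * (X.Q'₁ * (X.G'₁ * (X.G'₁ * (H.Am₁ * ((X.D * X.G'₂) * (X.Q't₂ * (X.C₂ * (X.Q'₂ * (X.G'₂ * ((X.Dt * X.G₂) * (X.Qt₂))))))))))))))) :=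
    ((OpShp.fmul hF H.hP₁ H.mG₁ hl2 (by norm_num) (by norm_num) H.c_nonneg (H.snn hF 13 13)).castK
      (by norm_num)).cst (by ring)
  have hl0 : OpShp F H.bB₁ H.bB₂ H.p₁ H.p₂ 2 (H.θ * (H.c ^ 15 * (F.Λ * F.K F.u) ^ 15))
      (X.Q₁ * (X.G₁ * ((X.D * X.G'₁) * (X.Q't₁ * (X.C₁ * (X.Q'₁ * (X.G'₁ * (X.G'₁ * (H.Am₁ * ((X.D * X.G'₂) * (X.Q't₂ * (X.C₂ * (X.Q'₂ * (X.G'₂ * ((X.Dt * X.G₂) * (X.Qt₂)))))))))))))))) :=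
    ((OpShp.fmul hF H.hP₁ H.mQ₁ hl1 (by norm_num) (by norm_num) H.c_nonneg (H.snn hF 14 14)).castK
      (by norm_num)).cst (by ring)
  exact hl0.mono hF (H.snn hF 15 15) (H.sle hF (by norm_num : 15 ≤ 15) (by norm_num : 15 ≤ 15))

/-- monomial `the same, part Am₀` (8 + 1 + 7 factors) is in `𝒮(2, θ(cΛK(u))¹⁵)`. [folklore] -/
theorem EstHyp.shape_m13b (hF : F.Valid) (H : EstHyp F X t U₁ U₂) :
    OpShp F H.bB₁ H.bB₂ H.p₁ H.p₂ 2 (H.θ * (H.c * (F.Λ * F.K F.u)) ^ 15)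
      (X.Q₁ * (X.G₁ * ((X.D * X.G'₁) * (X.Q't₁ * (X.C₁ * (X.Q'₁ * (X.G'₁ * (X.G'₁ * (H.Am₀ * (X.G'₂ * (X.Q't₂ * (X.C₂ * (X.Q'₂ * (X.G'₂ * ((X.Dt * X.G₂) * (X.Qt₂)))))))))))))))) := by
  have hz : OpShp F H.bs₁ H.bB₂ H.p₁ H.p₂ (-1) (H.θ * (H.c ^ 7 * (F.Λ * F.K F.u) ^ 7))
      (H.Am₀ * (X.G'₂ * (X.Q't₂ * (X.C₂ * (X.Q'₂ * (X.G'₂ * ((X.Dt * X.G₂) * (X.Qt₂)))))))) :=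
    ((OpShp.zmul hF H.hP₂ H.zAm₀ (H.chain8 hF) (by norm_num) (by norm_num) (by norm_num) H.hθ (H.cnn hF 7 6)).castK
      (by norm_num)).cst (by ring)
  have hl7 : OpShp F H.bs₁ H.bB₂ H.p₁ H.p₂ 1 (H.θ * (H.c ^ 8 * (F.Λ * F.K F.u) ^ 8))
      (X.G'₁ * (H.Am₀ * (X.G'₂ * (X.Q't₂ * (X.C₂ * (X.Q'₂ * (X.G'₂ * ((X.Dt * X.G₂) * (X.Qt₂))))))))) :=
    ((OpShp.fmul hF H.hP₁ H.mG'₁ hz (by norm_num) (by norm_num) H.c_nonneg (H.snn hF 7 7)).castK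
      (by norm_num)).cst (by ring)
  have hl6 : OpShp F H.bs₁ H.bB₂ H.p₁ H.p₂ 3 (H.θ * (H.c ^ 9 * (F.Λ * F.K F.u) ^ 9))
      (X.G'₁ * (X.G'₁ * (H.Am₀ * (X.G'₂ * (X.Q't₂ * (X.C₂ * (X.Q'₂ * (X.G'₂ * ((X.Dt * X.G₂) * (X.Qt₂)))))))))) :=
    ((OpShp.fmul hF H.hP₁ H.mG'₁ hl7 (by norm_num) (by norm_num) H.c_nonneg (H.snn hF 8 8)).castK
      (by norm_num)).cst (by ring)
  have hl5 : OpShp F H.bS₁ H.bB₂ H.p₁ H.p₂ 3 (H.θ * (H.c ^ 10 * (F.Λ * F.K F.u) ^ 10))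
      (X.Q'₁ * (X.G'₁ * (X.G'₁ * (H.Am₀ * (X.G'₂ * (X.Q't₂ * (X.C₂ * (X.Q'₂ * (X.G'₂ * ((X.Dt * X.G₂) * (X.Qt₂))))))))))) :=
    ((OpShp.fmul hF H.hP₁ H.mQ'₁ hl6 (by norm_num) (by norm_num) H.c_nonneg (H.snn hF 9 9)).castK
      (by norm_num)).cst (by ring)
  have hl4 : OpShp F H.bS₁ H.bB₂ H.p₁ H.p₂ (-1) (H.θ * (H.c ^ 11 * (F.Λ * F.K F.u) ^ 11))
      (X.C₁ * (X.Q'₁ * (X.G'₁ * (X.G'₁ * (H.Am₀ * (X.G'₂ * (X.Q't₂ * (X.C₂ * (X.Q'₂ * (X.G'₂ * ((X.Dt * X.G₂) * (X.Qt₂)))))))))))) :=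
    ((OpShp.fmul hF H.hP₁ H.mC₁ hl5 (by norm_num) (by norm_num) H.c_nonneg (H.snn hF 10 10)).castK
      (by norm_num)).cst (by ring)
  have hl3 : OpShp F H.bs₁ H.bB₂ H.p₁ H.p₂ (-1) (H.θ * (H.c ^ 12 * (F.Λ * F.K F.u) ^ 12))
      (X.Q't₁ * (X.C₁ * (X.Q'₁ * (X.G'₁ * (X.G'₁ * (H.Am₀ * (X.G'₂ * (X.Q't₂ * (X.C₂ * (X.Q'₂ * (X.G'₂ * ((X.Dt * X.G₂) * (X.Qt₂))))))))))))) :=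
    ((OpShp.fmul hF H.hP₁ H.mQ't₁ hl4 (by norm_num) (by norm_num) H.c_nonneg (H.snn hF 11 11)).castK
      (by norm_num)).cst (by ring)
  have hl2 : OpShp F H.bb₁ H.bB₂ H.p₁ H.p₂ 0 (H.θ * (H.c ^ 13 * (F.Λ * F.K F.u) ^ 13))
      ((X.D * X.G'₁) * (X.Q't₁ * (X.C₁ * (X.Q'₁ * (X.G'₁ * (X.G'₁ * (H.Am₀ * (X.G'₂ * (X.Q't₂ * (X.C₂ * (X.Q'₂ * (X.G'₂ * ((X.Dt * X.G₂) * (X.Qt₂)))))))))))))) :=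
    ((OpShp.fmul hF H.hP₁ H.mDG'₁ hl3 (by norm_num) (by norm_num) H.c_nonneg (H.snn hF 12 12)).castK
      (by norm_num)).cst (by ring)
  have hl1 : OpShp F H.bb₁ H.bB₂ H.p₁ H.p₂ 2 (H.θ * (H.c ^ 14 * (F.Λ * F.K F.u) ^ 14))
      (X.G₁ * ((X.D * X.G'₁) * (X.Q't₁ * (X.C₁ * (X.Q'₁ * (X.G'₁ * (X.G'₁ * (H.Am₀ * (X.G'₂ * (X.Q't₂ * (X.C₂ * (X.Q'₂ * (X.G'₂ * ((X.Dt * X.G₂) * (X.Qt₂))))))))))))))) :=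
    ((OpShp.fmul hF H.hP₁ H.mG₁ hl2 (by norm_num) (by norm_num) H.c_nonneg (H.snn hF 13 13)).castK
      (by norm_num)).cst (by ring)
  have hl0 : OpShp F H.bB₁ H.bB₂ H.p₁ H.p₂ 2 (H.θ * (H.c ^ 15 * (F.Λ * F.K F.u) ^ 15))
      (X.Q₁ * (X.G₁ * ((X.D * X.G'₁) * (X.Q't₁ * (X.C₁ * (X.Q'₁ * (X.G'₁ * (X.G'₁ * (H.Am₀ * (X.G'₂ * (X.Q't₂ * (X.C₂ * (X.Q'₂ * (X.G'₂ * ((X.Dt * X.G₂) * (X.Qt₂)))))))))))))))) :=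
    ((OpShp.fmul hF H.hP₁ H.mQ₁ hl1 (by norm_num) (by norm_num) H.c_nonneg (H.snn hF 14 14)).castK
      (by norm_num)).cst (by ring)
  exact hl0.mono hF (H.snn hF 15 15) (H.sle hF (by norm_num : 15 ≤ 15) (by norm_num : 15 ≤ 15))

/-- monomial `Q₁G₁(∂G′₁)Q′*₁C₁Q′₁G′₁²·𝔇(Q′*)·C₂Q′₂G′₂∂*G₂Q*₂` (8 + 1 + 5 factors) is in `𝒮(2, θ(cΛK(u))¹⁵)`. [folklore] -/
theorem EstHyp.shape_m14 (hF : F.Valid) (H : EstHyp F X t U₁ U₂) :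
    OpShp F H.bB₁ H.bB₂ H.p₁ H.p₂ 2 (H.θ * (H.c * (F.Λ * F.K F.u)) ^ 15)
      (X.Q₁ * (X.G₁ * ((X.D * X.G'₁) * (X.Q't₁ * (X.C₁ * (X.Q'₁ * (X.G'₁ * (X.G'₁ * (X.dQ't * (X.C₂ * (X.Q'₂ * (X.G'₂ * ((X.Dt * X.G₂) * (X.Qt₂)))))))))))))) := by
  have hz : OpShp F H.bs₁ H.bB₂ H.p₁ H.p₂ (-1) (H.θ * (H.c ^ 5 * (F.Λ * F.K F.u) ^ 5))
      (X.dQ't * (X.C₂ * (X.Q'₂ * (X.G'₂ * ((X.Dt * X.G₂) * (X.Qt₂)))))) :=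
    ((OpShp.zmul hF H.hP₂ H.zQ't (H.chain6 hF) (by norm_num) (by norm_num) (by norm_num) H.hθ (H.cnn hF 5 4)).castK
      (by norm_num)).cst (by ring)
  have hl7 : OpShp F H.bs₁ H.bB₂ H.p₁ H.p₂ 1 (H.θ * (H.c ^ 6 * (F.Λ * F.K F.u) ^ 6))
      (X.G'₁ * (X.dQ't * (X.C₂ * (X.Q'₂ * (X.G'₂ * ((X.Dt * X.G₂) * (X.Qt₂))))))) :=
    ((OpShp.fmul hF H.hP₁ H.mG'₁ hz (by norm_num) (by norm_num) H.c_nonneg (H.snn hF 5 5)).castK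
      (by norm_num)).cst (by ring)
  have hl6 : OpShp F H.bs₁ H.bB₂ H.p₁ H.p₂ 3 (H.θ * (H.c ^ 7 * (F.Λ * F.K F.u) ^ 7))
      (X.G'₁ * (X.G'₁ * (X.dQ't * (X.C₂ * (X.Q'₂ * (X.G'₂ * ((X.Dt * X.G₂) * (X.Qt₂)))))))) :=
    ((OpShp.fmul hF H.hP₁ H.mG'₁ hl7 (by norm_num) (by norm_num) H.c_nonneg (H.snn hF 6 6)).castK
      (by norm_num)).cst (by ring)
  have hl5 : OpShp F H.bS₁ H.bB₂ H.p₁ H.p₂ 3 (H.θ * (H.c ^ 8 * (F.Λ * F.K F.u) ^ 8))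
      (X.Q'₁ * (X.G'₁ * (X.G'₁ * (X.dQ't * (X.C₂ * (X.Q'₂ * (X.G'₂ * ((X.Dt * X.G₂) * (X.Qt₂))))))))) :=
    ((OpShp.fmul hF H.hP₁ H.mQ'₁ hl6 (by norm_num) (by norm_num) H.c_nonneg (H.snn hF 7 7)).castK
      (by norm_num)).cst (by ring)
  have hl4 : OpShp F H.bS₁ H.bB₂ H.p₁ H.p₂ (-1) (H.θ * (H.c ^ 9 * (F.Λ * F.K F.u) ^ 9))
      (X.C₁ * (X.Q'₁ * (X.G'₁ * (X.G'₁ * (X.dQ't * (X.C₂ * (X.Q'₂ * (X.G'₂ * ((X.Dt * X.G₂) * (X.Qt₂)))))))))) :=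
    ((OpShp.fmul hF H.hP₁ H.mC₁ hl5 (by norm_num) (by norm_num) H.c_nonneg (H.snn hF 8 8)).castK
      (by norm_num)).cst (by ring)
  have hl3 : OpShp F H.bs₁ H.bB₂ H.p₁ H.p₂ (-1) (H.θ * (H.c ^ 10 * (F.Λ * F.K F.u) ^ 10))
      (X.Q't₁ * (X.C₁ * (X.Q'₁ * (X.G'₁ * (X.G'₁ * (X.dQ't * (X.C₂ * (X.Q'₂ * (X.G'₂ * ((X.Dt * X.G₂) * (X.Qt₂))))))))))) :=
    ((OpShp.fmul hF H.hP₁ H.mQ't₁ hl4 (by norm_num) (by norm_num) H.c_nonneg (H.snn hF 9 9)).castK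
      (by norm_num)).cst (by ring)
  have hl2 : OpShp F H.bb₁ H.bB₂ H.p₁ H.p₂ 0 (H.θ * (H.c ^ 11 * (F.Λ * F.K F.u) ^ 11))
      ((X.D * X.G'₁) * (X.Q't₁ * (X.C₁ * (X.Q'₁ * (X.G'₁ * (X.G'₁ * (X.dQ't * (X.C₂ * (X.Q'₂ * (X.G'₂ * ((X.Dt * X.G₂) * (X.Qt₂)))))))))))) :=
    ((OpShp.fmul hF H.hP₁ H.mDG'₁ hl3 (by norm_num) (by norm_num) H.c_nonneg (H.snn hF 10 10)).castK
      (by norm_num)).cst (by ring)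
  have hl1 : OpShp F H.bb₁ H.bB₂ H.p₁ H.p₂ 2 (H.θ * (H.c ^ 12 * (F.Λ * F.K F.u) ^ 12))
      (X.G₁ * ((X.D * X.G'₁) * (X.Q't₁ * (X.C₁ * (X.Q'₁ * (X.G'₁ * (X.G'₁ * (X.dQ't * (X.C₂ * (X.Q'₂ * (X.G'₂ * ((X.Dt * X.G₂) * (X.Qt₂))))))))))))) :=
    ((OpShp.fmul hF H.hP₁ H.mG₁ hl2 (by norm_num) (by norm_num) H.c_nonneg (H.snn hF 11 11)).castK
      (by norm_num)).cst (by ring)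
  have hl0 : OpShp F H.bB₁ H.bB₂ H.p₁ H.p₂ 2 (H.θ * (H.c ^ 13 * (F.Λ * F.K F.u) ^ 13))
      (X.Q₁ * (X.G₁ * ((X.D * X.G'₁) * (X.Q't₁ * (X.C₁ * (X.Q'₁ * (X.G'₁ * (X.G'₁ * (X.dQ't * (X.C₂ * (X.Q'₂ * (X.G'₂ * ((X.Dt * X.G₂) * (X.Qt₂)))))))))))))) :=
    ((OpShp.fmul hF H.hP₁ H.mQ₁ hl1 (by norm_num) (by norm_num) H.c_nonneg (H.snn hF 12 12)).castK
      (by norm_num)).cst (by ring)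
  exact hl0.mono hF (H.snn hF 13 13) (H.sle hF (by norm_num : 13 ≤ 15) (by norm_num : 13 ≤ 15))

/-- monomial `Q₁G₁(∂G′₁)Q′*₁C₁·𝔇(Q′)·G′₂∂*G₂Q*₂` (5 + 1 + 3 factors) is in `𝒮(2, θ(cΛK(u))¹⁵)`. [folklore] -/
theorem EstHyp.shape_m15 (hF : F.Valid) (H : EstHyp F X t U₁ U₂) :
    OpShp F H.bB₁ H.bB₂ H.p₁ H.p₂ 2 (H.θ * (H.c * (F.Λ * F.K F.u)) ^ 15)
      (X.Q₁ * (X.G₁ * ((X.D * X.G'₁) * (X.Q't₁ * (X.C₁ * (X.dQ' * (X.G'₂ * ((X.Dt * X.G₂) * (X.Qt₂))))))))) := by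
  have hz : OpShp F H.bS₁ H.bB₂ H.p₁ H.p₂ 3 (H.θ * (H.c ^ 3 * (F.Λ * F.K F.u) ^ 3))
      (X.dQ' * (X.G'₂ * ((X.Dt * X.G₂) * (X.Qt₂)))) :=
    ((OpShp.zmul hF H.hP₂ H.zQ' (H.chain4 hF) (by norm_num) (by norm_num) (by norm_num) H.hθ (H.cnn hF 3 2)).castK
      (by norm_num)).cst (by ring)
  have hl4 : OpShp F H.bS₁ H.bB₂ H.p₁ H.p₂ (-1) (H.θ * (H.c ^ 4 * (F.Λ * F.K F.u) ^ 4))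
      (X.C₁ * (X.dQ' * (X.G'₂ * ((X.Dt * X.G₂) * (X.Qt₂))))) :=
    ((OpShp.fmul hF H.hP₁ H.mC₁ hz (by norm_num) (by norm_num) H.c_nonneg (H.snn hF 3 3)).castK
      (by norm_num)).cst (by ring)
  have hl3 : OpShp F H.bs₁ H.bB₂ H.p₁ H.p₂ (-1) (H.θ * (H.c ^ 5 * (F.Λ * F.K F.u) ^ 5))
      (X.Q't₁ * (X.C₁ * (X.dQ' * (X.G'₂ * ((X.Dt * X.G₂) * (X.Qt₂)))))) :=
    ((OpShp.fmul hF H.hP₁ H.mQ't₁ hl4 (by norm_num) (by norm_num) H.c_nonneg (H.snn hF 4 4)).castK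
      (by norm_num)).cst (by ring)
  have hl2 : OpShp F H.bb₁ H.bB₂ H.p₁ H.p₂ 0 (H.θ * (H.c ^ 6 * (F.Λ * F.K F.u) ^ 6))
      ((X.D * X.G'₁) * (X.Q't₁ * (X.C₁ * (X.dQ' * (X.G'₂ * ((X.Dt * X.G₂) * (X.Qt₂))))))) :=
    ((OpShp.fmul hF H.hP₁ H.mDG'₁ hl3 (by norm_num) (by norm_num) H.c_nonneg (H.snn hF 5 5)).castK
      (by norm_num)).cst (by ring)
  have hl1 : OpShp F H.bb₁ H.bB₂ H.p₁ H.p₂ 2 (H.θ * (H.c ^ 7 * (F.Λ * F.K F.u) ^ 7))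
      (X.G₁ * ((X.D * X.G'₁) * (X.Q't₁ * (X.C₁ * (X.dQ' * (X.G'₂ * ((X.Dt * X.G₂) * (X.Qt₂)))))))) :=
    ((OpShp.fmul hF H.hP₁ H.mG₁ hl2 (by norm_num) (by norm_num) H.c_nonneg (H.snn hF 6 6)).castK
      (by norm_num)).cst (by ring)
  have hl0 : OpShp F H.bB₁ H.bB₂ H.p₁ H.p₂ 2 (H.θ * (H.c ^ 8 * (F.Λ * F.K F.u) ^ 8))
      (X.Q₁ * (X.G₁ * ((X.D * X.G'₁) * (X.Q't₁ * (X.C₁ * (X.dQ' * (X.G'₂ * ((X.Dt * X.G₂) * (X.Qt₂))))))))) :=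
    ((OpShp.fmul hF H.hP₁ H.mQ₁ hl1 (by norm_num) (by norm_num) H.c_nonneg (H.snn hF 7 7)).castK
      (by norm_num)).cst (by ring)
  exact hl0.mono hF (H.snn hF 8 8) (H.sle hF (by norm_num : 8 ≤ 15) (by norm_num : 8 ≤ 15))

/-- right chain, 3 factors. [folklore] -/
theorem EstHyp.chain12 (hF : F.Valid) (H : EstHyp F X t U₁ U₂) :
    OpDec F H.bb₂ H.bB₂ H.p₂ H.p₂ 4 2 (H.c ^ 3 * (F.Λ * F.K F.u) ^ 2)
      ((X.D * X.G'₂) * ((X.Dt * X.G₂) * (X.Qt₂))) :=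
  (((OpDec.fmul hF H.hP₂ H.mDG'₂ (H.chain3 hF) (by norm_num) (by norm_num) (by norm_num) H.c_nonneg
    (H.cnn hF 2 1)).castK (by norm_num)).castN (by norm_num)).cst (by ring)

/-- monomial `Q₁G₁(∂G′₁)Q′*₁C₁Q′₁G′₁·𝔇(Δ′_a)·G′₂∂*G₂Q*₂, part Am₁∂` (7 + 1 + 3 factors) is in `𝒮(2, θ(cΛK(u))¹⁵)`. [folklore] -/
theorem EstHyp.shape_m16a (hF : F.Valid) (H : EstHyp F X t U₁ U₂) :
    OpShp F H.bB₁ H.bB₂ H.p₁ H.p₂ 2 (H.θ * (H.c * (F.Λ * F.K F.u)) ^ 15)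
      (X.Q₁ * (X.G₁ * ((X.D * X.G'₁) * (X.Q't₁ * (X.C₁ * (X.Q'₁ * (X.G'₁ * (H.Am₁ * ((X.D * X.G'₂) * ((X.Dt * X.G₂) * (X.Qt₂))))))))))) := by
  have hz : OpShp F H.bs₁ H.bB₂ H.p₁ H.p₂ 1 (H.θ * (H.c ^ 3 * (F.Λ * F.K F.u) ^ 3))
      (H.Am₁ * ((X.D * X.G'₂) * ((X.Dt * X.G₂) * (X.Qt₂)))) :=
    ((OpShp.zmul hF H.hP₂ H.zAm₁ (H.chain12 hF) (by norm_num) (by norm_num) (by norm_num) H.hθ (H.cnn hF 3 2)).castK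
      (by norm_num)).cst (by ring)
  have hl6 : OpShp F H.bs₁ H.bB₂ H.p₁ H.p₂ 3 (H.θ * (H.c ^ 4 * (F.Λ * F.K F.u) ^ 4))
      (X.G'₁ * (H.Am₁ * ((X.D * X.G'₂) * ((X.Dt * X.G₂) * (X.Qt₂))))) :=
    ((OpShp.fmul hF H.hP₁ H.mG'₁ hz (by norm_num) (by norm_num) H.c_nonneg (H.snn hF 3 3)).castK
      (by norm_num)).cst (by ring)
  have hl5 : OpShp F H.bS₁ H.bB₂ H.p₁ H.p₂ 3 (H.θ * (H.c ^ 5 * (F.Λ * F.K F.u) ^ 5))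
      (X.Q'₁ * (X.G'₁ * (H.Am₁ * ((X.D * X.G'₂) * ((X.Dt * X.G₂) * (X.Qt₂)))))) :=
    ((OpShp.fmul hF H.hP₁ H.mQ'₁ hl6 (by norm_num) (by norm_num) H.c_nonneg (H.snn hF 4 4)).castK
      (by norm_num)).cst (by ring)
  have hl4 : OpShp F H.bS₁ H.bB₂ H.p₁ H.p₂ (-1) (H.θ * (H.c ^ 6 * (F.Λ * F.K F.u) ^ 6))
      (X.C₁ * (X.Q'₁ * (X.G'₁ * (H.Am₁ * ((X.D * X.G'₂) * ((X.Dt * X.G₂) * (X.Qt₂))))))) :=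
    ((OpShp.fmul hF H.hP₁ H.mC₁ hl5 (by norm_num) (by norm_num) H.c_nonneg (H.snn hF 5 5)).castK
      (by norm_num)).cst (by ring)
  have hl3 : OpShp F H.bs₁ H.bB₂ H.p₁ H.p₂ (-1) (H.θ * (H.c ^ 7 * (F.Λ * F.K F.u) ^ 7))
      (X.Q't₁ * (X.C₁ * (X.Q'₁ * (X.G'₁ * (H.Am₁ * ((X.D * X.G'₂) * ((X.Dt * X.G₂) * (X.Qt₂)))))))) :=
    ((OpShp.fmul hF H.hP₁ H.mQ't₁ hl4 (by norm_num) (by norm_num) H.c_nonneg (H.snn hF 6 6)).castK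
      (by norm_num)).cst (by ring)
  have hl2 : OpShp F H.bb₁ H.bB₂ H.p₁ H.p₂ 0 (H.θ * (H.c ^ 8 * (F.Λ * F.K F.u) ^ 8))
      ((X.D * X.G'₁) * (X.Q't₁ * (X.C₁ * (X.Q'₁ * (X.G'₁ * (H.Am₁ * ((X.D * X.G'₂) * ((X.Dt * X.G₂) * (X.Qt₂))))))))) :=
    ((OpShp.fmul hF H.hP₁ H.mDG'₁ hl3 (by norm_num) (by norm_num) H.c_nonneg (H.snn hF 7 7)).castK
      (by norm_num)).cst (by ring)
  have hl1 : OpShp F H.bb₁ H.bB₂ H.p₁ H.p₂ 2 (H.θ * (H.c ^ 9 * (F.Λ * F.K F.u) ^ 9))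
      (X.G₁ * ((X.D * X.G'₁) * (X.Q't₁ * (X.C₁ * (X.Q'₁ * (X.G'₁ * (H.Am₁ * ((X.D * X.G'₂) * ((X.Dt * X.G₂) * (X.Qt₂)))))))))) :=
    ((OpShp.fmul hF H.hP₁ H.mG₁ hl2 (by norm_num) (by norm_num) H.c_nonneg (H.snn hF 8 8)).castK
      (by norm_num)).cst (by ring)
  have hl0 : OpShp F H.bB₁ H.bB₂ H.p₁ H.p₂ 2 (H.θ * (H.c ^ 10 * (F.Λ * F.K F.u) ^ 10))
      (X.Q₁ * (X.G₁ * ((X.D * X.G'₁) * (X.Q't₁ * (X.C₁ * (X.Q'₁ * (X.G'₁ * (H.Am₁ * ((X.D * X.G'₂) * ((X.Dt * X.G₂) * (X.Qt₂))))))))))) :=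
    ((OpShp.fmul hF H.hP₁ H.mQ₁ hl1 (by norm_num) (by norm_num) H.c_nonneg (H.snn hF 9 9)).castK
      (by norm_num)).cst (by ring)
  exact hl0.mono hF (H.snn hF 10 10) (H.sle hF (by norm_num : 10 ≤ 15) (by norm_num : 10 ≤ 15))

/-- monomial `the same, part Am₀` (7 + 1 + 3 factors) is in `𝒮(2, θ(cΛK(u))¹⁵)`. [folklore] -/
theorem EstHyp.shape_m16b (hF : F.Valid) (H : EstHyp F X t U₁ U₂) :
    OpShp F H.bB₁ H.bB₂ H.p₁ H.p₂ 2 (H.θ * (H.c * (F.Λ * F.K F.u)) ^ 15)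
      (X.Q₁ * (X.G₁ * ((X.D * X.G'₁) * (X.Q't₁ * (X.C₁ * (X.Q'₁ * (X.G'₁ * (H.Am₀ * (X.G'₂ * ((X.Dt * X.G₂) * (X.Qt₂))))))))))) := by
  have hz : OpShp F H.bs₁ H.bB₂ H.p₁ H.p₂ 1 (H.θ * (H.c ^ 3 * (F.Λ * F.K F.u) ^ 3))
      (H.Am₀ * (X.G'₂ * ((X.Dt * X.G₂) * (X.Qt₂)))) :=
    ((OpShp.zmul hF H.hP₂ H.zAm₀ (H.chain4 hF) (by norm_num) (by norm_num) (by norm_num) H.hθ (H.cnn hF 3 2)).castK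
      (by norm_num)).cst (by ring)
  have hl6 : OpShp F H.bs₁ H.bB₂ H.p₁ H.p₂ 3 (H.θ * (H.c ^ 4 * (F.Λ * F.K F.u) ^ 4))
      (X.G'₁ * (H.Am₀ * (X.G'₂ * ((X.Dt * X.G₂) * (X.Qt₂))))) :=
    ((OpShp.fmul hF H.hP₁ H.mG'₁ hz (by norm_num) (by norm_num) H.c_nonneg (H.snn hF 3 3)).castK
      (by norm_num)).cst (by ring)
  have hl5 : OpShp F H.bS₁ H.bB₂ H.p₁ H.p₂ 3 (H.θ * (H.c ^ 5 * (F.Λ * F.K F.u) ^ 5))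
      (X.Q'₁ * (X.G'₁ * (H.Am₀ * (X.G'₂ * ((X.Dt * X.G₂) * (X.Qt₂)))))) :=
    ((OpShp.fmul hF H.hP₁ H.mQ'₁ hl6 (by norm_num) (by norm_num) H.c_nonneg (H.snn hF 4 4)).castK
      (by norm_num)).cst (by ring)
  have hl4 : OpShp F H.bS₁ H.bB₂ H.p₁ H.p₂ (-1) (H.θ * (H.c ^ 6 * (F.Λ * F.K F.u) ^ 6))
      (X.C₁ * (X.Q'₁ * (X.G'₁ * (H.Am₀ * (X.G'₂ * ((X.Dt * X.G₂) * (X.Qt₂))))))) :=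
    ((OpShp.fmul hF H.hP₁ H.mC₁ hl5 (by norm_num) (by norm_num) H.c_nonneg (H.snn hF 5 5)).castK
      (by norm_num)).cst (by ring)
  have hl3 : OpShp F H.bs₁ H.bB₂ H.p₁ H.p₂ (-1) (H.θ * (H.c ^ 7 * (F.Λ * F.K F.u) ^ 7))
      (X.Q't₁ * (X.C₁ * (X.Q'₁ * (X.G'₁ * (H.Am₀ * (X.G'₂ * ((X.Dt * X.G₂) * (X.Qt₂)))))))) :=
    ((OpShp.fmul hF H.hP₁ H.mQ't₁ hl4 (by norm_num) (by norm_num) H.c_nonneg (H.snn hF 6 6)).castK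
      (by norm_num)).cst (by ring)
  have hl2 : OpShp F H.bb₁ H.bB₂ H.p₁ H.p₂ 0 (H.θ * (H.c ^ 8 * (F.Λ * F.K F.u) ^ 8))
      ((X.D * X.G'₁) * (X.Q't₁ * (X.C₁ * (X.Q'₁ * (X.G'₁ * (H.Am₀ * (X.G'₂ * ((X.Dt * X.G₂) * (X.Qt₂))))))))) :=
    ((OpShp.fmul hF H.hP₁ H.mDG'₁ hl3 (by norm_num) (by norm_num) H.c_nonneg (H.snn hF 7 7)).castK
      (by norm_num)).cst (by ring)
  have hl1 : OpShp F H.bb₁ H.bB₂ H.p₁ H.p₂ 2 (H.θ * (H.c ^ 9 * (F.Λ * F.K F.u) ^ 9))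
      (X.G₁ * ((X.D * X.G'₁) * (X.Q't₁ * (X.C₁ * (X.Q'₁ * (X.G'₁ * (H.Am₀ * (X.G'₂ * ((X.Dt * X.G₂) * (X.Qt₂)))))))))) :=
    ((OpShp.fmul hF H.hP₁ H.mG₁ hl2 (by norm_num) (by norm_num) H.c_nonneg (H.snn hF 8 8)).castK
      (by norm_num)).cst (by ring)
  have hl0 : OpShp F H.bB₁ H.bB₂ H.p₁ H.p₂ 2 (H.θ * (H.c ^ 10 * (F.Λ * F.K F.u) ^ 10))
      (X.Q₁ * (X.G₁ * ((X.D * X.G'₁) * (X.Q't₁ * (X.C₁ * (X.Q'₁ * (X.G'₁ * (H.Am₀ * (X.G'₂ * ((X.Dt * X.G₂) * (X.Qt₂))))))))))) :=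
    ((OpShp.fmul hF H.hP₁ H.mQ₁ hl1 (by norm_num) (by norm_num) H.c_nonneg (H.snn hF 9 9)).castK
      (by norm_num)).cst (by ring)
  exact hl0.mono hF (H.snn hF 10 10) (H.sle hF (by norm_num : 10 ≤ 15) (by norm_num : 10 ≤ 15))

/-- **THEOREM D, estimate half** (the window-free form): under (M), (L), (P) over a valid frame, `𝔇(QGQ*) = X.dT`
is in the shape class `𝒮(2, 22·θ·(cΛK(u))¹⁵)` between the block bonds of the two sequences — a block majorant
bounded by `22θ(cΛK(u))¹⁵ · sc(y)² · e^{−σ(ρ(y,y″) + β(y) + β(y″))}`, `σ = (δ₀ − 20u)/2`: *"besides the usual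
factors connected with propagators of a considered type, an exponential factor with a distance between localizations
and a closest point where a change was made"* (p. 412), with the commutator factor `θ = O(M⁻¹)` (*"The commutator in
the first term gives O(M⁻¹)"*).  Proof: `TwoSeq.dT_flat` with the three one-sided forms substituted (22 monomials);
per monomial the right chain is folded by `OpDec.fmul`, the defect enters by `OpShp.zmul` / `OpShp.of_zon`, the left
factors by `OpShp.fmul`; `OpShp.add/sub`. OURS (the printed claim is by reference to [2]).
[cite: Balaban1985BackgroundPropagators, (3.97) p.412] -/
theorem EstHyp.dT_opShp (hF : F.Valid) (H : EstHyp F X t U₁ U₂) :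
    OpShp F H.bB₁ H.bB₂ H.p₁ H.p₂ 2 (22 * H.θ * (H.c * F.Λ * F.K F.u) ^ 15) X.dT := by
  have s2 := (H.shape_m1 hF).add (H.shape_m2 hF)
  have s3 := s2.sub (H.shape_m3a hF)
  have s4 := s3.sub (H.shape_m3b hF)
  have s5 := s4.sub (H.shape_m4 hF)
  have s6 := s5.sub (H.shape_m5 hF)
  have s7 := s6.add (H.shape_m6 hF)
  have s8 := s7.sub (H.shape_m7a hF)
  have s9 := s8.sub (H.shape_m7b hF)
  have s10 := s9.add (H.shape_m8 hF)
  have s11 := s10.sub (H.shape_m9a hF)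
  have s12 := s11.sub (H.shape_m9b hF)
  have s13 := s12.add (H.shape_m10 hF)
  have s14 := s13.sub (H.shape_m11 hF)
  have s15 := s14.add (H.shape_m12a hF)
  have s16 := s15.add (H.shape_m12b hF)
  have s17 := s16.add (H.shape_m13a hF)
  have s18 := s17.add (H.shape_m13b hF)
  have s19 := s18.sub (H.shape_m14 hF)
  have s20 := s19.add (H.shape_m15 hF)
  have s21 := s20.sub (H.shape_m16a hF)
  have s22 := s21.sub (H.shape_m16b hF)
  rw [H.dT_split]
  exact s22.cst (by ring)

/-- the entrywise form of `EstHyp.dT_opShp`. [folklore] -/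
theorem EstHyp.dT_entry (hF : F.Valid) (H : EstHyp F X t U₁ U₂) (x : B₁) (x' : B₂) :
    |X.dT x x'| ≤ 22 * H.θ * (H.c * F.Λ * F.K F.u) ^ 15 * F.sc (H.p₁ (H.bB₁ x)) ^ (2 : ℤ) *
      Real.exp (-(F.σ * (F.ρ (H.p₁ (H.bB₁ x)) (H.p₂ (H.bB₂ x')) + F.β (H.p₁ (H.bB₁ x)) + F.β (H.p₂ (H.bB₂ x'))))) :=
  (H.dT_opShp hF).entry x x'

/-- **the (H-diff) entry**: with `ψB` the cutoff `cutX f₁ f₂ ψ` on a common window of block bonds, on the core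
`ψ(a) = ψ(v) = 1` the difference of the two minimal propagators `(Q₁G₁Q*₁)(a,v) − (Q₂G₂Q*₂)(a,v)` (B9 (3.97), [2]
(1.11)/(1.12)) obeys the bound of `dT_entry` (`TwoSeq.core_entry`) — the typed form of GAPS G-B9-05R residual (iv) /
the record's THEOREM D conclusion, to be fed to `B9SectCDiff.entry_bound_of_window_shape`. OURS.
[cite: Balaban1985BackgroundPropagators, (3.97) p.412] -/
theorem EstHyp.core_diff_entry [DecidableEq B₁] [DecidableEq B₂] (hF : F.Valid) (H : EstHyp F X t U₁ U₂)
    {mB : Type uu} [Fintype mB] {f₁ : mB → B₁} {f₂ : mB → B₂} (hf₁ : Function.Injective f₁)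
    (hf₂ : Function.Injective f₂) {ψ : mB → ℝ} (hψ : X.ψB = cutX f₁ f₂ ψ) {a v : mB} (ha : ψ a = 1)
    (hv : ψ v = 1) :
    |X.T₁ (f₁ a) (f₁ v) - X.T₂ (f₂ a) (f₂ v)| ≤ 22 * H.θ * (H.c * F.Λ * F.K F.u) ^ 15 *
      F.sc (H.p₁ (H.bB₁ (f₁ a))) ^ (2 : ℤ) * Real.exp (-(F.σ * (F.ρ (H.p₁ (H.bB₁ (f₁ a))) (H.p₂ (H.bB₂ (f₂ v)))
        + F.β (H.p₁ (H.bB₁ (f₁ a))) + F.β (H.p₂ (H.bB₂ (f₂ v)))))) := by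
  rw [X.core_entry hf₁ hf₂ hψ ha hv, abs_neg]
  exact H.dT_entry hF _ _

end Instance

/-! ## §5 Instantiation helpers (v1.1, APPEND-ONLY): the printed forms ⇒ the classes of §1–§3

The successor item (T1c) instantiates `EstHyp` from B9's theorems; these lemmas turn the PRINTED shapes into the
classes above: the operator form of (3.42) (sup over the observation block against block-supported sources of sup
norm ≤ 1) ⇔ `BlkMaj`; the two-sided (2.60)-type slow variation of the scale `sc(b) ≤ Λ₀·sc(a)·e^{κρ(a,b)}` ⇒ the
transfers `Frame.Valid.htr` of every power `scᵏ`, `|k| ≤ 8`, with `(Λ, u) = (Λ₀⁸, 8κ)`; entrywise bounds for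
unit-block (coarse-lattice) operators ⇒ `OpDec` / `OpZon`. -/

section Helpers

variable {S : Type*} {u v U V : Type*}

/-- **(3.42) operator form ⇒ block majorant**: if for every fine point `x`, every block `J` and every source `g`
supported in the block `J` with `sup|g| ≤ 1` one has `|(Tg)(x)| ≤ K(bu x, J)` (this is (3.42): *"for x ∈ Δ(y), y ∈
Λ_j, supp λ ⊂ Δ(y′)"* with the right side `B₀(Lʲη)²e^{−δ₀d(y,y′)}|λ|`), then `K` is a block majorant of `T` (test
with `g = sign T(x,·)` on the block). [cite: Balaban1985BackgroundPropagators, (3.42) p.397] -/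
theorem BlkMaj.of_opBound [Fintype v] [DecidableEq V] {bu : u → U} {bv : v → V} {T : Matrix u v ℝ}
    {K : Matrix U V ℝ} (hK : ∀ I J, 0 ≤ K I J)
    (h : ∀ (x : u) (J : V) (g : v → ℝ), (∀ x', bv x' ≠ J → g x' = 0) → (∀ x', |g x'| ≤ 1) →
      |∑ x', T x x' * g x'| ≤ K (bu x) J) :
    BlkMaj bu bv T K where
  nonneg := hK
  le x J := by
    have key := h x J (fun x' => if bv x' = J then (if 0 ≤ T x x' then 1 else -1) else 0)
      (fun x' hx => by simp [hx]) (fun x' => by split_ifs <;> simp)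
    refine le_trans (le_of_eq ?_) (le_trans (le_abs_self _) key)
    rw [Finset.sum_filter]
    refine Finset.sum_congr rfl fun x' _ => ?_
    split_ifs with hJ hT
    · rw [mul_one, abs_of_nonneg hT]
    · rw [mul_neg, mul_one, abs_of_neg (not_le.mp hT)]
    · rw [mul_zero]

/-- **block majorant ⇒ (3.42) operator form** (the converse reading). [folklore] -/
theorem BlkMaj.opBound [Fintype v] [DecidableEq V] {bu : u → U} {bv : v → V} {T : Matrix u v ℝ}
    {K : Matrix U V ℝ} (hT : BlkMaj bu bv T K) (x : u) (J : V) (g : v → ℝ)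
    (h1 : ∀ x', bv x' ≠ J → g x' = 0) (h2 : ∀ x', |g x'| ≤ 1) : |∑ x', T x x' * g x'| ≤ K (bu x) J := by
  have hs : ∑ x', T x x' * g x' = ∑ x' ∈ univ.filter (fun x' => bv x' = J), T x x' * g x' := by
    rw [Finset.sum_filter]
    refine Finset.sum_congr rfl fun x' _ => ?_
    split_ifs with hJ
    · rfl
    · rw [h1 x' hJ, mul_zero]
  rw [hs]
  refine le_trans (Finset.abs_sum_le_sum_abs _ _) (le_trans (Finset.sum_le_sum fun x' _ => ?_) (hT.le x J))
  rw [abs_mul]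
  exact le_trans (mul_le_mul_of_nonneg_left (h2 x') (abs_nonneg _)) (le_of_eq (mul_one _))

/-- **(2.60)-type two-sided slow variation ⇒ the transfers of every power `scᵏ`, `|k| ≤ 8`**: if
`sc(b) ≤ Λ₀·sc(a)·e^{κρ(a,b)}` for all `a, b` (ρ symmetric and nonnegative, `sc > 0`, `Λ₀ ≥ 1`, `κ ≥ 0`), then
`sc(b)ᵏ ≤ Λ₀⁸·sc(a)ᵏ·e^{8κρ(a,b)}` — the hypothesis `Frame.Valid.htr` with `(Λ, u) = (Λ₀⁸, 8κ)` (for (2.60) of [4]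
with `sc(y) = Lʲη` on `Λ_j`: `Λ₀ = L`, `κ = α′δ₀/2`-type, as in `B6DomainMajorant` §4).
[cite: Balaban1984PropagatorsII, (2.60) p.234] -/
theorem Transfer.of_twoSided {ρ : S → S → ℝ} {sc : S → ℝ} {Λ₀ κ : ℝ} (hρs : ∀ a b, ρ a b = ρ b a)
    (hρ0 : ∀ a b, 0 ≤ ρ a b) (hsc : ∀ a, 0 < sc a) (hΛ₀ : 1 ≤ Λ₀) (hκ : 0 ≤ κ)
    (h : ∀ a b, sc b ≤ Λ₀ * sc a * Real.exp (κ * ρ a b)) {k : ℤ} (hk : -8 ≤ k) (hk' : k ≤ 8) :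
    Transfer ρ (fun a => sc a ^ k) (Λ₀ ^ 8) (8 * κ) := by
  intro a b
  show sc b ^ k ≤ Λ₀ ^ 8 * sc a ^ k * Real.exp (8 * κ * ρ a b)
  set M := Λ₀ * Real.exp (κ * ρ a b) with hM
  have hM1 : 1 ≤ M := one_le_mul_of_one_le_of_one_le hΛ₀ (Real.one_le_exp (mul_nonneg hκ (hρ0 a b)))
  have hMpos : 0 < M := lt_of_lt_of_le one_pos hM1
  have hexp : Real.exp (κ * ρ a b) ^ 8 = Real.exp (8 * κ * ρ a b) := by
    rw [← Real.exp_nat_mul]; congr 1; push_cast; ring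
  have hMpow : ∀ n : ℕ, n ≤ 8 → M ^ n ≤ Λ₀ ^ 8 * Real.exp (8 * κ * ρ a b) := fun n hn => by
    calc M ^ n ≤ M ^ 8 := pow_le_pow_right₀ hM1 hn
      _ = Λ₀ ^ 8 * Real.exp (8 * κ * ρ a b) := by rw [hM, mul_pow, hexp]
  have hf : sc b ≤ M * sc a := by
    calc sc b ≤ Λ₀ * sc a * Real.exp (κ * ρ a b) := h a b
      _ = M * sc a := by rw [hM]; ring
  have hb : (sc b)⁻¹ ≤ M * (sc a)⁻¹ := by
    have h' : sc a ≤ M * sc b := by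
      calc sc a ≤ Λ₀ * sc b * Real.exp (κ * ρ b a) := h b a
        _ = M * sc b := by rw [hM, hρs b a]; ring
    rw [← div_eq_mul_inv, le_div_iff₀ (hsc a), inv_mul_eq_div, div_le_iff₀ (hsc b)]
    exact h'
  rcases Int.eq_nat_or_neg k with ⟨n, rfl | rfl⟩
  · have hn : n ≤ 8 := by omega
    simp only [zpow_natCast]
    calc sc b ^ n ≤ (M * sc a) ^ n := pow_le_pow_left₀ (hsc b).le hf n
      _ = M ^ n * sc a ^ n := mul_pow _ _ _
      _ ≤ Λ₀ ^ 8 * Real.exp (8 * κ * ρ a b) * sc a ^ n :=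
          mul_le_mul_of_nonneg_right (hMpow n hn) (pow_nonneg (hsc a).le n)
      _ = Λ₀ ^ 8 * sc a ^ n * Real.exp (8 * κ * ρ a b) := by ring
  · have hn : n ≤ 8 := by omega
    simp only [_root_.zpow_neg, zpow_natCast]
    rw [← inv_pow, ← inv_pow]
    calc (sc b)⁻¹ ^ n ≤ (M * (sc a)⁻¹) ^ n := pow_le_pow_left₀ (inv_nonneg.mpr (hsc b).le) hb n
      _ = M ^ n * (sc a)⁻¹ ^ n := mul_pow _ _ _
      _ ≤ Λ₀ ^ 8 * Real.exp (8 * κ * ρ a b) * (sc a)⁻¹ ^ n :=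
          mul_le_mul_of_nonneg_right (hMpow n hn) (pow_nonneg (inv_nonneg.mpr (hsc a).le) n)
      _ = Λ₀ ^ 8 * (sc a)⁻¹ ^ n * Real.exp (8 * κ * ρ a b) := by ring

/-- rearrangement: the form `e^{−κρ(a,b)}·sc(b) ≤ Λ₀·sc(a)` (γ = 1 of `B6DomainMajorant.transfer_len_pow_of_ineq260`,
not imported here) is the two-sided hypothesis of `Transfer.of_twoSided`. [folklore] -/
theorem twoSided_of_expMul {ρ : S → S → ℝ} {sc : S → ℝ} {Λ₀ κ : ℝ}
    (h : ∀ a b, Real.exp (-(κ * ρ a b)) * sc b ≤ Λ₀ * sc a) (a b : S) :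
    sc b ≤ Λ₀ * sc a * Real.exp (κ * ρ a b) := by
  have he : 0 < Real.exp (κ * ρ a b) := Real.exp_pos _
  have h1 := mul_le_mul_of_nonneg_right (h a b) he.le
  calc sc b = Real.exp (-(κ * ρ a b)) * sc b * Real.exp (κ * ρ a b) := by
        rw [mul_comm (Real.exp _) (sc b), mul_assoc, ← Real.exp_add, neg_add_cancel, Real.exp_zero, mul_one]
    _ ≤ Λ₀ * sc a * Real.exp (κ * ρ a b) := h1

variable {F : Frame S}

/-- assembling `OpDec` from its two parts. [folklore] -/
theorem OpDec.of_parts [Fintype v] [DecidableEq V] {bu : u → U} {bv : v → V} {pU : U → S} {pV : V → S}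
    {n : ℕ} {k : ℤ} {c : ℝ} {T : Matrix u v ℝ} {K : Matrix U V ℝ} (hB : BlkMaj bu bv T K)
    (hW : WDec F.ρ pU pV (fun a => F.sc a ^ k) c (F.rate n) K) : OpDec F bu bv pU pV n k c T :=
  ⟨K, hB, hW⟩

/-- assembling `OpZon` from its three parts. [folklore] -/
theorem OpZon.of_parts [Fintype v] [DecidableEq V] {bu : u → U} {bv : v → V} {pU : U → S} {pV : V → S}
    {k : ℤ} {θ : ℝ} {Z : Matrix u v ℝ} {K : Matrix U V ℝ} (hB : BlkMaj bu bv Z K)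
    (hW : WDec F.ρ pU pV (fun a => F.sc a ^ k) θ (F.rate 0) K) (hR : RowZone F.β pU K) :
    OpZon F bu bv pU pV k θ Z :=
  ⟨K, hB, hW, hR⟩

/-- **unit blocks**: an entrywise (3.48)-type bound on a coarse-lattice operator (e.g. `C_c = (Q′G′²Q′*)⁻¹` with
`k = −4`) is an `OpDec` with identity block maps.  Reading (cell XREAD b09-g9 N1): the matrix entry here is the
printed KERNEL times the column measure weight of the lattice it acts on, which is what cancels (3.48)'s
`(L^{j′}η)^{−d}` and leaves the pure scale power `k`. [cite: Balaban1985BackgroundPropagators, (3.48) p.398] -/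
theorem OpDec.of_abs_le [Fintype v] [DecidableEq v] {p : u → S} {q : v → S} {n : ℕ} {k : ℤ} {c : ℝ}
    {T : Matrix u v ℝ} (h : ∀ x x', |T x x'| ≤ c * F.sc (p x) ^ k * Real.exp (-(F.rate n * F.ρ (p x) (q x')))) :
    OpDec F id id p q n k c T :=
  ⟨fun x x' => c * F.sc (p x) ^ k * Real.exp (-(F.rate n * F.ρ (p x) (q x'))), BlkMaj.of_abs_le h,
    fun i j => by rw [abs_of_nonneg ((abs_nonneg _).trans (h i j))]⟩

/-- **unit blocks, zone-supported**: an entrywise bound at rate `δ₀` plus "rows outside the zone vanish" is an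
`OpZon` with identity block maps (the form in which a coarse-lattice defect such as `𝔇(C)`-type data would enter).
[folklore] -/
theorem OpZon.of_abs_le [Fintype v] [DecidableEq v] (hF : F.Valid) {p : u → S} {q : v → S} {k : ℤ} {θ : ℝ}
    {T : Matrix u v ℝ} (hθ : 0 ≤ θ)
    (h : ∀ x x', |T x x'| ≤ θ * F.sc (p x) ^ k * Real.exp (-(F.δ₀ * F.ρ (p x) (q x'))))
    (hz : ∀ x x', T x x' ≠ 0 → F.β (p x) = 0) : OpZon F id id p q k θ T := by
  refine ⟨fun x x' => if T x x' = 0 then 0 else θ * F.sc (p x) ^ k * Real.exp (-(F.δ₀ * F.ρ (p x) (q x'))),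
    BlkMaj.of_abs_le fun x x' => ?_, fun i j => ?_, fun i j hK => ?_⟩
  · try dsimp only
    split_ifs with h0
    · rw [h0, abs_zero]
    · exact h x x'
  · rw [F.rate_zero]
    try dsimp only
    split_ifs with h0
    · rw [abs_zero]
      exact mul_nonneg (mul_nonneg hθ (hF.sc_zpow_nonneg k _)) (Real.exp_nonneg _)
    · rw [abs_of_nonneg ((abs_nonneg _).trans (h i j))]
  · have hT : T i j ≠ 0 := by
      intro h0; apply hK; simp [h0]
    exact hz i j hT

end Helpers

/-! ## §6 THEOREM D's twin for `E = Q′G′²Q′*` (v1.2, APPEND-ONLY; cell XREAD b09-g9 request R1)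

The b09 consumer chain differences the COARSE operator `Q′(G′²_{□₀} − G′²_□)Q′*` of (3.97) (scale power `k = 4`:
two factors `G′`), not only `QGQ*`.  `TwoSeq.dE_explicit` ((E5) substituted into (E4)) lists `𝔇(Q′G′²Q′*)` as four
terms; with the one-sided form `𝔇(Δ′_a) = Am₁·∂ + Am₀` of `EstHyp` these are six monomials of at most six factors,
each estimated exactly as in §4 (`OpDec.fmul` chains right of the defect, `OpShp.zmul`, `OpShp.fmul` for the left
factors), giving `𝔇(Q′G′²Q′*) ∈ 𝒮(4, 6θ(cΛK(u))¹⁵)` and the core-entry bound.  OURS (the printed claim is by reference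
to [2]); value = certificate, NOT summit progress. -/

section InstanceE

open B9SectCDiffExpansion (TwoSeq)
open B9SectCDiff (cutX)

universe uu

variable {S : Type*}
variable {s b S₁ S₂ B₁ B₂ : Type uu} [Fintype s] [DecidableEq s] [Fintype b] [DecidableEq b]
  [Fintype S₁] [DecidableEq S₁] [Fintype S₂] [DecidableEq S₂] [Fintype B₁] [Fintype B₂]

variable {F : Frame S} {X : TwoSeq s b S₁ S₂ B₁ B₂} {t U₁ U₂ : Type uu} [Fintype t] [Fintype U₁] [DecidableEq U₁]
  [Fintype U₂] [DecidableEq U₂]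

/-- `TwoSeq.dE_explicit` with the one-sided form of `𝔇(Δ′_a)` substituted: 6 right-nested monomials. [folklore] -/
theorem EstHyp.dE_split (H : EstHyp F X t U₁ U₂) : X.dE =
    X.dQ' * (X.G'₂ * (X.G'₂ * (X.Q't₂)))
    - X.Q'₁ * (X.G'₁ * (H.Am₁ * ((X.D * X.G'₂) * (X.G'₂ * (X.Q't₂)))))
    - X.Q'₁ * (X.G'₁ * (H.Am₀ * (X.G'₂ * (X.G'₂ * (X.Q't₂)))))
    - X.Q'₁ * (X.G'₁ * (X.G'₁ * (H.Am₁ * ((X.D * X.G'₂) * (X.Q't₂)))))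
    - X.Q'₁ * (X.G'₁ * (X.G'₁ * (H.Am₀ * (X.G'₂ * (X.Q't₂)))))
    + X.Q'₁ * (X.G'₁ * (X.G'₁ * (X.dQ't))) := by
  rw [X.dE_explicit, ← X.ddA'_eq, H.hA]
  simp only [Matrix.mul_add, Matrix.add_mul, Matrix.mul_assoc]
  abel

/-- right chain `X.Q't₂`. [folklore] -/
theorem EstHyp.echain0 (_hF : F.Valid) (H : EstHyp F X t U₁ U₂) :
    OpDec F H.bs₂ H.bS₂ H.p₂ H.p₂ 0 0 (H.c ^ 1 * (F.Λ * F.K F.u) ^ 0) X.Q't₂ :=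
  H.mQ't₂.cst (by ring)

/-- right chain, 2 factors. [folklore] -/
theorem EstHyp.echain1 (hF : F.Valid) (H : EstHyp F X t U₁ U₂) :
    OpDec F H.bs₂ H.bS₂ H.p₂ H.p₂ 2 2 (H.c ^ 2 * (F.Λ * F.K F.u) ^ 1)
      (X.G'₂ * (X.Q't₂)) :=
  (((OpDec.fmul hF H.hP₂ H.mG'₂ (H.echain0 hF) (by norm_num) (by norm_num) (by norm_num) H.c_nonneg
    (H.cnn hF 1 0)).castK (by norm_num)).castN (by norm_num)).cst (by ring)

/-- right chain, 3 factors. [folklore] -/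
theorem EstHyp.echain2 (hF : F.Valid) (H : EstHyp F X t U₁ U₂) :
    OpDec F H.bs₂ H.bS₂ H.p₂ H.p₂ 4 4 (H.c ^ 3 * (F.Λ * F.K F.u) ^ 2)
      (X.G'₂ * (X.G'₂ * (X.Q't₂))) :=
  (((OpDec.fmul hF H.hP₂ H.mG'₂ (H.echain1 hF) (by norm_num) (by norm_num) (by norm_num) H.c_nonneg
    (H.cnn hF 2 1)).castK (by norm_num)).castN (by norm_num)).cst (by ring)

/-- monomial `𝔇(Q′)·G′₂²Q′*₂` (0 + 1 + 3 factors) is in `𝒮(4, θ(cΛK(u))¹⁵)`. [folklore] -/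
theorem EstHyp.shape_e1 (hF : F.Valid) (H : EstHyp F X t U₁ U₂) :
    OpShp F H.bS₁ H.bS₂ H.p₁ H.p₂ 4 (H.θ * (H.c * (F.Λ * F.K F.u)) ^ 15)
      (X.dQ' * (X.G'₂ * (X.G'₂ * (X.Q't₂)))) := by
  have hz : OpShp F H.bS₁ H.bS₂ H.p₁ H.p₂ 4 (H.θ * (H.c ^ 3 * (F.Λ * F.K F.u) ^ 3))
      (X.dQ' * (X.G'₂ * (X.G'₂ * (X.Q't₂)))) :=
    ((OpShp.zmul hF H.hP₂ H.zQ' (H.echain2 hF) (by norm_num) (by norm_num) (by norm_num) H.hθ (H.cnn hF 3 2)).castK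
      (by norm_num)).cst (by ring)
  exact hz.mono hF (H.snn hF 3 3) (H.sle hF (by norm_num : 3 ≤ 15) (by norm_num : 3 ≤ 15))

/-- right chain, 3 factors. [folklore] -/
theorem EstHyp.echain3 (hF : F.Valid) (H : EstHyp F X t U₁ U₂) :
    OpDec F H.bb₂ H.bS₂ H.p₂ H.p₂ 4 3 (H.c ^ 3 * (F.Λ * F.K F.u) ^ 2)
      ((X.D * X.G'₂) * (X.G'₂ * (X.Q't₂))) :=
  (((OpDec.fmul hF H.hP₂ H.mDG'₂ (H.echain1 hF) (by norm_num) (by norm_num) (by norm_num) H.c_nonneg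
    (H.cnn hF 2 1)).castK (by norm_num)).castN (by norm_num)).cst (by ring)

/-- monomial `Q′₁G′₁·𝔇(Δ′_a)·G′₂²Q′*₂, part Am₁∂` (2 + 1 + 3 factors) is in `𝒮(4, θ(cΛK(u))¹⁵)`. [folklore] -/
theorem EstHyp.shape_e2a (hF : F.Valid) (H : EstHyp F X t U₁ U₂) :
    OpShp F H.bS₁ H.bS₂ H.p₁ H.p₂ 4 (H.θ * (H.c * (F.Λ * F.K F.u)) ^ 15)
      (X.Q'₁ * (X.G'₁ * (H.Am₁ * ((X.D * X.G'₂) * (X.G'₂ * (X.Q't₂)))))) := by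
  have hz : OpShp F H.bs₁ H.bS₂ H.p₁ H.p₂ 2 (H.θ * (H.c ^ 3 * (F.Λ * F.K F.u) ^ 3))
      (H.Am₁ * ((X.D * X.G'₂) * (X.G'₂ * (X.Q't₂)))) :=
    ((OpShp.zmul hF H.hP₂ H.zAm₁ (H.echain3 hF) (by norm_num) (by norm_num) (by norm_num) H.hθ (H.cnn hF 3 2)).castK
      (by norm_num)).cst (by ring)
  have hl1 : OpShp F H.bs₁ H.bS₂ H.p₁ H.p₂ 4 (H.θ * (H.c ^ 4 * (F.Λ * F.K F.u) ^ 4))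
      (X.G'₁ * (H.Am₁ * ((X.D * X.G'₂) * (X.G'₂ * (X.Q't₂))))) :=
    ((OpShp.fmul hF H.hP₁ H.mG'₁ hz (by norm_num) (by norm_num) H.c_nonneg (H.snn hF 3 3)).castK
      (by norm_num)).cst (by ring)
  have hl0 : OpShp F H.bS₁ H.bS₂ H.p₁ H.p₂ 4 (H.θ * (H.c ^ 5 * (F.Λ * F.K F.u) ^ 5))
      (X.Q'₁ * (X.G'₁ * (H.Am₁ * ((X.D * X.G'₂) * (X.G'₂ * (X.Q't₂)))))) :=
    ((OpShp.fmul hF H.hP₁ H.mQ'₁ hl1 (by norm_num) (by norm_num) H.c_nonneg (H.snn hF 4 4)).castK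
      (by norm_num)).cst (by ring)
  exact hl0.mono hF (H.snn hF 5 5) (H.sle hF (by norm_num : 5 ≤ 15) (by norm_num : 5 ≤ 15))

/-- monomial `the same, part Am₀` (2 + 1 + 3 factors) is in `𝒮(4, θ(cΛK(u))¹⁵)`. [folklore] -/
theorem EstHyp.shape_e2b (hF : F.Valid) (H : EstHyp F X t U₁ U₂) :
    OpShp F H.bS₁ H.bS₂ H.p₁ H.p₂ 4 (H.θ * (H.c * (F.Λ * F.K F.u)) ^ 15)
      (X.Q'₁ * (X.G'₁ * (H.Am₀ * (X.G'₂ * (X.G'₂ * (X.Q't₂)))))) := by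
  have hz : OpShp F H.bs₁ H.bS₂ H.p₁ H.p₂ 2 (H.θ * (H.c ^ 3 * (F.Λ * F.K F.u) ^ 3))
      (H.Am₀ * (X.G'₂ * (X.G'₂ * (X.Q't₂)))) :=
    ((OpShp.zmul hF H.hP₂ H.zAm₀ (H.echain2 hF) (by norm_num) (by norm_num) (by norm_num) H.hθ (H.cnn hF 3 2)).castK
      (by norm_num)).cst (by ring)
  have hl1 : OpShp F H.bs₁ H.bS₂ H.p₁ H.p₂ 4 (H.θ * (H.c ^ 4 * (F.Λ * F.K F.u) ^ 4))
      (X.G'₁ * (H.Am₀ * (X.G'₂ * (X.G'₂ * (X.Q't₂))))) :=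
    ((OpShp.fmul hF H.hP₁ H.mG'₁ hz (by norm_num) (by norm_num) H.c_nonneg (H.snn hF 3 3)).castK
      (by norm_num)).cst (by ring)
  have hl0 : OpShp F H.bS₁ H.bS₂ H.p₁ H.p₂ 4 (H.θ * (H.c ^ 5 * (F.Λ * F.K F.u) ^ 5))
      (X.Q'₁ * (X.G'₁ * (H.Am₀ * (X.G'₂ * (X.G'₂ * (X.Q't₂)))))) :=
    ((OpShp.fmul hF H.hP₁ H.mQ'₁ hl1 (by norm_num) (by norm_num) H.c_nonneg (H.snn hF 4 4)).castK
      (by norm_num)).cst (by ring)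
  exact hl0.mono hF (H.snn hF 5 5) (H.sle hF (by norm_num : 5 ≤ 15) (by norm_num : 5 ≤ 15))

/-- right chain, 2 factors. [folklore] -/
theorem EstHyp.echain4 (hF : F.Valid) (H : EstHyp F X t U₁ U₂) :
    OpDec F H.bb₂ H.bS₂ H.p₂ H.p₂ 2 1 (H.c ^ 2 * (F.Λ * F.K F.u) ^ 1)
      ((X.D * X.G'₂) * (X.Q't₂)) :=
  (((OpDec.fmul hF H.hP₂ H.mDG'₂ (H.echain0 hF) (by norm_num) (by norm_num) (by norm_num) H.c_nonneg
    (H.cnn hF 1 0)).castK (by norm_num)).castN (by norm_num)).cst (by ring)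

/-- monomial `Q′₁G′₁²·𝔇(Δ′_a)·G′₂Q′*₂, part Am₁∂` (3 + 1 + 2 factors) is in `𝒮(4, θ(cΛK(u))¹⁵)`. [folklore] -/
theorem EstHyp.shape_e3a (hF : F.Valid) (H : EstHyp F X t U₁ U₂) :
    OpShp F H.bS₁ H.bS₂ H.p₁ H.p₂ 4 (H.θ * (H.c * (F.Λ * F.K F.u)) ^ 15)
      (X.Q'₁ * (X.G'₁ * (X.G'₁ * (H.Am₁ * ((X.D * X.G'₂) * (X.Q't₂)))))) := by
  have hz : OpShp F H.bs₁ H.bS₂ H.p₁ H.p₂ 0 (H.θ * (H.c ^ 2 * (F.Λ * F.K F.u) ^ 2))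
      (H.Am₁ * ((X.D * X.G'₂) * (X.Q't₂))) :=
    ((OpShp.zmul hF H.hP₂ H.zAm₁ (H.echain4 hF) (by norm_num) (by norm_num) (by norm_num) H.hθ (H.cnn hF 2 1)).castK
      (by norm_num)).cst (by ring)
  have hl2 : OpShp F H.bs₁ H.bS₂ H.p₁ H.p₂ 2 (H.θ * (H.c ^ 3 * (F.Λ * F.K F.u) ^ 3))
      (X.G'₁ * (H.Am₁ * ((X.D * X.G'₂) * (X.Q't₂)))) :=
    ((OpShp.fmul hF H.hP₁ H.mG'₁ hz (by norm_num) (by norm_num) H.c_nonneg (H.snn hF 2 2)).castK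
      (by norm_num)).cst (by ring)
  have hl1 : OpShp F H.bs₁ H.bS₂ H.p₁ H.p₂ 4 (H.θ * (H.c ^ 4 * (F.Λ * F.K F.u) ^ 4))
      (X.G'₁ * (X.G'₁ * (H.Am₁ * ((X.D * X.G'₂) * (X.Q't₂))))) :=
    ((OpShp.fmul hF H.hP₁ H.mG'₁ hl2 (by norm_num) (by norm_num) H.c_nonneg (H.snn hF 3 3)).castK
      (by norm_num)).cst (by ring)
  have hl0 : OpShp F H.bS₁ H.bS₂ H.p₁ H.p₂ 4 (H.θ * (H.c ^ 5 * (F.Λ * F.K F.u) ^ 5))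
      (X.Q'₁ * (X.G'₁ * (X.G'₁ * (H.Am₁ * ((X.D * X.G'₂) * (X.Q't₂)))))) :=
    ((OpShp.fmul hF H.hP₁ H.mQ'₁ hl1 (by norm_num) (by norm_num) H.c_nonneg (H.snn hF 4 4)).castK
      (by norm_num)).cst (by ring)
  exact hl0.mono hF (H.snn hF 5 5) (H.sle hF (by norm_num : 5 ≤ 15) (by norm_num : 5 ≤ 15))

/-- monomial `the same, part Am₀` (3 + 1 + 2 factors) is in `𝒮(4, θ(cΛK(u))¹⁵)`. [folklore] -/
theorem EstHyp.shape_e3b (hF : F.Valid) (H : EstHyp F X t U₁ U₂) :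
    OpShp F H.bS₁ H.bS₂ H.p₁ H.p₂ 4 (H.θ * (H.c * (F.Λ * F.K F.u)) ^ 15)
      (X.Q'₁ * (X.G'₁ * (X.G'₁ * (H.Am₀ * (X.G'₂ * (X.Q't₂)))))) := by
  have hz : OpShp F H.bs₁ H.bS₂ H.p₁ H.p₂ 0 (H.θ * (H.c ^ 2 * (F.Λ * F.K F.u) ^ 2))
      (H.Am₀ * (X.G'₂ * (X.Q't₂))) :=
    ((OpShp.zmul hF H.hP₂ H.zAm₀ (H.echain1 hF) (by norm_num) (by norm_num) (by norm_num) H.hθ (H.cnn hF 2 1)).castK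
      (by norm_num)).cst (by ring)
  have hl2 : OpShp F H.bs₁ H.bS₂ H.p₁ H.p₂ 2 (H.θ * (H.c ^ 3 * (F.Λ * F.K F.u) ^ 3))
      (X.G'₁ * (H.Am₀ * (X.G'₂ * (X.Q't₂)))) :=
    ((OpShp.fmul hF H.hP₁ H.mG'₁ hz (by norm_num) (by norm_num) H.c_nonneg (H.snn hF 2 2)).castK
      (by norm_num)).cst (by ring)
  have hl1 : OpShp F H.bs₁ H.bS₂ H.p₁ H.p₂ 4 (H.θ * (H.c ^ 4 * (F.Λ * F.K F.u) ^ 4))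
      (X.G'₁ * (X.G'₁ * (H.Am₀ * (X.G'₂ * (X.Q't₂))))) :=
    ((OpShp.fmul hF H.hP₁ H.mG'₁ hl2 (by norm_num) (by norm_num) H.c_nonneg (H.snn hF 3 3)).castK
      (by norm_num)).cst (by ring)
  have hl0 : OpShp F H.bS₁ H.bS₂ H.p₁ H.p₂ 4 (H.θ * (H.c ^ 5 * (F.Λ * F.K F.u) ^ 5))
      (X.Q'₁ * (X.G'₁ * (X.G'₁ * (H.Am₀ * (X.G'₂ * (X.Q't₂)))))) :=
    ((OpShp.fmul hF H.hP₁ H.mQ'₁ hl1 (by norm_num) (by norm_num) H.c_nonneg (H.snn hF 4 4)).castK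
      (by norm_num)).cst (by ring)
  exact hl0.mono hF (H.snn hF 5 5) (H.sle hF (by norm_num : 5 ≤ 15) (by norm_num : 5 ≤ 15))

/-- monomial `Q′₁G′₁²·𝔇(Q′*)` (3 + 1 + 0 factors) is in `𝒮(4, θ(cΛK(u))¹⁵)`. [folklore] -/
theorem EstHyp.shape_e4 (hF : F.Valid) (H : EstHyp F X t U₁ U₂) :
    OpShp F H.bS₁ H.bS₂ H.p₁ H.p₂ 4 (H.θ * (H.c * (F.Λ * F.K F.u)) ^ 15)
      (X.Q'₁ * (X.G'₁ * (X.G'₁ * (X.dQ't)))) := by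
  have hz : OpShp F H.bs₁ H.bS₂ H.p₁ H.p₂ 0 (H.θ * (H.c ^ 0 * (F.Λ * F.K F.u) ^ 0)) (X.dQ't) :=
    (OpShp.of_zon hF H.zQ't H.hθ).cst (by ring)
  have hl2 : OpShp F H.bs₁ H.bS₂ H.p₁ H.p₂ 2 (H.θ * (H.c ^ 1 * (F.Λ * F.K F.u) ^ 1))
      (X.G'₁ * (X.dQ't)) :=
    ((OpShp.fmul hF H.hP₁ H.mG'₁ hz (by norm_num) (by norm_num) H.c_nonneg (H.snn hF 0 0)).castK
      (by norm_num)).cst (by ring)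
  have hl1 : OpShp F H.bs₁ H.bS₂ H.p₁ H.p₂ 4 (H.θ * (H.c ^ 2 * (F.Λ * F.K F.u) ^ 2))
      (X.G'₁ * (X.G'₁ * (X.dQ't))) :=
    ((OpShp.fmul hF H.hP₁ H.mG'₁ hl2 (by norm_num) (by norm_num) H.c_nonneg (H.snn hF 1 1)).castK
      (by norm_num)).cst (by ring)
  have hl0 : OpShp F H.bS₁ H.bS₂ H.p₁ H.p₂ 4 (H.θ * (H.c ^ 3 * (F.Λ * F.K F.u) ^ 3))
      (X.Q'₁ * (X.G'₁ * (X.G'₁ * (X.dQ't)))) :=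
    ((OpShp.fmul hF H.hP₁ H.mQ'₁ hl1 (by norm_num) (by norm_num) H.c_nonneg (H.snn hF 2 2)).castK
      (by norm_num)).cst (by ring)
  exact hl0.mono hF (H.snn hF 3 3) (H.sle hF (by norm_num : 3 ≤ 15) (by norm_num : 3 ≤ 15))

/-- **THEOREM D′ (estimate half for `E = Q′G′²Q′*`)**: under (M), (L), (P) of `EstHyp` over a valid frame,
`𝔇(Q′G′²Q′*) ∈ 𝒮(4, 6θ(cΛK(u))¹⁵)` — row weight `(L^{j(y)}η)⁴·e^{−σ(d(y,y′) + dist(y,N) + dist(y′,N))}`, `σ = rate 20`.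
OURS (the printed claim is by reference to [2]). [cite: Balaban1985BackgroundPropagators, (3.97) p.412] -/
theorem EstHyp.dE_opShp (hF : F.Valid) (H : EstHyp F X t U₁ U₂) :
    OpShp F H.bS₁ H.bS₂ H.p₁ H.p₂ 4 (6 * H.θ * (H.c * F.Λ * F.K F.u) ^ 15) X.dE := by
  have s2 := (H.shape_e1 hF).sub (H.shape_e2a hF)
  have s3 := s2.sub (H.shape_e2b hF)
  have s4 := s3.sub (H.shape_e3a hF)
  have s5 := s4.sub (H.shape_e3b hF)
  have s6 := s5.add (H.shape_e4 hF)
  rw [H.dE_split]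
  exact s6.cst (by ring)

/-- the entrywise form of `EstHyp.dE_opShp`. [folklore] -/
theorem EstHyp.dE_entry (hF : F.Valid) (H : EstHyp F X t U₁ U₂) (x : S₁) (x' : S₂) :
    |X.dE x x'| ≤ 6 * H.θ * (H.c * F.Λ * F.K F.u) ^ 15 * F.sc (H.p₁ (H.bS₁ x)) ^ (4 : ℤ) *
      Real.exp (-(F.σ * (F.ρ (H.p₁ (H.bS₁ x)) (H.p₂ (H.bS₂ x')) + F.β (H.p₁ (H.bS₁ x)) + F.β (H.p₂ (H.bS₂ x'))))) :=
  (H.dE_opShp hF).entry x x'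

/-- **the core entry for `E`**: with `ψS` the cutoff `cutX f₁ f₂ ψ` on a common window of coarse points, on the core
`ψ(a) = ψ(v) = 1` the difference `(Q′₁G′₁²Q′*₁)(a,v) − (Q′₂G′₂²Q′*₂)(a,v)` obeys the bound of `dE_entry`
(`B9SectCDiff.sub_eq_neg_tdef_apply`) — the form the b09 consumer chain (GAPS G-B9-05R (iv)) takes. OURS.
[cite: Balaban1985BackgroundPropagators, (3.97) p.412] -/
theorem EstHyp.core_dE_entry (hF : F.Valid) (H : EstHyp F X t U₁ U₂)
    {mS : Type uu} [Fintype mS] {f₁ : mS → S₁} {f₂ : mS → S₂} (hf₁ : Function.Injective f₁)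
    (hf₂ : Function.Injective f₂) {ψ : mS → ℝ} (hψ : X.ψS = cutX f₁ f₂ ψ) {a v : mS} (ha : ψ a = 1)
    (hv : ψ v = 1) :
    |X.E₁ (f₁ a) (f₁ v) - X.E₂ (f₂ a) (f₂ v)| ≤ 6 * H.θ * (H.c * F.Λ * F.K F.u) ^ 15 *
      F.sc (H.p₁ (H.bS₁ (f₁ a))) ^ (4 : ℤ) * Real.exp (-(F.σ * (F.ρ (H.p₁ (H.bS₁ (f₁ a))) (H.p₂ (H.bS₂ (f₂ v)))
        + F.β (H.p₁ (H.bS₁ (f₁ a))) + F.β (H.p₂ (H.bS₂ (f₂ v)))))) := by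
  have h : X.E₁ (f₁ a) (f₁ v) - X.E₂ (f₂ a) (f₂ v) = -(X.dE (f₁ a) (f₂ v)) := by
    rw [TwoSeq.dE, hψ]
    exact B9SectCDiff.sub_eq_neg_tdef_apply hf₁ hf₂ X.E₁ X.E₂ ha hv
  rw [h, abs_neg]
  exact H.dE_entry hF _ _

end InstanceE

end Literature.MathematicalPhysics.QuantumFieldTheory.Balaban1983to89.B9SectCDiffEstimate
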